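import Summits.QuantumFields.YangMills.Theses.ParabolicTrajectory
import Literature.MathematicalPhysics.QuantumFieldTheory.LatticeGaugeProofs
import Literature.MathematicalPhysics.QuantumFieldTheory.BalabanRegulatorChart
import Summits.QuantumFields.YangMills.Theorems.BalabanStepParabolic.Negative.ScalingLimitInRegion
import Summits.QuantumFields.YangMills.Theorems.BalabanStepParabolic.Negative.OverTunedLimit
import Summits.QuantumFields.YangMills.Theorems.ContinuumLimitOnTrajectory.Negative.ThreePoint
import Literature.MathematicalPhysics.QuantumLattice.GaugeGroupsProofs
import Mathlib.Analysis.Calculus.BumpFunction.InnerProduct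
import Mathlib.Analysis.Calculus.BumpFunction.FiniteDimension
import Mathlib.Analysis.SpecificLimits.Normed
import Summits.QuantumFields.YangMills.Theorems.ParabolicTrajectoryBalabanStepParabolicRegulatorChartBridge

/-!
# Disproof of `BalabanStepParabolic` (crux `stmt-QuantumFields-9684`) — the standing adversary's work file

Crux (route `ParabolicTrajectory`, rank 3):
`∀ G (compact simple Lie) r, ∃ M₀, ∀ M ≥ M₀, Nonempty (BalabanBanachStep G r M)`.

**Verdict after cycle 4 (gen 4, v10, 2026-08-16): REFUTED MODULO A PHYSICAL HYPOTHESIS (misstated (4c)) — see §P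
(NEW): the typed (4c) admits FACE-TOUCHING tuples (off-diagonal in `ℝ⁴ⁿ`, periodisations in contact on the torus);
for them the forced data diverge like `(M^k/16)³ β⁻²` (physics) while every inhabitant forces them to `0`
(`overtuned_trivial_of_nonempty`).  Kernel-checked: `FaceContactHypothesis → ¬ BalabanStepParabolic`
(`FaceContactHypothesis` = plaquette-covariance positivity ∧ nearest-neighbour covariance `≥ cβ^{-p}` for `SU(2)`,
both open).  PLANNER: restrict (4c) to tuples supported in the OPEN fundamental cube.  Cycle-3 text follows.**

**Verdict after cycle 3 (gen 3, v9, 2026-08-16): NOT REFUTED — and the reason is now a THEOREM.**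
The crux resists at ODD block factors because its continuity field (4c), for EVERY inhabitant and EVERY
choice of the Banach space `E`, forces the genuine dilated Wilson plaquette data along the inhabitant's own
tuning to CONVERGE (§V `forced_scaling_limit`: the fibre coordinate of deep Wilson-orbit points is slaved to
the coupling coordinate, so deep orbit points converge whenever their couplings do, and (4c) turns this into
a continuum/thermodynamic limit of `wilsonCentredSchwinger r.ρ (betaOf g_j) L'_j (c g_j) n σ (dilate^{k_j} f)`,
`β_j → ∞`, tori `M^{k_j}(2L+1) → ∞`, limit a function of the arrival coupling only).  It is MIS-DESIGNED
elsewhere: even `M` are dead weight (§B; for the PICKED line's object `RegulatorChart` as well, §G), the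
normalisation fields `b₀`, `κ` pin nothing (§R), species generality is illusory (§S), and
`IsCompactSimpleLieGroup` guards content, not truth (§H, §G).  No refutation exists short of proving
NON-convergence of 4-d Wilson Yang–Mills plaquette correlators along EVERY admissible tuning.  Everything
below is sorry-free except where a docstring says PENDING (nothing is, at v9).

## Findings, indexed (theorem names in this namespace)

* **§P PERIODIC FACE CONTACT (NEW, cycle 4)** `siteCov`, `PlaquetteCovNonneg` (H₁), `AdjacentCovLowerBound` (H₂),
  `facePair`, `isOffDiagonal_facePair`, `wilsonCentredSchwinger_two_eq`, `dist_sample_le`, **`faceData_lower_bound`**,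
  **`not_nonempty_of_faceContact`** (H₁ → H₂ → odd `M` → `¬ Nonempty (BalabanBanachStep G r M)`),
  **`balabanStepParabolic_false_of_faceContactHypothesis`** (`FaceContactHypothesis → ¬ BalabanStepParabolic`).
  The first KILL of the typed crux, conditional only on two standard (unproved) weak-coupling facts; unconditionally
  it needs a LOWER bound on nearest-neighbour plaquette covariances + positivity — not a non-convergence theorem.

* **§F1 orbit recursion** `orbitRec`, `orbitRec_mul`, `orbitRec_pow_mul`, `continuous_orbitRec`,
  `blockContract` (inverse of `blockDilate`): peeling factors `M` off the torus size makes the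
  covariance axiom (4a) hold IDENTICALLY for ANY germ — (4a) has no content of its own
  (structural finding F1 of `Ideas/structuralfindings.md`, mechanised).
* **§A no-(4c) junk, every `M ≥ 2`**: `PreStep` (= `BalabanBanachStep` minus
  `continuousOn_expect`, with `toPreStep`), `preStepJunk`, **`preStep_nonempty`**: chart `ℝ × ℝ`,
  `g ↦ g + (log M) g³`, halving fibre, `yW g = (1, g)`, `betaOf = 1/g²`, functional `expectJ`
  (`expectJ_step` = (4a) identically, `expectJ_orbit`/`expectJ_wilson` = (4b) by decoding `(k, g)`
  from the fibre coordinate).  ALL content of the crux is in (4c).  (Cycle 1 §A, rebuilt.)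
* **§B even `M` is dead weight**: `evenStep`, **`nonempty_of_even`** (thin chart `E = ℝ`,
  `yW ≡ 1`): for EVEN `M` only the Wilson arc is ever pinned (`M ∤ 2L+1`), so the FULL structure
  is inhabited from `CurvatureTorusRegular r` alone (β-continuity and β → ∞ convergence of the
  genuine centred plaquette `n`-point functions on each FIXED odd torus — RG-free, PROVED in §E).
  **`balabanStepParabolic_even`** (UNCONDITIONAL): `∀ G r M, Even M → 2 ≤ M → Nonempty …`;
  **`balabanStepParabolic_iff_odd`** (UNCONDITIONAL): `BalabanStepParabolic ↔
  BalabanStepParabolicOdd`.  PLANNER: restate with `Odd M →` (equivalent, cosmetic) or let (4b)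
  pin ALL tori.
* **§E finite-torus regularity (re-proved this generation, ~700 lines)**: `integral_wilsonMeasure_eq`
  (Gibbs reweighting of product Haar), `continuous_wilsonCentredSchwinger` (continuity in `β ∈ ℝ`
  of the centred `n`-point functions of ANY species string, by dominated convergence jointly in
  `(β, centrings)`), `tendsto_expect_wilsonAction` (`⟨S_W⟩_β → 0`: Laplace concentration, using
  unitarity `Re tr ρ ≤ N` and `Haar{S_W < t} > 0`), `abs_curvCorr_le` (`|curvCorr_{k+1}(β)| ≤
  K ⟨S_W⟩_β` via `Pmax − P(τₓŨ) ≤ 16 S_W(U)`), **`curvatureTorusRegular_holds`**.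
* **§T transport (odd `M`, any inhabitant)**: `expect_orbit_wilson` — at depth `k` of the orbit of
  the Wilson point `(g, yW g)` the functional on the torus `2L+1` IS Wilson's centred `n`-point
  function at `β = betaOf g` on the torus `M^k(2L+1)` with `k`-fold dilated test functions;
  `tendsto_wilson_of_tendsto_orbit` — any in-chart convergent sequence of such orbit points forces
  CONVERGENCE of those genuine data (joint limit `β_j → ∞`, volume `→ ∞`, scale `M^{k_j} → ∞`
  along the inhabitant's own tuning).  This is why odd `M` resists.  (Cycle 1 §D, rebuilt.)
* **§L orbit length (NEW, cycle 2)**: `orbit_mem_chart`, `wilson_data_in_chart` — with explicit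
  `c₁ = b + C(δ + R)` and threshold `gₛ`, the Wilson orbit from coupling `g` stays in the chart for
  every `k ≤ (1/g² − 1/gₛ²)/(2c₁)`: the pinned tori reach side `(2L+1)·M^k` with `k` LINEAR in
  `betaOf g ≈ κ/g²`, i.e. volumes EXPONENTIAL in `β`.  Quantifies the content: (4c) is a statement
  about Wilson plaquette correlators at `β → ∞` on tori of side up to `exp((log M/(2c₁κ)) β)`.
* **§C corner (any `M`)**: `tendsto_wilson_corner` — continuity at `(0, yW 0)` forces the Wilson
  data at `β = betaOf g` to converge as `g → 0⁺` on every FIXED odd torus; `atTop_le_map_betaOf`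
  (filter inversion of `betaOf`), `tendsto_curvCorr_atTop` — hence the genuine centred plaquette
  `n`-point functions converge as `β → ∞` on each fixed torus.  TRUE (limit `0`, `n ≥ 1`):
  a near-miss, not a kill.  (Cycle 1 §C, rebuilt.)
* **§R `b₀` unpinned (NEW, cycle 2)**: `rescale` (coupling coordinate `g ↦ l g`, every field
  re-verified), **`exists_b₀_eq`**: an inhabited `BalabanBanachStep G r M` is inhabited with ANY
  positive value of the field `b₀`; `rescale_κ_mul_b₀`: only `b₀ κ` is invariant — and NO field
  relates `b₀ κ` (the slope `β_{k+1} − β_k ≈ −2 b₀ κ log M`) to `(G, r)`.  So the informal clause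
  "`b₀(G) = 11 C₂(G)/(48π²)`, uniform in `G`" is not in the typed crux, and an OVER- or UNDER-TUNED
  inhabitant (unphysical slope) would satisfy the letter of the crux while being useless to
  `ContinuumLimitOnTrajectory` (whose sequences need `N₁(k) → θ > 0`).  PLANNER: if the crux is to
  feed the route, pin `b₀ κ` (e.g. `κ b₀ = 2 r.N · afCoefficient r.N` in Wilson normalisation) or add
  a non-triviality clause on `expect` along the centre curve.

* **§S species generality is illusory (NEW, cycle 2)**: `curvatureOnly`, **`exists_curvatureOnly`** —
  an inhabited `BalabanBanachStep G r M` is inhabited by a structure with normalisations `c g s = 0`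
  for every `s ≠ r.curvature` and realisation functional ZERO on every species string that is not
  pure curvature (same chart, step, Wilson embedding, `betaOf`; unchanged on pure-curvature
  strings).  So the typed crux constrains only the plaquette field `tr F²`; the "all local
  gauge-invariant fields" needed by `IsYangMillsFor` downstream are unconstrained.  PLANNER: pin `c`.

* **§H load-bearing analysis (NEW, cycle 2)**: `trivialGroupStep`, **`nonempty_of_subsingleton`**,
  `balabanStep_punit` — dropping the crux's only hypothesis `IsCompactSimpleLieGroup G` does not
  falsify it but TRIVIALISES it: for a one-element gauge group (admitted by `LatticeRep`) the FULL
  structure is inhabited for every `M ≥ 2`, odd included, by constants.  No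
  `_false_without_IsCompactSimpleLieGroup` theorem exists; the hypothesis excludes junk `G`.

* **§V fibre slaving and the FORCED SCALING LIMIT (NEW, cycle 3; landed as `Negative/FibreSlaving`,
  `Negative/ForcedScalingLimit`, restated below as `slaving_dichotomy'`, `deep_orbit_cauchySeq'`,
  `forced_scaling_limit'`)**: for ANY inhabitant `S` — (V.1) one-step two-point estimates
  `‖ΔΨ‖ ≤ θ'‖Δy‖ + C(2τ+δ)|Δg|`, `|Δφ| ≥ (1 − Cτ²(τ+δ))|Δg| − Cτ³‖Δy‖`; (V.2) the cone `‖Δy‖ ≤ λ|Δg|`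
  (`λ = 2C(2τ+δ)/(1−θ')`) is forward invariant along two orbit segments and outside it `‖Δy‖` contracts by
  `ϑ = (1+θ')/2`, so `‖Δy_m‖ ≤ λ|Δg_m| + ϑ^m‖Δy_0‖`; (V.3) admissible Wilson orbit points (`0 < g ≤ τ₀`,
  `2c₁k ≤ 1/g² − 1/τ₀²`) sit in the slaving region from depth `i₀` on; (V.4) deep orbit points are
  `λ`-Lipschitz functions of their coupling up to `ϑ^{depth}·2δ`, deep sequences with convergent arrival
  couplings CONVERGE in `ℝ × E` (any `E`!), the limit depending on the coupling only; (V.5)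
  **`forced_scaling_limit`** (odd `M`): `∃ g⋆ > 0, ∃ Q : ℝ → chart`, admissible deep sequences exist, and along
  EVERY admissible deep sequence with arrival couplings `→ t` the genuine Wilson data converge to
  `expect (Q t) (2L+1) n σ f`.  This mechanises PICKED.md's forced-accumulation note and strengthens it from
  "some subsequence" to "every admissible sequence": NO chart `E` can dodge the convergence content of (4c).
  (V.6, `Negative/ScalingLimitInRegion`, restated as `forced_scaling_limit_of_region'`) the INTRINSIC form:
  admissible = the orbit stays in `[0,τ₀] × B̄_R` up to its depth (no a-priori window), for EVERY cap
  `τ₀ ≤ τmax`; (V.7, `Negative/ScalingLimitReach`, `exists_reaching_sequence` — wrapper in v10 once the farm has built it) REACHABILITY: deep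
  couplings increase strictly (`φ ≥ g + (b/2)g³` once the fibre has decayed), so every level `t` with
  `t + c₁t³ ≤ τ` is crossed in-region at depth `≥ (1/g² − 1/t²)/(2c₁) → ∞` — for EVERY inhabitant the forced
  scaling limits exist at a `c₁t³`-DENSE set of running couplings `t' ∈ [t, t + c₁t³]`; (V.8,
  `Negative/ScalingLimitContinuity`, `forced_scaling_limit_continuous`) the graph `Q` is Lipschitz on the
  reachable couplings and the forced limits `t ↦ expect (Q t) (2L+1) n σ f` are CONTINUOUS there.
* **§G the line's object (NEW, cycle 3)**: the PICKED line `perfect-action-regulator-chart` reduces the crux to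
  `∀ G r, ∃ M₀, ∀ M ≥ M₀, Nonempty (RegulatorChart G r M)` (stubs 2–3 landed by the lead).  That object has the
  crux's dead weight verbatim: even `M` junk-inhabited (the LEAD's `nonempty_regulatorChart_of_even` /
  `regulatorChartExists_iff_odd` in `Theorems/ParabolicTrajectoryBalabanStepParabolicRegulatorChartEven.lean`,
  found independently here and dropped as duplicate), and — below, `regulatorChartTrivialGroup`,
  `regulatorChart_nonempty_of_subsingleton`, `regulatorChart_punit` — inhabited at a one-element gauge group
  for EVERY `M ≥ 2` by the thin smooth chart (`smoothHalfChart_thin'`, exact normal form `C = 0`) and constant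
  chart functions.  Via stub 3 every §T/§L/§V statement applies to the `BalabanBanachStep` image of a
  `RegulatorChart`; `corr_step`'s "inside the chart only" clause is no relief (Wilson orbits stay inside, §L).

## Why no UNCONDITIONAL kill (the adversary's honest summary; but see §P for the kill modulo H)

0. (cycle 4) §P kills the typed crux GIVEN (H₁) positivity of plaquette covariances and (H₂) a `cβ^{-p}` lower bound
   on nearest-neighbour plaquette covariances at weak coupling — the typed (4c) lets ℝ⁴ⁿ-off-diagonal tuples collide
   on the torus.  Without H the items below still stand for the REPAIRED statement (supports in the open cube).

1. Junk `G`/`r` are excluded: `IsCompactSimpleLieGroup` demands `ConnectedSpace G` and a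
   non-commuting pair, `LatticeRep` demands `Function.Injective ρ`; no finite/abelian/trivial-rep
   instance exists, so (4b) always pins genuine non-abelian Wilson data.
2. Every structural escape tried closes: F cannot eject Wilson points from the chart in `O(1)`
   steps (§L: `≥ c/g²` steps forced); orbits cannot revisit the Wilson arc or cross (chart
   `ℝ × ℝ` encodes `(k, g)` injectively, §A), so (4a)+(4b) are jointly consistent WITHOUT (4c)
   for every `M`; `c g s` is free off the curvature species (set `0`), `betaOf`'s `O(1)` slack `K`
   and the `O(g⁴)` slack of `φ` only reparametrise the tuning.
3. What is left is analytic and TRUE-looking: continuity of transported Wilson data at the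
   accumulation set of Wilson orbits (the centre curve `y = h(g)`, forced by `ParabolicCentreCurve`
   for ANY inhabitant, finite- or infinite-dimensional `E`).  By §R the inhabitant may over-tune
   (`b₀ κ` huge ⇒ only `ε β` RG steps in the chart, all fields small with high probability, NO
   large-field/R-operation regime) — but the precision then required is exactly the perturbative
   size `g⁴ ∼ β⁻²` of the dimensionless curvature two-point function with its `|x−y|⁻⁸` decay,
   uniformly over `log(scale) ≲ εβ` scales: genuine small-field multi-scale analysis, no slack.
   Under-tuning needs weak-coupling exponential clustering (the IR gap).  Physical tuning is
   Bałaban's programme plus convergence.  None is refutable; none is cheap.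
4. A refutation `¬ BalabanStepParabolic` needs `IsEmpty (BalabanBanachStep G r M)` for some
   `(G, r)` and infinitely many ODD `M` (even `M` are inhabited, §B), i.e. DIScontinuity of the
   transported Wilson data for EVERY admissible `(φ, Ψ, yW, betaOf, c)` — a theorem about
   non-convergence of 4-d Yang–Mills correlators along all tunings.  Out of reach and presumably
   false.  Cycle 3 makes the converse precise: §V `forced_scaling_limit` — any inhabitant DOES deliver such a
   convergence, along every admissible deep sequence, for any `E`.

## Landed companions (importable; `Summits/QuantumFields/YangMills/Theorems/BalabanStepParabolic/Negative/`)
`OrbitRecursion` (§F1, p70677) · `NoContinuityJunk` (§A, p71213) · `OrbitTransport` (§T §L §C, p70637) ·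
`RescaleCoupling` (§R, p70615) · `CurvatureOnly` (§S, p71462) · `TrivialGroup` (§H, p71587) ·
`TorusAction`/`TorusGibbs`/`TorusRegularity` (§E, p71274/p71433/p71563) · `ThinChartReduction`
(`nonempty_of_thinChartFunctional`: all structure bookkeeping discharged — to inhabit the structure
it suffices to give `b, κ, c` and a functional on the thin junk chart `ℝ × ℝ²` satisfying verbatim
(4a) (free by `orbitRec`), (4b), (4c); p71731) · `EvenRedundant` (§B unconditional: `nonempty_of_even`, `balabanStepParabolic_iff_odd`,
`balabanStepParabolic_even_half`; p71802) · `FibreSlaving` (§V.1–3, p72746) · `ForcedScalingLimit`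
(§V.4–5, p73078) · `ScalingLimitInRegion` (§V.6, p73246) · `ScalingLimitReach` (§V.7, p73470) ·
`ScalingLimitContinuity` (§V.8, p73480) · `OverTunedLimit` (drefute gen 2: `overtuned_trivial_of_nonempty`, used by §P) ·
`FaceContactSetup` / `FaceContact` (§P, gen 4 — PROPOSED, p-ids in the crux item's evidence notes once the gate answers).

## Not applicable (checked, cycle 2)
* Renormalisation-group "pathologies" (non-Gibbsianness of block-averaged measures, van Enter–
  Fernández–Sokal 1993 and successors) do not bite the TYPED crux: `E` and `expect` are abstract
  (existentially chosen), no Gibbsian/quasi-local representation of the renormalised densities is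
  demanded, and on a finite torus every step is a finite-dimensional integral.  They bite only the
  INFORMAL reading "E = quasi-local action functionals".  (Literature search for printed no-go
  results on Bałaban-type maps: cycle 2 `lit search` rc 75; cycle 3 `lit search` rc 75 ×3 (searchd down),
  `lit galaxy search --star pdf --mode bm25` ×2 (27 rows): nearest = the non-Gibbsianness family — van Enter,
  "The Renormalization-Group peculiarities of Griffiths and Pearce: what have we learned?" arXiv:cond-mat/9810405;
  R. Fernández, "Random fields in lattices: the Gibbsianness issue" (Resenhas IME-USP); Oberwolfach Report
  26/2016 "The Renormalization Group" (doi:10.4171/OWR/2016/26) — none states an obstruction for an ABSTRACT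
  Banach chart, and no printed no-go for Bałaban's gauge-theory map was found.)
* No hypothesis of the crux is load-bearing for truth (§H); no natural strengthening tried is
  refutable by a small model: "all `M ≥ 2`" (even `M` true, §B), "drop `IsCompactSimpleLieGroup`"
  (true at the trivial group, §H), "`M < 2`" is excluded by `BalabanBanachStep.two_le_M` (empty).

## Provenance
Generation 1 of this seat (refuter-cdisprove-stmt-QuantumFields-9684-0, cycle 1, 1730 lines,
rc 0, 0 sorry) attached its file only as item evidence (`run/gate/evidence/…`, not mounted in later
jails) and never published it to the crux directory; this generation rebuilt the content from the
evidence NOTES and extends it (§L, §R new; §E re-proved).  Later generations: READ THIS FILE via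
`ledger crux cat stmt-QuantumFields-9684 Disproof.lean` and EXTEND it.
-/

open scoped SchwartzMap
open MeasureTheory Filter Topology
open Literature.MathematicalPhysics.QuantumFieldTheory Literature.MathematicalPhysics.AQFT
open Literature.MathematicalPhysics.QuantumLattice
open Literature.Probability.LatticeModels (box Torus.proj Torus.proj_apply)

noncomputable section

namespace Summit.QuantumFields.YangMills.Cruxes.BalabanStepParabolic.Disproof

/-! ### F1: the base-torus recursion that makes (4a) hold identically -/

section OrbitRec

variable {P α β : Type} (M : ℕ) (F : P → P) (T : α → α) (e : P → ℕ → α → β)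

/-- **Orbit recursion** (structural finding F1 of `Ideas/structuralfindings.md`, recast as a
well-founded recursion on the torus size): given ANY germ `e p S a` and a step `F` on chart points,
a pull-back `T` on test data, define `orbitRec p S a` by peeling factors `M` off `S`:
`orbitRec p (M·S) a = orbitRec (F p) S (T a)` and `orbitRec p S a = e p S a` when `M ∤ S` or `S = 0`.
With `T` a left inverse of block dilation this makes the covariance axiom (4a) of
`BalabanBanachStep` hold IDENTICALLY, for every germ. -/
def orbitRec (hM : 2 ≤ M) : P → ℕ → α → β
  | p, S, a =>
    if _h : S ≠ 0 ∧ M ∣ S then orbitRec hM (F p) (S / M) (T a) else e p S a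
  termination_by _ S _ => S
  decreasing_by exact Nat.div_lt_self (Nat.pos_of_ne_zero _h.1) (by omega)

variable {M} (hM : 2 ≤ M)

theorem orbitRec_of_not (p : P) (S : ℕ) (a : α) (h : ¬ (S ≠ 0 ∧ M ∣ S)) :
    orbitRec M F T e hM p S a = e p S a := by
  rw [orbitRec]; simp [h]

theorem orbitRec_zero (p : P) (a : α) : orbitRec M F T e hM p 0 a = e p 0 a :=
  orbitRec_of_not F T e hM p 0 a (by simp)

theorem orbitRec_mul (p : P) {S : ℕ} (hS : S ≠ 0) (a : α) :
    orbitRec M F T e hM p (M * S) a = orbitRec M F T e hM (F p) S (T a) := by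
  have hM0 : M ≠ 0 := by omega
  have h : M * S ≠ 0 ∧ M ∣ M * S := ⟨Nat.mul_ne_zero hM0 hS, dvd_mul_right M S⟩
  rw [orbitRec, dif_pos h, Nat.mul_div_cancel_left S (by omega)]

/-- Full unfolding along `k` peeled factors. [folklore] -/
theorem orbitRec_pow_mul (p : P) {S : ℕ} (hS : S ≠ 0) (a : α) (k : ℕ) :
    orbitRec M F T e hM p (M ^ k * S) a = orbitRec M F T e hM (F^[k] p) S (T^[k] a) := by
  induction k generalizing p a with
  | zero => simp
  | succ k ih =>
    have hM0 : M ≠ 0 := by omega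
    rw [pow_succ', mul_assoc, orbitRec_mul F T e hM p (Nat.mul_ne_zero (pow_ne_zero k hM0) hS),
      ih (F p) (T a)]
    simp only [Function.iterate_succ_apply]

/-- Continuity is inherited from the germ through the recursion. [folklore] -/
theorem continuous_orbitRec [TopologicalSpace P] [TopologicalSpace β] (hF : Continuous F)
    (he : ∀ S a, Continuous fun p => e p S a) (S : ℕ) (a : α) :
    Continuous fun p => orbitRec M F T e hM p S a := by
  induction S using Nat.strong_induction_on generalizing a with
  | _ S ih =>
    by_cases h : S ≠ 0 ∧ M ∣ S
    · obtain ⟨S', rfl⟩ := h.2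
      have hS' : S' ≠ 0 := by rintro rfl; exact h.1 (by simp)
      have hlt : S' < M * S' := by
        have : 1 * S' < M * S' := Nat.mul_lt_mul_of_pos_right (by omega) (Nat.pos_of_ne_zero hS')
        simpa using this
      simp_rw [orbitRec_mul F T e hM _ hS']
      exact (ih S' hlt (T a)).comp hF
    · simp_rw [orbitRec_of_not F T e hM _ S _ h]
      exact he S a

end OrbitRec

/-! ### Block contraction: the inverse of `blockDilate` -/

/-- `blockContract M f = f ∘ (M • ·)`, the inverse of `blockDilate M` for `M ≠ 0`
(junk: identity at `M = 0`). -/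
def blockContract (M : ℕ) :
    𝓢(EuclideanSpace ℝ (Fin 4), ℝ) →L[ℝ] 𝓢(EuclideanSpace ℝ (Fin 4), ℝ) :=
  if hM : M = 0 then ContinuousLinearMap.id ℝ _
  else
    SchwartzMap.compCLMOfContinuousLinearEquiv ℝ
      ((LinearEquiv.smulOfNeZero ℝ (EuclideanSpace ℝ (Fin 4)) (M : ℝ)
          (Nat.cast_ne_zero.2 hM)).toContinuousLinearEquiv)

@[simp] theorem blockContract_apply {M : ℕ} (hM : M ≠ 0) (f : 𝓢(EuclideanSpace ℝ (Fin 4), ℝ))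
    (x : EuclideanSpace ℝ (Fin 4)) : blockContract M f x = f ((M : ℝ) • x) := by
  simp only [blockContract, hM, ↓reduceDIte, SchwartzMap.compCLMOfContinuousLinearEquiv_apply,
    Function.comp_apply, LinearEquiv.coe_toContinuousLinearEquiv', LinearEquiv.smulOfNeZero_apply]

theorem blockDilate_blockContract {M : ℕ} (hM : M ≠ 0) (f : 𝓢(EuclideanSpace ℝ (Fin 4), ℝ)) :
    blockDilate M (blockContract M f) = f := by
  ext x
  have hM' : (M : ℝ) ≠ 0 := Nat.cast_ne_zero.2 hM
  rw [blockDilate_apply hM, blockContract_apply hM, smul_smul, mul_inv_cancel₀ hM', one_smul]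

theorem blockContract_blockDilate {M : ℕ} (hM : M ≠ 0) (f : 𝓢(EuclideanSpace ℝ (Fin 4), ℝ)) :
    blockContract M (blockDilate M f) = f := by
  ext x
  have hM' : (M : ℝ) ≠ 0 := Nat.cast_ne_zero.2 hM
  rw [blockContract_apply hM, blockDilate_apply hM, smul_smul, inv_mul_cancel₀ hM', one_smul]

theorem blockDilate_iterate_blockContract_iterate {M : ℕ} (hM : M ≠ 0) (k : ℕ)
    (f : 𝓢(EuclideanSpace ℝ (Fin 4), ℝ)) :
    (blockDilate M)^[k] ((blockContract M)^[k] f) = f := by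
  induction k generalizing f with
  | zero => rfl
  | succ k ih =>
    rw [Function.iterate_succ_apply', Function.iterate_succ_apply, ih,
      blockDilate_blockContract hM]

/-- Pull-back of a tuple of test functions by block contraction. -/
def contractTuple (M : ℕ) {n : ℕ} (f : Fin n → 𝓢(EuclideanSpace ℝ (Fin 4), ℝ)) :
    Fin n → 𝓢(EuclideanSpace ℝ (Fin 4), ℝ) := fun i => blockContract M (f i)

@[simp] theorem contractTuple_dilate {M : ℕ} (hM : M ≠ 0) {n : ℕ}
    (f : Fin n → 𝓢(EuclideanSpace ℝ (Fin 4), ℝ)) :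
    contractTuple M (fun i => blockDilate M (f i)) = f := by
  funext i; simp [contractTuple, blockContract_blockDilate hM]

theorem contractTuple_iterate (M : ℕ) {n : ℕ} (k : ℕ)
    (f : Fin n → 𝓢(EuclideanSpace ℝ (Fin 4), ℝ)) :
    (contractTuple M)^[k] f = fun i => (blockContract M)^[k] (f i) := by
  induction k generalizing f with
  | zero => rfl
  | succ k ih =>
    rw [Function.iterate_succ_apply, ih]
    funext i
    rw [Function.iterate_succ_apply]
    rfl

theorem dilate_iterate_contractTuple_iterate {M : ℕ} (hM : M ≠ 0) {n : ℕ} (k : ℕ)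
    (f : Fin n → 𝓢(EuclideanSpace ℝ (Fin 4), ℝ)) :
    (fun i => (blockDilate M)^[k] (((contractTuple M)^[k] f) i)) = f := by
  rw [contractTuple_iterate]
  funext i
  exact blockDilate_iterate_blockContract_iterate hM k (f i)


/-! ### §0  RG-free objects: centred plaquette correlators on a fixed torus -/

section Common

variable {G : Type} [Group G] [TopologicalSpace G] [IsTopologicalGroup G] [CompactSpace G]
  [MeasurableSpace G] [BorelSpace G] (r : LatticeRep G)

/-- The genuine **centred plaquette (`tr F²`) `n`-point function** on the torus of side `2L+1`
at inverse coupling `β`, unit normalisation — an RG-free, finite-dimensional object. -/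
def curvCorr (β : ℝ) (L n : ℕ) (f : Fin n → 𝓢(EuclideanSpace ℝ (Fin 4), ℝ)) : ℝ :=
  wilsonCentredSchwinger r.ρ β L (fun _ => 1) n (fun _ => r.curvature) f

/-- **Finite-torus regularity of Wilson's lattice gauge theory** (RG-free): on every fixed odd
torus the centred plaquette `n`-point functions are continuous in `β ∈ (0, ∞)` and converge as
`β → ∞`. TRUE: theorem `curvatureTorusRegular_holds` of §E below (finite-dimensional integrals of bounded
measurable functions against `e^{-β S_W} d Haar`; the `β → ∞` limit is `0` for `n ≥ 1` by
concentration of Wilson's measure on `{S_W = 0}`). Kept as a named predicate so that §B can be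
stated cleanly. -/
def CurvatureTorusRegular : Prop :=
  ∀ (L n : ℕ) (f : Fin n → 𝓢(EuclideanSpace ℝ (Fin 4), ℝ)),
    ContinuousOn (fun β => curvCorr r β L n f) (Set.Ioi 0) ∧
      ∃ ℓ : ℝ, Tendsto (fun β => curvCorr r β L n f) atTop (𝓝 ℓ)

open Classical in
/-- Normalisations killing every species but the curvature. -/
def cInd : YMSpecies G → ℝ := fun s => if s = r.curvature then 1 else 0

@[simp] theorem cInd_curvature : cInd r r.curvature = 1 := by simp [cInd]

end Common

/-! ### §E  Finite-torus regularity of Wilson's lattice gauge theory (RG-free) -/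


/-- `Re tr U ≤ N` for a unitary `N × N` matrix. [folklore] -/
theorem re_trace_le_of_unitary {N : ℕ} {U : Matrix (Fin N) (Fin N) ℂ}
    (hU : U ∈ Matrix.unitaryGroup (Fin N) ℂ) : U.trace.re ≤ N := by
  calc U.trace.re ≤ ‖U.trace‖ := Complex.re_le_norm _
    _ = ‖∑ i, U i i‖ := rfl
    _ ≤ ∑ i, ‖U i i‖ := norm_sum_le _ _
    _ ≤ ∑ _i : Fin N, (1 : ℝ) := Finset.sum_le_sum fun i _ => entry_norm_bound_of_unitary hU i i
    _ = N := by simp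

/-- `proj (x + eᵢ) = proj x + eᵢ` on the discrete torus. [folklore] -/
theorem proj_add_single (T : ℕ) (x : Fin 4 → ℤ) (i : Fin 4) :
    Torus.proj T (x + Pi.single i 1) = Torus.proj T x + Pi.single i 1 := by
  funext k
  by_cases h : k = i
  · subst h; simp [Torus.proj_apply]
  · simp [Torus.proj_apply, h]

section ShiftLift

variable {G : Type} [Group G] [MeasurableSpace G]

/-- The plaquette at the origin of the shifted periodic lift is the torus plaquette at `x mod T`. [folklore] -/
theorem plaquetteHolonomyZd_shift_lift (T : ℕ) (U : GaugeConfig 4 T G) (x : Fin 4 → ℤ)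
    (i j : Fin 4) :
    plaquetteHolonomyZd (configShift (-x) (torusLift T U)) 0 i j =
      plaquetteHolonomy U (Torus.proj T x) i j := by
  simp only [plaquetteHolonomyZd, configShift_apply, torusLift, Function.comp_apply, torusEdge,
    plaquetteHolonomy, Literature.MathematicalPhysics.QuantumFieldTheory.Site.shift, sub_neg_eq_add]
  rw [zero_add, zero_add, zero_add, add_comm (Pi.single i 1) x, add_comm (Pi.single j 1) x,
    proj_add_single, proj_add_single]

omit [Group G] in
/-- Shifting by `0` does nothing. [folklore] -/
theorem configShift_zero' (V : LGConfig 4 G) : configShift 0 V = V := by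
  ext e; simp

end ShiftLift

section TorusRegularity

variable {G : Type} [Group G] [TopologicalSpace G] [IsTopologicalGroup G] [CompactSpace G]
  [MeasurableSpace G] [BorelSpace G] (r : LatticeRep G)

omit [IsTopologicalGroup G] [MeasurableSpace G] [BorelSpace G] in
include r in
/-- A faithful continuous matrix representation makes the compact group second countable. [folklore] -/
theorem secondCountable_of_latticeRep : SecondCountableTopology G :=
  (Continuous.isClosedEmbedding r.continuous r.injective).isEmbedding.secondCountableTopology

/-- The deficit `N − Re tr ρ(U_p)` of the torus plaquette at `x` in the `(i, j)` plane. -/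
def pDef {T : ℕ} (U : GaugeConfig 4 T G) (x : Fin 4 → ZMod T) (i j : Fin 4) : ℝ :=
  (r.N : ℝ) - (r.ρ (plaquetteHolonomy U x i j)).trace.re

omit [IsTopologicalGroup G] [CompactSpace G] [MeasurableSpace G] [BorelSpace G] in
/-- Plaquette deficits are non-negative (unitarity). [folklore] -/
theorem pDef_nonneg {T : ℕ} (U : GaugeConfig 4 T G) (x : Fin 4 → ZMod T) (i j : Fin 4) :
    0 ≤ pDef r U x i j :=
  sub_nonneg.2 (re_trace_le_of_unitary (r.mem_unitary _))

omit [IsTopologicalGroup G] [CompactSpace G] [MeasurableSpace G] [BorelSpace G] in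
/-- The Wilson action is the sum of the plaquette deficits. [folklore] -/
theorem wilsonAction_eq_sum_pDef {T : ℕ} [NeZero T] (U : GaugeConfig 4 T G) :
    wilsonAction r.ρ U = ∑ p : Plaquette 4 T, pDef r U p.1 p.2.1.1 p.2.1.2 := by
  unfold wilsonAction pDef; rfl

omit [IsTopologicalGroup G] [CompactSpace G] [MeasurableSpace G] [BorelSpace G] in
/-- The Wilson action is non-negative (unitarity). [folklore] -/
theorem wilsonAction_nonneg' {T : ℕ} [NeZero T] (U : GaugeConfig 4 T G) : 0 ≤ wilsonAction r.ρ U := by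
  rw [wilsonAction_eq_sum_pDef]
  exact Finset.sum_nonneg fun p _ => pDef_nonneg r U _ _ _

omit [IsTopologicalGroup G] [CompactSpace G] [MeasurableSpace G] [BorelSpace G] in
/-- One plaquette deficit is at most the whole Wilson action. [folklore] -/
theorem pDef_le_wilsonAction {T : ℕ} [NeZero T] (U : GaugeConfig 4 T G)
    (x : Fin 4 → ZMod T) {i j : Fin 4} (hij : i < j) :
    pDef r U x i j ≤ wilsonAction r.ρ U := by
  rw [wilsonAction_eq_sum_pDef]
  have h := Finset.single_le_sum (s := (Finset.univ : Finset (Plaquette 4 T)))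
    (f := fun p : Plaquette 4 T => pDef r U p.1 p.2.1.1 p.2.1.2)
    (fun p _ => pDef_nonneg r U _ _ _) (Finset.mem_univ ((x, ⟨(i, j), hij⟩) : Plaquette 4 T))
  exact h

omit [MeasurableSpace G] [BorelSpace G] [CompactSpace G] in
/-- The Wilson action is continuous on the (compact) torus configuration space. [folklore] -/
theorem continuous_wilsonAction' {T : ℕ} [NeZero T] :
    Continuous (wilsonAction (d := 4) (L := T) (G := G) r.ρ) := by
  unfold wilsonAction
  refine continuous_finsetSum _ fun p _ => continuous_const.sub ?_
  refine (continuous_trace_re r.ρ r.continuous).comp ?_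
  unfold plaquetteHolonomy
  fun_prop

omit [IsTopologicalGroup G] [CompactSpace G] [MeasurableSpace G] [BorelSpace G] in
/-- The trivial configuration has zero Wilson action. [folklore] -/
theorem wilsonAction_one {T : ℕ} [NeZero T] : wilsonAction r.ρ (1 : GaugeConfig 4 T G) = 0 := by
  simp [wilsonAction, plaquetteHolonomy, Matrix.trace_one]

/-- `∑_{i<j} N`, the value of the action density on flat configurations. -/
def Pmax : ℝ := ∑ i : Fin 4, ∑ j : Fin 4, if i < j then (r.N : ℝ) else 0

omit [IsTopologicalGroup G] [CompactSpace G] [BorelSpace G] in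
/-- The local action deficit in terms of plaquette deficits. [folklore] -/
theorem Pmax_sub_actionDensity (T : ℕ) (U : GaugeConfig 4 T G) (x : Fin 4 → ℤ) :
    Pmax r - actionDensity r.ρ (configShift (-x) (torusLift T U)) =
      ∑ i : Fin 4, ∑ j : Fin 4, if i < j then pDef r U (Torus.proj T x) i j else 0 := by
  unfold Pmax actionDensity
  rw [← Finset.sum_sub_distrib]
  refine Finset.sum_congr rfl fun i _ => ?_
  rw [← Finset.sum_sub_distrib]
  refine Finset.sum_congr rfl fun j _ => ?_
  split_ifs with hij
  · simp [plaquetteObs, plaquetteHolonomyZd_shift_lift, pDef]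
  · simp

omit [IsTopologicalGroup G] [CompactSpace G] [BorelSpace G] in
/-- The local action deficit is non-negative. [folklore] -/
theorem Pmax_sub_actionDensity_nonneg (T : ℕ) (U : GaugeConfig 4 T G) (x : Fin 4 → ℤ) :
    0 ≤ Pmax r - actionDensity r.ρ (configShift (-x) (torusLift T U)) := by
  rw [Pmax_sub_actionDensity]
  refine Finset.sum_nonneg fun i _ => Finset.sum_nonneg fun j _ => ?_
  split_ifs
  · exact pDef_nonneg r U _ _ _
  · exact le_rfl

omit [IsTopologicalGroup G] [CompactSpace G] [BorelSpace G] in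
/-- The local action deficit is controlled by the total action: `Pmax − P(τₓŨ) ≤ 16 S_W(U)`. [folklore] -/
theorem Pmax_sub_actionDensity_le {T : ℕ} [NeZero T] (U : GaugeConfig 4 T G) (x : Fin 4 → ℤ) :
    Pmax r - actionDensity r.ρ (configShift (-x) (torusLift T U)) ≤ 16 * wilsonAction r.ρ U := by
  rw [Pmax_sub_actionDensity]
  have hS := wilsonAction_nonneg' r U
  calc ∑ i : Fin 4, ∑ j : Fin 4, (if i < j then pDef r U (Torus.proj T x) i j else 0)
      ≤ ∑ _i : Fin 4, ∑ _j : Fin 4, wilsonAction r.ρ U := by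
        refine Finset.sum_le_sum fun i _ => Finset.sum_le_sum fun j _ => ?_
        split_ifs with hij
        · exact pDef_le_wilsonAction r U _ hij
        · exact hS
    _ = 16 * wilsonAction r.ρ U := by simp [Finset.sum_const, Finset.card_univ]; ring

omit [IsTopologicalGroup G] [CompactSpace G] [BorelSpace G] in
/-- The action density never exceeds its flat value. [folklore] -/
theorem actionDensity_lift_le_Pmax (T : ℕ) (U : GaugeConfig 4 T G) :
    actionDensity r.ρ (torusLift T U) ≤ Pmax r := by
  have h := Pmax_sub_actionDensity_nonneg r T U 0
  rw [neg_zero, configShift_zero'] at h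
  linarith


/-! #### The torus Wilson state as a Gibbs reweighting of product Haar measure -/

variable (T : ℕ) [NeZero T]

/-- Product Haar probability measure on torus configurations. -/
def haarPi : Measure (GaugeConfig 4 T G) := Measure.pi fun _ : Edge 4 T => haarProbability G

instance isProbabilityMeasure_haarPi : IsProbabilityMeasure (haarPi (G := G) T) := by
  unfold haarPi; infer_instance

/-- The real partition function `Z(β) = ∫ e^{-β S_W} dHaar`. -/
def Zr (β : ℝ) : ℝ := ∫ U, Real.exp (-β * wilsonAction r.ρ U) ∂(haarPi T)

/-- The Boltzmann factor is measurable. [folklore] -/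
theorem measurable_expAction (β : ℝ) :
    Measurable fun U : GaugeConfig 4 T G => Real.exp (-β * wilsonAction r.ρ U) := by
  haveI := secondCountable_of_latticeRep r
  exact Real.measurable_exp.comp ((measurable_wilsonAction r.ρ r.continuous).const_mul _)

omit [IsTopologicalGroup G] [MeasurableSpace G] [BorelSpace G] in
/-- Two-sided bounds on the Boltzmann factor. [folklore] -/
theorem exists_exp_action_bounds :
    ∃ B : ℝ, 0 ≤ B ∧ ∀ (β : ℝ) (U : GaugeConfig 4 T G),
      Real.exp (-(|β| * B)) ≤ Real.exp (-β * wilsonAction r.ρ U) ∧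
        Real.exp (-β * wilsonAction r.ρ U) ≤ Real.exp (|β| * B) := by
  obtain ⟨B, hB⟩ := exists_abs_wilsonAction_le (d := 4) (L := T) r.ρ r.continuous
  have hB0 : 0 ≤ B := (abs_nonneg _).trans (hB 1)
  refine ⟨B, hB0, fun β U => ?_⟩
  have h : |β * wilsonAction r.ρ U| ≤ |β| * B := by
    rw [abs_mul]; exact mul_le_mul_of_nonneg_left (hB U) (abs_nonneg _)
  have h1 := (abs_le.1 h).1
  have h2 := (abs_le.1 h).2
  exact ⟨Real.exp_le_exp.2 (by linarith), Real.exp_le_exp.2 (by linarith)⟩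

/-- `Z(β) > 0`. [folklore] -/
theorem Zr_pos (β : ℝ) : 0 < Zr r T β := by
  obtain ⟨B, -, hB⟩ := exists_exp_action_bounds r T
  have hint : Integrable (fun U : GaugeConfig 4 T G => Real.exp (-β * wilsonAction r.ρ U)) (haarPi T) :=
    Integrable.of_bound (measurable_expAction r T β).aestronglyMeasurable (Real.exp (|β| * B))
      (ae_of_all _ fun U => by rw [Real.norm_eq_abs, abs_of_pos (Real.exp_pos _)]; exact (hB β U).2)
  have hle : ∫ _U : GaugeConfig 4 T G, Real.exp (-(|β| * B)) ∂(haarPi T) ≤ Zr r T β :=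
    integral_mono (integrable_const _) hint fun U => (hB β U).1
  rw [integral_const, probReal_univ, one_smul] at hle
  exact (Real.exp_pos _).trans_le hle

/-- **Gibbs reweighting formula**: torus Wilson expectations are product-Haar integrals against
the Boltzmann factor, divided by `Z(β)`. [folklore] -/
theorem integral_wilsonMeasure_eq (β : ℝ) (F : GaugeConfig 4 T G → ℝ) :
    ∫ U, F U ∂(wilsonMeasure (d := 4) (L := T) r.ρ β) =
      (Zr r T β)⁻¹ * ∫ U, Real.exp (-β * wilsonAction r.ρ U) * F U ∂(haarPi T) := by
  have hw : Measurable fun U : GaugeConfig 4 T G =>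
      ENNReal.ofReal (Real.exp (-β * wilsonAction r.ρ U)) := (measurable_expAction r T β).ennreal_ofReal
  obtain ⟨B, -, hB⟩ := exists_exp_action_bounds r T
  have hint : Integrable (fun U : GaugeConfig 4 T G => Real.exp (-β * wilsonAction r.ρ U)) (haarPi T) :=
    Integrable.of_bound (measurable_expAction r T β).aestronglyMeasurable (Real.exp (|β| * B))
      (ae_of_all _ fun U => by rw [Real.norm_eq_abs, abs_of_pos (Real.exp_pos _)]; exact (hB β U).2)
  have hZ : partitionFunction (d := 4) (L := T) r.ρ β = ENNReal.ofReal (Zr r T β) := by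
    rw [Zr, ofReal_integral_eq_lintegral_ofReal hint (ae_of_all _ fun U => (Real.exp_pos _).le)]
    simp only [partitionFunction, wilsonWeight, withDensity_apply _ MeasurableSet.univ,
      Measure.restrict_univ]
    rfl
  simp only [wilsonMeasure, integral_smul_measure, wilsonWeight, smul_eq_mul]
  rw [integral_withDensity_eq_integral_toReal_smul hw (ae_of_all _ fun U => ENNReal.ofReal_lt_top),
    hZ, ENNReal.toReal_inv, ENNReal.toReal_ofReal (Zr_pos r T β).le]
  congr 1
  refine integral_congr_ae (ae_of_all _ fun U => ?_)
  simp only [smul_eq_mul]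
  rw [ENNReal.toReal_ofReal (Real.exp_pos _).le]

/-- **Continuity in `β` of Boltzmann-weighted Haar integrals** of a bounded measurable
observable (dominated convergence). [folklore] -/
theorem continuous_laplaceNum (F : GaugeConfig 4 T G → ℝ) (hFm : Measurable F) {C : ℝ}
    (hC : ∀ U, |F U| ≤ C) :
    Continuous fun β : ℝ => ∫ U, Real.exp (-β * wilsonAction r.ρ U) * F U ∂(haarPi T) := by
  obtain ⟨B, hB0, hB⟩ := exists_exp_action_bounds r T
  refine continuous_iff_continuousAt.2 fun β₀ => ?_
  refine continuousAt_of_dominated (bound := fun _ => Real.exp ((|β₀| + 1) * B) * C) ?_ ?_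
    (integrable_const _) ?_
  · exact Eventually.of_forall fun β => ((measurable_expAction r T β).mul hFm).aestronglyMeasurable
  · filter_upwards [Metric.ball_mem_nhds β₀ one_pos] with β hβ
    refine ae_of_all _ fun U => ?_
    rw [Real.norm_eq_abs, abs_mul, abs_of_pos (Real.exp_pos _)]
    have hβ' : |β| ≤ |β₀| + 1 := by
      have := Metric.mem_ball.1 hβ
      rw [Real.dist_eq] at this
      have := abs_sub_abs_le_abs_sub β β₀
      linarith
    have h1 : Real.exp (-β * wilsonAction r.ρ U) ≤ Real.exp ((|β₀| + 1) * B) :=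
      (hB β U).2.trans (Real.exp_le_exp.2 (mul_le_mul_of_nonneg_right hβ' hB0))
    exact mul_le_mul h1 (hC U) (abs_nonneg _) (Real.exp_pos _).le
  · exact ae_of_all _ fun U => (by fun_prop : Continuous fun β : ℝ =>
      Real.exp (-β * wilsonAction r.ρ U) * F U).continuousAt

/-- `Z` is continuous. [folklore] -/
theorem continuous_Zr : Continuous (Zr r T) := by
  have h := continuous_laplaceNum r T (fun _ => (1 : ℝ)) measurable_const (C := 1) (fun _ => by simp)
  simp only [mul_one] at h
  exact h

/-- **Continuity in `β` of torus Wilson expectations** of a bounded measurable observable. [folklore] -/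
theorem continuous_integral_wilsonMeasure (F : GaugeConfig 4 T G → ℝ) (hFm : Measurable F) {C : ℝ}
    (hC : ∀ U, |F U| ≤ C) :
    Continuous fun β : ℝ => ∫ U, F U ∂(wilsonMeasure (d := 4) (L := T) r.ρ β) := by
  simp_rw [integral_wilsonMeasure_eq r T]
  exact ((continuous_Zr r T).inv₀ fun β => (Zr_pos r T β).ne').mul
    (continuous_laplaceNum r T F hFm hC)

/-! #### Laplace concentration: `⟨S_W⟩_β → 0` as `β → ∞` -/

/-- Product Haar measure charges the open set `{S_W < t}` (it contains the trivial configuration). [folklore] -/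
theorem haarPi_actionLT_pos {t : ℝ} (ht : 0 < t) :
    0 < ((haarPi (G := G) T) {U | wilsonAction r.ρ U < t}).toReal := by
  have hopen : IsOpen {U : GaugeConfig 4 T G | wilsonAction r.ρ U < t} :=
    isOpen_lt (continuous_wilsonAction' (T := T) r) continuous_const
  have hne : ({U : GaugeConfig 4 T G | wilsonAction r.ρ U < t}).Nonempty :=
    ⟨1, by simp only [Set.mem_setOf_eq, wilsonAction_one]; exact ht⟩
  haveI : (haarPi (G := G) T).IsOpenPosMeasure := by unfold haarPi; infer_instance
  have hpos := hopen.measure_pos (haarPi (G := G) T) hne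
  exact ENNReal.toReal_pos hpos.ne' (measure_ne_top _ _)

/-- **Laplace bound.** For `β ≥ 0` and `ε > 0`:
`⟨S_W⟩_β ≤ ε/2 + (B / Haar{S_W < ε/4}) · e^{−βε/4}`. [folklore] -/
theorem expect_wilsonAction_le {β ε : ℝ} (hβ : 0 ≤ β) (hε : 0 < ε) :
    ∫ U, wilsonAction r.ρ U ∂(wilsonMeasure (d := 4) (L := T) r.ρ β) ≤
      ε / 2 + (Classical.choose (exists_abs_wilsonAction_le (d := 4) (L := T) r.ρ r.continuous) /
        ((haarPi (G := G) T) {U | wilsonAction r.ρ U < ε / 4}).toReal) * Real.exp (-(β * (ε / 4))) := by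
  haveI := secondCountable_of_latticeRep r
  set B := Classical.choose (exists_abs_wilsonAction_le (d := 4) (L := T) r.ρ r.continuous) with hBdef
  have hB : ∀ U : GaugeConfig 4 T G, |wilsonAction r.ρ U| ≤ B :=
    Classical.choose_spec (exists_abs_wilsonAction_le (d := 4) (L := T) r.ρ r.continuous)
  set q := ((haarPi (G := G) T) {U | wilsonAction r.ρ U < ε / 4}).toReal with hqdef
  have hq : 0 < q := haarPi_actionLT_pos r T (by positivity)
  have hSm : Measurable (wilsonAction (d := 4) (L := T) (G := G) r.ρ) := measurable_wilsonAction r.ρ r.continuous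
  have hS0 : ∀ U : GaugeConfig 4 T G, 0 ≤ wilsonAction r.ρ U := wilsonAction_nonneg' r
  have hinte : Integrable (fun U : GaugeConfig 4 T G => Real.exp (-β * wilsonAction r.ρ U)) (haarPi T) :=
    Integrable.of_bound (measurable_expAction r T β).aestronglyMeasurable 1
      (ae_of_all _ fun U => by
        rw [Real.norm_eq_abs, abs_of_pos (Real.exp_pos _), ← Real.exp_zero]
        exact Real.exp_le_exp.2 (by nlinarith [hS0 U]))
  -- numerator bound
  have hnum : ∫ U, Real.exp (-β * wilsonAction r.ρ U) * wilsonAction r.ρ U ∂(haarPi T) ≤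
      ε / 2 * Zr r T β + B * Real.exp (-(β * (ε / 2))) := by
    have hpt : ∀ U : GaugeConfig 4 T G, Real.exp (-β * wilsonAction r.ρ U) * wilsonAction r.ρ U ≤
        ε / 2 * Real.exp (-β * wilsonAction r.ρ U) + B * Real.exp (-(β * (ε / 2))) := by
      intro U
      have he := Real.exp_pos (-β * wilsonAction r.ρ U)
      have hBU : wilsonAction r.ρ U ≤ B := (le_abs_self _).trans (hB U)
      have hB0 : 0 ≤ B := (hS0 U).trans hBU
      by_cases hcase : wilsonAction r.ρ U ≤ ε / 2
      · have : Real.exp (-β * wilsonAction r.ρ U) * wilsonAction r.ρ U ≤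
            ε / 2 * Real.exp (-β * wilsonAction r.ρ U) := by nlinarith
        have : 0 ≤ B * Real.exp (-(β * (ε / 2))) := by positivity
        linarith
      · have hcase' := not_le.1 hcase
        have hexp : Real.exp (-β * wilsonAction r.ρ U) ≤ Real.exp (-(β * (ε / 2))) :=
          Real.exp_le_exp.2 (by nlinarith)
        have : Real.exp (-β * wilsonAction r.ρ U) * wilsonAction r.ρ U ≤ Real.exp (-(β * (ε / 2))) * B :=
          mul_le_mul hexp hBU (hS0 U) (Real.exp_pos _).le
        have : 0 ≤ ε / 2 * Real.exp (-β * wilsonAction r.ρ U) := by positivity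
        linarith
    have hint1 : Integrable (fun U : GaugeConfig 4 T G => Real.exp (-β * wilsonAction r.ρ U) * wilsonAction r.ρ U)
        (haarPi T) := by
      refine Integrable.of_bound ((measurable_expAction r T β).mul hSm).aestronglyMeasurable (1 * B)
        (ae_of_all _ fun U => ?_)
      rw [Real.norm_eq_abs, abs_mul, abs_of_pos (Real.exp_pos _)]
      refine mul_le_mul ?_ (hB U) (abs_nonneg _) zero_le_one
      rw [← Real.exp_zero]; exact Real.exp_le_exp.2 (by nlinarith [hS0 U])
    have hint2 : Integrable (fun U : GaugeConfig 4 T G =>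
        ε / 2 * Real.exp (-β * wilsonAction r.ρ U) + B * Real.exp (-(β * (ε / 2)))) (haarPi T) :=
      (hinte.const_mul _).add (integrable_const _)
    calc _ ≤ ∫ U, (ε / 2 * Real.exp (-β * wilsonAction r.ρ U) + B * Real.exp (-(β * (ε / 2)))) ∂(haarPi T) :=
          integral_mono hint1 hint2 hpt
      _ = ε / 2 * Zr r T β + B * Real.exp (-(β * (ε / 2))) := by
          rw [integral_add (hinte.const_mul _) (integrable_const _), integral_const_mul, integral_const,
            probReal_univ, one_smul, Zr]
  -- denominator bound
  have hden : Real.exp (-(β * (ε / 4))) * q ≤ Zr r T β := by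
    have hpt : ∀ U : GaugeConfig 4 T G,
        Set.indicator {U | wilsonAction r.ρ U < ε / 4} (fun _ => Real.exp (-(β * (ε / 4)))) U ≤
          Real.exp (-β * wilsonAction r.ρ U) := by
      intro U
      by_cases hU : U ∈ {U : GaugeConfig 4 T G | wilsonAction r.ρ U < ε / 4}
      · rw [Set.indicator_of_mem hU]
        exact Real.exp_le_exp.2 (by have := hU.out; nlinarith)
      · rw [Set.indicator_of_notMem hU]; exact (Real.exp_pos _).le
    have hmeas : MeasurableSet {U : GaugeConfig 4 T G | wilsonAction r.ρ U < ε / 4} :=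
      measurableSet_lt hSm measurable_const
    have h := integral_mono ((integrable_const _).indicator hmeas) hinte hpt
    rw [integral_indicator hmeas, setIntegral_const, smul_eq_mul] at h
    calc Real.exp (-(β * (ε / 4))) * q
        = (haarPi T).real {U | wilsonAction r.ρ U < ε / 4} * Real.exp (-(β * (ε / 4))) := by
          rw [hqdef, measureReal_def, mul_comm]
      _ ≤ Zr r T β := h
  -- combine
  have hZ := Zr_pos r T β
  rw [integral_wilsonMeasure_eq r T]
  have hexp2 : Real.exp (-(β * (ε / 2))) = Real.exp (-(β * (ε / 4))) * Real.exp (-(β * (ε / 4))) := by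
    rw [← Real.exp_add]; ring_nf
  have hB0 : 0 ≤ B := (abs_nonneg _).trans (hB 1)
  have hstep1 : (Zr r T β)⁻¹ * ∫ U, Real.exp (-β * wilsonAction r.ρ U) * wilsonAction r.ρ U ∂(haarPi T) ≤
      (Zr r T β)⁻¹ * (ε / 2 * Zr r T β + B * Real.exp (-(β * (ε / 2)))) :=
    mul_le_mul_of_nonneg_left hnum (inv_nonneg.2 hZ.le)
  have hratio : Real.exp (-(β * (ε / 4))) / Zr r T β ≤ 1 / q := by
    rw [div_le_div_iff₀ hZ hq, one_mul]; exact hden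
  have he4 : 0 ≤ B * Real.exp (-(β * (ε / 4))) := by positivity
  have hcancel : (Zr r T β)⁻¹ * (ε / 2 * Zr r T β) = ε / 2 := by field_simp
  calc (Zr r T β)⁻¹ * ∫ U, Real.exp (-β * wilsonAction r.ρ U) * wilsonAction r.ρ U ∂(haarPi T)
      ≤ (Zr r T β)⁻¹ * (ε / 2 * Zr r T β + B * Real.exp (-(β * (ε / 2)))) := hstep1
    _ = ε / 2 + B * Real.exp (-(β * (ε / 4))) * (Real.exp (-(β * (ε / 4))) / Zr r T β) := by
        rw [mul_add, hcancel, hexp2]; ring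
    _ ≤ ε / 2 + B * Real.exp (-(β * (ε / 4))) * (1 / q) := by
        linarith [mul_le_mul_of_nonneg_left hratio he4]
    _ = ε / 2 + B / q * Real.exp (-(β * (ε / 4))) := by ring

/-- **`⟨S_W⟩_β → 0` as `β → ∞`** on every fixed torus (Wilson's measure concentrates on
`{S_W = 0}`). [folklore] -/
theorem tendsto_expect_wilsonAction :
    Tendsto (fun β => ∫ U, wilsonAction r.ρ U ∂(wilsonMeasure (d := 4) (L := T) r.ρ β)) atTop (𝓝 0) := by
  refine tendsto_order.2 ⟨fun a ha => Eventually.of_forall fun β => ha.trans_le ?_, fun b hb => ?_⟩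
  · exact integral_nonneg fun U => wilsonAction_nonneg' (T := T) r U
  · set B := Classical.choose (exists_abs_wilsonAction_le (d := 4) (L := T) r.ρ r.continuous)
    set q := ((haarPi (G := G) T) {U | wilsonAction r.ρ U < b / 4}).toReal
    have htail : Tendsto (fun β : ℝ => B / q * Real.exp (-(β * (b / 4)))) atTop (𝓝 (B / q * 0)) := by
      refine tendsto_const_nhds.mul ?_
      have : Tendsto (fun β : ℝ => -(β * (b / 4))) atTop atBot := by
        have h := tendsto_id.atTop_mul_const (show 0 < b / 4 by positivity)
        exact tendsto_neg_atTop_atBot.comp h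
      exact Real.tendsto_exp_atBot.comp this
    rw [mul_zero] at htail
    have hev : ∀ᶠ β : ℝ in atTop, B / q * Real.exp (-(β * (b / 4))) < b / 2 :=
      htail (Iio_mem_nhds (by positivity))
    filter_upwards [hev, eventually_ge_atTop (0 : ℝ)] with β hβ hβ0
    have h := expect_wilsonAction_le r T hβ0 hb
    linarith


/-! #### Continuity in `β` of the centred `n`-point functions -/

omit [TopologicalSpace G] [IsTopologicalGroup G] [CompactSpace G] [BorelSpace G] [NeZero T] in
/-- Smeared local fields of the periodic lift are measurable on torus configurations. [folklore] -/
theorem measurable_smeared_lift (O : YMSpecies G) (Λ : Finset (Fin 4 → ℤ)) (a c m : ℝ)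
    (f : 𝓢(EuclideanSpace ℝ (Fin 4), ℝ)) :
    Measurable fun U : GaugeConfig 4 T G => smearedLatticeField O.F Λ a c m f (torusLift T U) := by
  unfold smearedLatticeField
  refine Measurable.const_mul (Finset.measurable_sum _ fun x _ => ?_) _
  refine Measurable.const_mul ?_ _
  exact ((O.measurable.comp ((configShift (-x)).measurable.comp (measurable_torusLift T))).sub_const m)

omit [Group G] [TopologicalSpace G] [IsTopologicalGroup G] [CompactSpace G] [BorelSpace G] [NeZero T] in
/-- Crude bound on a smeared local field: `|Φ(f)| ≤ |c| a⁴ ∑ₓ |f(a x)| (C_O + |m|)`. [folklore] -/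
theorem abs_smeared_le {O : LGConfig 4 G → ℝ} {C : ℝ} (hO : ∀ V, |O V| ≤ C) (Λ : Finset (Fin 4 → ℤ))
    (a c m : ℝ) (f : 𝓢(EuclideanSpace ℝ (Fin 4), ℝ)) (V : LGConfig 4 G) :
    |smearedLatticeField O Λ a c m f V| ≤
      |c| * |a| ^ 4 * ∑ x ∈ Λ, |f (a • siteToE x)| * (C + |m|) := by
  unfold smearedLatticeField
  rw [abs_mul, abs_mul, abs_pow]
  refine mul_le_mul_of_nonneg_left ?_ (by positivity)
  refine (Finset.abs_sum_le_sum_abs _ _).trans (Finset.sum_le_sum fun x _ => ?_)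
  rw [abs_mul]
  refine mul_le_mul_of_nonneg_left ?_ (abs_nonneg _)
  exact (abs_sub _ _).trans (add_le_add (hO _) le_rfl)

variable (L : ℕ) {n : ℕ} (c : YMSpecies G → ℝ) (σ : Fin n → YMSpecies G)
  (f : Fin n → 𝓢(EuclideanSpace ℝ (Fin 4), ℝ))

/-- The Boltzmann-weighted product integrand, parametrised by `(β, m)`. -/
def jointIntegrand (q : ℝ × (Fin n → ℝ)) (U : GaugeConfig 4 (2 * L + 1) G) : ℝ :=
  Real.exp (-q.1 * wilsonAction r.ρ U) *
    ∏ i, smearedLatticeField (σ i).F (box 4 L) 1 (c (σ i)) (q.2 i) (f i) (torusLift (2 * L + 1) U)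

/-- **Joint continuity in `(β, m)`** of the Boltzmann-weighted Haar integral of the product of
smeared fields with free centrings `m` (dominated convergence on the compact configuration space). [folklore] -/
theorem continuous_jointIntegral :
    Continuous fun q : ℝ × (Fin n → ℝ) => ∫ U, jointIntegrand r L c σ f q U ∂(haarPi (2 * L + 1)) := by
  obtain ⟨B, hB0, hB⟩ := exists_exp_action_bounds r (2 * L + 1)
  have hCO : ∀ i, ∃ C, 0 ≤ C ∧ ∀ V, |(σ i).F V| ≤ C := fun i => by
    obtain ⟨C, hC⟩ := (σ i).bounded
    exact ⟨max C 0, le_max_right _ _, fun V => (hC V).trans (le_max_left _ _)⟩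
  choose C hC0 hC using hCO
  refine continuous_iff_continuousAt.2 fun q₀ => ?_
  -- the dominating constant on the unit ball around q₀
  set K : ℝ := Real.exp ((‖q₀‖ + 1) * B) *
    ∏ i, (|c (σ i)| * |(1 : ℝ)| ^ 4 *
      ∑ x ∈ box 4 L, |f i ((1 : ℝ) • siteToE x)| * (C i + (‖q₀‖ + 1)))
  refine continuousAt_of_dominated (bound := fun _ => K) ?_ ?_ (integrable_const _) ?_
  · refine Eventually.of_forall fun q => ?_
    refine ((measurable_expAction r (2 * L + 1) q.1).mul ?_).aestronglyMeasurable
    exact Finset.measurable_prod _ fun i _ => measurable_smeared_lift (2 * L + 1) (σ i) _ _ _ _ _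
  · filter_upwards [Metric.ball_mem_nhds q₀ one_pos] with q hq
    refine ae_of_all _ fun U => ?_
    have hqn : ‖q‖ ≤ ‖q₀‖ + 1 := by
      have h1 := Metric.mem_ball.1 hq
      rw [dist_eq_norm] at h1
      have := norm_le_norm_add_norm_sub' q q₀
      have := norm_sub_rev q q₀
      linarith [norm_le_insert' q q₀]
    unfold jointIntegrand
    rw [Real.norm_eq_abs, abs_mul, abs_of_pos (Real.exp_pos _), Finset.abs_prod]
    refine mul_le_mul ?_ ?_ (Finset.prod_nonneg fun i _ => abs_nonneg _) (Real.exp_pos _).le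
    · have hq1 : |q.1| ≤ ‖q₀‖ + 1 := (norm_fst_le q).trans hqn
      exact (hB q.1 U).2.trans (Real.exp_le_exp.2 (mul_le_mul_of_nonneg_right hq1 hB0))
    · refine Finset.prod_le_prod (fun i _ => abs_nonneg _) fun i _ => ?_
      refine (abs_smeared_le (hC i) _ _ _ _ _ _).trans ?_
      have hq2 : |q.2 i| ≤ ‖q₀‖ + 1 := by
        have := norm_le_pi_norm q.2 i
        have := norm_snd_le q
        rw [Real.norm_eq_abs] at *
        linarith
      gcongr
  · refine ae_of_all _ fun U => ?_
    unfold jointIntegrand smearedLatticeField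
    refine Continuous.continuousAt ?_
    refine Continuous.mul (by fun_prop) ?_
    exact continuous_finsetProd _ fun i _ => by fun_prop

/-- The torus Wilson mean of a species is continuous in `β`. [folklore] -/
theorem continuous_wilsonTorusMean (O : YMSpecies G) :
    Continuous fun β => wilsonTorusMean r.ρ β L O.F := by
  obtain ⟨C, hC⟩ := O.bounded
  exact continuous_integral_wilsonMeasure r (2 * L + 1) (fun U => O.F (torusLift (2 * L + 1) U))
    (O.measurable.comp (measurable_torusLift _)) (C := C) fun U => hC _

/-- The centred Wilson `n`-point function in Gibbs form. [folklore] -/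
theorem wilsonCentredSchwinger_eq_joint (β : ℝ) :
    wilsonCentredSchwinger r.ρ β L c n σ f =
      (Zr r (2 * L + 1) β)⁻¹ * ∫ U, jointIntegrand r L c σ f
        (β, fun i => wilsonTorusMean r.ρ β L (σ i).F) U ∂(haarPi (2 * L + 1)) := by
  unfold wilsonCentredSchwinger jointIntegrand
  rw [integral_wilsonMeasure_eq r (2 * L + 1)]

/-- **Continuity in `β ∈ ℝ` of the centred unit-lattice Wilson `n`-point functions** on a fixed
torus (any species string, any normalisations). [folklore] -/
theorem continuous_wilsonCentredSchwinger :
    Continuous fun β => wilsonCentredSchwinger r.ρ β L c n σ f := by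
  have heq : (fun β => wilsonCentredSchwinger r.ρ β L c n σ f) = fun β =>
      (Zr r (2 * L + 1) β)⁻¹ * ∫ U, jointIntegrand r L c σ f
        (β, fun i => wilsonTorusMean r.ρ β L (σ i).F) U ∂(haarPi (2 * L + 1)) :=
    funext (wilsonCentredSchwinger_eq_joint r L c σ f)
  rw [heq]
  refine ((continuous_Zr r (2 * L + 1)).inv₀ fun β => (Zr_pos r (2 * L + 1) β).ne').mul ?_
  refine (continuous_jointIntegral r L c σ f).comp ?_
  exact continuous_id.prodMk (continuous_pi fun i => continuous_wilsonTorusMean r L (σ i))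

/-! #### The `β → ∞` limit of the centred plaquette `n`-point functions is `0` (`n ≥ 1`) -/

/-- `∑ₓ |g(x)|` over the box: the `ℓ¹` size of a unit-scale test function. -/
def l1Box (g : 𝓢(EuclideanSpace ℝ (Fin 4), ℝ)) : ℝ :=
  ∑ x ∈ box 4 L, |g (siteToE x)|

omit [Group G] [TopologicalSpace G] [IsTopologicalGroup G] [CompactSpace G] [MeasurableSpace G]
  [BorelSpace G] in
theorem l1Box_nonneg (g : 𝓢(EuclideanSpace ℝ (Fin 4), ℝ)) : 0 ≤ l1Box L g :=
  Finset.sum_nonneg fun _ _ => abs_nonneg _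

/-- The plaquette species of `r` is the action density. [folklore] -/
theorem curvature_F : r.curvature.F = actionDensity r.ρ := rfl

/-- Integrability of bounded measurable observables under the torus Wilson state. [folklore] -/
theorem integrable_wilson_of_bound (β : ℝ) {F : GaugeConfig 4 (2 * L + 1) G → ℝ} (hFm : Measurable F)
    {C : ℝ} (hC : ∀ U, |F U| ≤ C) :
    Integrable F (wilsonMeasure (d := 4) (L := 2 * L + 1) r.ρ β) := by
  haveI := isProbabilityMeasure_wilsonMeasure (d := 4) (L := 2 * L + 1) r.ρ r.continuous β
  exact Integrable.of_bound hFm.aestronglyMeasurable C (ae_of_all _ fun U => by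
    rw [Real.norm_eq_abs]; exact hC U)

/-- **The mean plaquette deficit is controlled by `⟨S_W⟩_β`:**
`0 ≤ Pmax − ⟨P⟩_β ≤ 16 ⟨S_W⟩_β`. [folklore] -/
theorem Pmax_sub_mean_bounds (β : ℝ) :
    0 ≤ Pmax r - wilsonTorusMean r.ρ β L (actionDensity r.ρ) ∧
      Pmax r - wilsonTorusMean r.ρ β L (actionDensity r.ρ) ≤
        16 * ∫ U, wilsonAction r.ρ U ∂(wilsonMeasure (d := 4) (L := 2 * L + 1) r.ρ β) := by
  haveI := isProbabilityMeasure_wilsonMeasure (d := 4) (L := 2 * L + 1) r.ρ r.continuous β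
  haveI := secondCountable_of_latticeRep r
  obtain ⟨C, hC⟩ := r.curvature.bounded
  have hPm : Measurable fun U : GaugeConfig 4 (2 * L + 1) G => actionDensity r.ρ (torusLift (2 * L + 1) U) :=
    (curvature_F r ▸ r.curvature.measurable).comp (measurable_torusLift _)
  have hPint : Integrable (fun U : GaugeConfig 4 (2 * L + 1) G => actionDensity r.ρ (torusLift (2 * L + 1) U))
      (wilsonMeasure (d := 4) (L := 2 * L + 1) r.ρ β) :=
    integrable_wilson_of_bound r L β hPm (C := C) fun U => by rw [← curvature_F]; exact hC _
  obtain ⟨B, hB⟩ := exists_abs_wilsonAction_le (d := 4) (L := 2 * L + 1) r.ρ r.continuous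
  have hSint : Integrable (wilsonAction (d := 4) (L := 2 * L + 1) (G := G) r.ρ)
      (wilsonMeasure (d := 4) (L := 2 * L + 1) r.ρ β) :=
    integrable_wilson_of_bound r L β (measurable_wilsonAction r.ρ r.continuous) hB
  have heq : Pmax r - wilsonTorusMean r.ρ β L (actionDensity r.ρ) =
      ∫ U, (Pmax r - actionDensity r.ρ (torusLift (2 * L + 1) U))
        ∂(wilsonMeasure (d := 4) (L := 2 * L + 1) r.ρ β) := by
    rw [integral_sub (integrable_const _) hPint, integral_const, probReal_univ, one_smul]
    rfl
  rw [heq]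
  constructor
  · exact integral_nonneg fun U => sub_nonneg.2 (actionDensity_lift_le_Pmax r _ U)
  · rw [← integral_const_mul]
    refine integral_mono ((integrable_const _).sub hPint) (hSint.const_mul _) fun U => ?_
    have h := Pmax_sub_actionDensity_le r (T := 2 * L + 1) U 0
    rwa [neg_zero, configShift_zero'] at h

/-- **Domination of the centred plaquette `(k+1)`-point function by `⟨S_W⟩_β`**:
`|curvCorr β| ≤ K_c ⟨S_W⟩_β` with `K_c` independent of `β`. [folklore] -/
theorem abs_curvCorr_le (k : ℕ) (f : Fin (k + 1) → 𝓢(EuclideanSpace ℝ (Fin 4), ℝ)) :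
    ∃ Kc : ℝ, ∀ β : ℝ, |curvCorr r β L (k + 1) f| ≤
      Kc * ∫ U, wilsonAction r.ρ U ∂(wilsonMeasure (d := 4) (L := 2 * L + 1) r.ρ β) := by
  haveI := secondCountable_of_latticeRep r
  obtain ⟨C, hC⟩ := r.curvature.bounded
  set CP := max C 0 with hCPdef
  have hCP0 : 0 ≤ CP := le_max_right _ _
  have hCP : ∀ V, |actionDensity r.ρ V| ≤ CP := fun V => by
    rw [← curvature_F]; exact (hC V).trans (le_max_left _ _)
  set Kp : ℝ := ∏ i : Fin k, (l1Box L (f i.succ) * (2 * CP)) with hKpdef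
  have hKp0 : 0 ≤ Kp := Finset.prod_nonneg fun i _ => mul_nonneg (l1Box_nonneg L _) (by positivity)
  refine ⟨32 * l1Box L (f 0) * Kp, fun β => ?_⟩
  haveI := isProbabilityMeasure_wilsonMeasure (d := 4) (L := 2 * L + 1) r.ρ r.continuous β
  set μ := wilsonMeasure (d := 4) (L := 2 * L + 1) r.ρ β with hμ
  set m := wilsonTorusMean r.ρ β L (actionDensity r.ρ) with hmdef
  set D := Pmax r - m with hDdef
  set ES := ∫ U, wilsonAction r.ρ U ∂μ with hES
  obtain ⟨hD0, hD⟩ := Pmax_sub_mean_bounds r L β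
  rw [← hmdef, ← hDdef] at hD0 hD
  -- |m| ≤ CP
  have hm : |m| ≤ CP := by
    rw [hmdef, wilsonTorusMean]
    refine (abs_integral_le_integral_abs).trans ?_
    have hint : Integrable (fun U : GaugeConfig 4 (2 * L + 1) G => |actionDensity r.ρ (torusLift (2 * L + 1) U)|) μ :=
      (integrable_wilson_of_bound r L β ((curvature_F r ▸ r.curvature.measurable).comp
        (measurable_torusLift _)) (fun U => hCP _)).abs
    refine (integral_mono hint (integrable_const CP) fun U => hCP _).trans ?_
    rw [integral_const, probReal_univ, one_smul]
  -- the factors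
  set A : Fin (k + 1) → GaugeConfig 4 (2 * L + 1) G → ℝ := fun i U =>
    smearedLatticeField (actionDensity r.ρ) (box 4 L) 1 1 m (f i) (torusLift (2 * L + 1) U) with hA
  have hcurv : curvCorr r β L (k + 1) f = ∫ U, ∏ i, A i U ∂μ := rfl
  have hS0 : ∀ U : GaugeConfig 4 (2 * L + 1) G, 0 ≤ wilsonAction r.ρ U := wilsonAction_nonneg' r
  -- bounds on the factors
  have hA_succ : ∀ (i : Fin k) (U : GaugeConfig 4 (2 * L + 1) G),
      |A i.succ U| ≤ l1Box L (f i.succ) * (2 * CP) := by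
    intro i U
    refine (abs_smeared_le hCP _ _ _ _ _ _).trans ?_
    simp only [abs_one, one_pow, one_mul, one_smul, l1Box, Finset.sum_mul]
    refine Finset.sum_le_sum fun x _ => ?_
    have : CP + |m| ≤ 2 * CP := by linarith
    exact mul_le_mul_of_nonneg_left this (abs_nonneg _)
  have hA_zero : ∀ U : GaugeConfig 4 (2 * L + 1) G,
      |A 0 U| ≤ l1Box L (f 0) * (16 * wilsonAction r.ρ U + D) := by
    intro U
    simp only [hA, smearedLatticeField, one_pow, one_mul, one_smul, l1Box, Finset.sum_mul]
    refine (Finset.abs_sum_le_sum_abs _ _).trans (Finset.sum_le_sum fun x _ => ?_)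
    rw [abs_mul]
    refine mul_le_mul_of_nonneg_left ?_ (abs_nonneg _)
    have h1 := Pmax_sub_actionDensity_nonneg r (2 * L + 1) U x
    have h2 := Pmax_sub_actionDensity_le r (T := 2 * L + 1) U x
    have : |actionDensity r.ρ (configShift (-x) (torusLift (2 * L + 1) U)) - m| ≤
        (Pmax r - actionDensity r.ρ (configShift (-x) (torusLift (2 * L + 1) U))) + D := by
      rw [abs_le]; constructor <;> linarith
    linarith
  -- pointwise bound on the product
  have hprod : ∀ U : GaugeConfig 4 (2 * L + 1) G,
      |∏ i, A i U| ≤ Kp * l1Box L (f 0) * (16 * wilsonAction r.ρ U + D) := by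
    intro U
    rw [Finset.abs_prod, Fin.prod_univ_succ]
    have hrest : ∏ i : Fin k, |A i.succ U| ≤ Kp :=
      Finset.prod_le_prod (fun i _ => abs_nonneg _) fun i _ => hA_succ i U
    have hrest0 : 0 ≤ ∏ i : Fin k, |A i.succ U| := Finset.prod_nonneg fun i _ => abs_nonneg _
    have hz := hA_zero U
    have hpos : 0 ≤ l1Box L (f 0) * (16 * wilsonAction r.ρ U + D) :=
      mul_nonneg (l1Box_nonneg L _) (by nlinarith [hS0 U])
    calc |A 0 U| * ∏ i : Fin k, |A i.succ U|
        ≤ (l1Box L (f 0) * (16 * wilsonAction r.ρ U + D)) * Kp :=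
          mul_le_mul hz hrest hrest0 hpos
      _ = Kp * l1Box L (f 0) * (16 * wilsonAction r.ρ U + D) := by ring
  -- integrability
  obtain ⟨B, hB⟩ := exists_abs_wilsonAction_le (d := 4) (L := 2 * L + 1) r.ρ r.continuous
  have hSint : Integrable (wilsonAction (d := 4) (L := 2 * L + 1) (G := G) r.ρ) μ :=
    integrable_wilson_of_bound r L β (measurable_wilsonAction r.ρ r.continuous) hB
  have hRint : Integrable (fun U : GaugeConfig 4 (2 * L + 1) G =>
      Kp * l1Box L (f 0) * (16 * wilsonAction r.ρ U + D)) μ :=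
    ((hSint.const_mul 16).add (integrable_const D)).const_mul _
  have hPm : Measurable fun U : GaugeConfig 4 (2 * L + 1) G => ∏ i, A i U :=
    Finset.measurable_prod _ fun i _ => measurable_smeared_lift (2 * L + 1) r.curvature _ _ _ _ _
  have hPint : Integrable (fun U : GaugeConfig 4 (2 * L + 1) G => |∏ i, A i U|) μ := by
    refine (Integrable.of_bound hPm.aestronglyMeasurable (Kp * l1Box L (f 0) * (16 * B + D))
      (ae_of_all _ fun U => ?_)).abs
    rw [Real.norm_eq_abs]
    refine (hprod U).trans ?_
    have hSB : wilsonAction r.ρ U ≤ B := (le_abs_self _).trans (hB U)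
    have := mul_nonneg hKp0 (l1Box_nonneg L (f 0))
    nlinarith
  -- integrate
  calc |curvCorr r β L (k + 1) f| = |∫ U, ∏ i, A i U ∂μ| := by rw [hcurv]
    _ ≤ ∫ U, |∏ i, A i U| ∂μ := abs_integral_le_integral_abs
    _ ≤ ∫ U, Kp * l1Box L (f 0) * (16 * wilsonAction r.ρ U + D) ∂μ := integral_mono hPint hRint hprod
    _ = Kp * l1Box L (f 0) * (16 * ES + D) := by
        rw [integral_const_mul, integral_add (hSint.const_mul 16) (integrable_const D),
          integral_const_mul, integral_const, probReal_univ, one_smul]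
    _ ≤ Kp * l1Box L (f 0) * (16 * ES + 16 * ES) := by
        have := mul_nonneg hKp0 (l1Box_nonneg L (f 0))
        nlinarith
    _ = 32 * l1Box L (f 0) * Kp * ES := by ring

/-- **Finite-torus regularity holds** (cycle 1 §E `curvatureTorusRegular_holds`, re-proved): the
genuine centred plaquette `n`-point functions on a fixed odd torus are continuous in `β` and
converge as `β → ∞` (to `1` for `n = 0`, to `0` for `n ≥ 1`). [folklore] -/
theorem curvatureTorusRegular_holds' :
    ∀ (n : ℕ) (f : Fin n → 𝓢(EuclideanSpace ℝ (Fin 4), ℝ)),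
      Continuous (fun β => curvCorr r β L n f) ∧
        ∃ ℓ : ℝ, Tendsto (fun β => curvCorr r β L n f) atTop (𝓝 ℓ) := by
  intro n f
  refine ⟨continuous_wilsonCentredSchwinger r L _ _ f, ?_⟩
  cases n with
  | zero =>
    refine ⟨1, tendsto_const_nhds.congr fun β => ?_⟩
    haveI := isProbabilityMeasure_wilsonMeasure (d := 4) (L := 2 * L + 1) r.ρ r.continuous β
    unfold curvCorr
    rw [wilsonCentredSchwinger_zero]
    exact (probReal_univ).symm
  | succ k =>
    obtain ⟨Kc, hKc⟩ := abs_curvCorr_le r L k f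
    refine ⟨0, ?_⟩
    have h := (tendsto_expect_wilsonAction r (2 * L + 1)).const_mul Kc
    rw [mul_zero] at h
    exact squeeze_zero_norm (fun β => by rw [Real.norm_eq_abs]; exact hKc β) h

end TorusRegularity


section RegularityBridge

variable {G : Type} [Group G] [TopologicalSpace G] [IsTopologicalGroup G] [CompactSpace G]
  [MeasurableSpace G] [BorelSpace G] (r : LatticeRep G)

/-- **`CurvatureTorusRegular r` holds for every lattice representation** (§E). [folklore] -/
theorem curvatureTorusRegular_holds : CurvatureTorusRegular r := fun L n f =>
  ⟨(curvatureTorusRegular_holds' r L n f).1.continuousOn, (curvatureTorusRegular_holds' r L n f).2⟩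

end RegularityBridge

/-! ## What every inhabitant forces (§T, §L, §C) and what it does not pin (§R) -/

section Inhabitant

variable {G : Type} [Group G] [TopologicalSpace G] [IsTopologicalGroup G] [CompactSpace G]
  [MeasurableSpace G] [BorelSpace G] {r : LatticeRep G} {M : ℕ} (S : BalabanBanachStep G r M)


/-! ### §T  Transport: in-chart orbit points of Wilson points carry genuine dilated Wilson data -/

/-- Odd block factors keep odd tori odd: `M^k (2L+1) = 2 L' + 1` with
`L' = (M^k (2L+1) - 1)/2`. [folklore] -/
theorem pow_mul_odd_eq (hM : Odd M) (k L : ℕ) :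
    M ^ k * (2 * L + 1) = 2 * ((M ^ k * (2 * L + 1) - 1) / 2) + 1 := by
  have hodd : Odd (M ^ k * (2 * L + 1)) := (hM.pow).mul ⟨L, rfl⟩
  obtain ⟨m, hm⟩ := hodd
  omega

/-- **Transport theorem.** At the `k`-th step of the orbit of the Wilson point `(g, yW g)`
(`g ∈ (0, g₀]`, orbit in the chart for `k` steps) the realisation functional on the odd torus
`2L+1` IS the genuine centred Wilson `n`-point function at inverse coupling `betaOf g` on the
torus `2L'+1 = M^k (2L+1)` with `k`-fold block-dilated test functions — for odd `M` (where such
`L'` exists for every `k`, `pow_mul_odd_eq`) nothing in the structure is free there. [folklore] -/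
theorem expect_orbit_wilson {g : ℝ} (hg : g ∈ Set.Ioc 0 S.g₀) (k : ℕ)
    (hk : ∀ i < k, (S.F^[i] (g, S.yW g)).1 ∈ Set.Icc 0 S.δ ∧ ‖(S.F^[i] (g, S.yW g)).2‖ ≤ S.R)
    (L L' n : ℕ) (hL : M ^ k * (2 * L + 1) = 2 * L' + 1) (σ : Fin n → YMSpecies G)
    (f : Fin n → 𝓢(EuclideanSpace ℝ (Fin 4), ℝ)) :
    S.expect (S.F^[k] (g, S.yW g)) (2 * L + 1) n σ f =
      wilsonCentredSchwinger r.ρ (S.betaOf g) L' (S.c g) n σ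
        (fun i => (blockDilate M)^[k] (f i)) := by
  rw [S.expect_iterate (g, S.yW g) k hk (2 * L + 1) n σ f, hL, S.expect_wilson g hg]

/-- **Accumulation ⇒ continuum-type convergence.** If a sequence of in-chart orbit points of
Wilson points converges IN THE CHART, then (odd `M`, off-diagonal tuple) the corresponding genuine
Wilson data — at inverse couplings `betaOf g_j`, on tori `M^{k_j}(2L+1)`, with `k_j`-fold dilated
test functions — converge (to the value of `expect` at the limit point). With `k_j → ∞`,
`g_j → 0⁺` this is a joint continuum/thermodynamic limit statement along the inhabitant's own
tuning `β_j = betaOf g_j`: the content (4c) carries for odd `M`. [folklore] -/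
theorem tendsto_wilson_of_tendsto_orbit (hM : Odd M) {g : ℕ → ℝ} {k : ℕ → ℕ}
    (hg : ∀ j, g j ∈ Set.Ioc 0 S.g₀)
    (hk : ∀ j, ∀ i ≤ k j, (S.F^[i] (g j, S.yW (g j))).1 ∈ Set.Icc 0 S.δ ∧
      ‖(S.F^[i] (g j, S.yW (g j))).2‖ ≤ S.R)
    {q : ℝ × S.E} (hq : q ∈ Set.Icc 0 S.δ ×ˢ Metric.closedBall (0 : S.E) S.R)
    (hconv : Tendsto (fun j => S.F^[k j] (g j, S.yW (g j))) atTop (𝓝 q))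
    (L n : ℕ) (σ : Fin n → YMSpecies G) (f : Fin n → 𝓢(EuclideanSpace ℝ (Fin 4), ℝ))
    (hf : IsOffDiagonal (SchwartzMap.tensorFin n fun i => ofRealTest (f i))) :
    Tendsto (fun j => wilsonCentredSchwinger r.ρ (S.betaOf (g j))
        ((M ^ (k j) * (2 * L + 1) - 1) / 2) (S.c (g j)) n σ
        (fun i => (blockDilate M)^[k j] (f i))) atTop (𝓝 (S.expect q (2 * L + 1) n σ f)) := by
  have hmem : ∀ j, S.F^[k j] (g j, S.yW (g j)) ∈
      Set.Icc 0 S.δ ×ˢ Metric.closedBall (0 : S.E) S.R := fun j => by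
    have h := hk j (k j) le_rfl
    exact Set.mk_mem_prod h.1 (by simpa [Metric.mem_closedBall, dist_zero_right] using h.2)
  have hcont := S.continuousOn_expect (2 * L + 1) n σ f hf q hq
  have h1 : Tendsto (fun j => S.F^[k j] (g j, S.yW (g j))) atTop
      (𝓝[Set.Icc 0 S.δ ×ˢ Metric.closedBall (0 : S.E) S.R] q) :=
    tendsto_nhdsWithin_iff.2 ⟨hconv, Eventually.of_forall hmem⟩
  have h2 := hcont.tendsto.comp h1
  refine h2.congr fun j => ?_
  simp only [Function.comp_apply]
  exact expect_orbit_wilson S (hg j) (k j) (fun i hi => hk j i hi.le) L _ n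
    (pow_mul_odd_eq hM (k j) L) σ f

/-! ### §L  Orbit length: Wilson orbits stay in the chart for ≳ 1/(2c₁g²) steps -/

/-- The cubic growth constant of the coupling on the basin: `|φ g y − g| ≤ c₁ |g|³`. -/
def c₁ : ℝ := S.b + S.C * (S.δ + S.R)

theorem c₁_pos : 0 < (c₁ S) := by
  have := S.b_pos; have := S.C_pos; have := S.δ_pos; have := S.R_pos
  unfold c₁; positivity

/-- On the basin the coupling moves by at most `c₁ g³` per step. [folklore] -/
theorem abs_φ_sub_self_le {g : ℝ} {y : S.E} (hg0 : 0 ≤ g) (hg : g ≤ S.δ) (hy : ‖y‖ ≤ S.R) :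
    |S.φ g y - g| ≤ (c₁ S) * g ^ 3 := by
  have habs : |g| ≤ S.δ := by rwa [abs_of_nonneg hg0]
  have h := S.abs_φ_sub_le habs hy
  rw [abs_of_nonneg hg0] at h
  have hC := S.C_pos.le
  have hg4 : g ^ 4 ≤ S.δ * g ^ 3 := by nlinarith [pow_nonneg hg0 3]
  calc |S.φ g y - g| ≤ S.b * g ^ 3 + S.C * (g ^ 4 + g ^ 3 * S.R) := h
    _ ≤ S.b * g ^ 3 + S.C * (S.δ * g ^ 3 + g ^ 3 * S.R) := by gcongr
    _ = (c₁ S) * g ^ 3 := by unfold c₁; ring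

/-- Elementary: if `0 < g' ≤ g + c g³` (`c ≥ 0`, `g > 0`) then `1/g'² ≥ 1/g² − 2c`. [folklore] -/
theorem inv_sq_step {g g' c : ℝ} (hg : 0 < g) (hg' : 0 < g') (hc : 0 ≤ c)
    (h : g' ≤ g + c * g ^ 3) : 1 / g ^ 2 - 2 * c ≤ 1 / g' ^ 2 := by
  have hx : 0 ≤ c * g ^ 2 := by positivity
  -- (1 - 2x)(1 + x)^2 ≤ 1 with x = c g²
  have key : (1 - 2 * (c * g ^ 2)) * (1 + c * g ^ 2) ^ 2 ≤ 1 := by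
    nlinarith [sq_nonneg (c * g ^ 2), mul_nonneg hx (sq_nonneg (c * g ^ 2))]
  have hg'le : g' ≤ g * (1 + c * g ^ 2) := by nlinarith
  have hpos : 0 < g * (1 + c * g ^ 2) := by positivity
  have h1 : 1 / (g * (1 + c * g ^ 2)) ^ 2 ≤ 1 / g' ^ 2 := by
    apply one_div_le_one_div_of_le (by positivity)
    exact pow_le_pow_left₀ hg'.le hg'le 2
  refine le_trans ?_ h1
  have e1 : 1 / g ^ 2 - 2 * c = (1 - 2 * (c * g ^ 2)) / g ^ 2 := by
    field_simp
  rw [e1, div_le_div_iff₀ (by positivity) (by positivity), one_mul]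
  calc (1 - 2 * (c * g ^ 2)) * (g * (1 + c * g ^ 2)) ^ 2
      = g ^ 2 * ((1 - 2 * (c * g ^ 2)) * (1 + c * g ^ 2) ^ 2) := by ring
    _ ≤ g ^ 2 * 1 := by gcongr
    _ = g ^ 2 := mul_one _

/-- A smallness threshold `gₛ > 0` for the coupling: `gₛ ≤ δ`, `c₁ gₛ² ≤ 1/2`,
`C gₛ² ≤ (1 − θ') R`. -/
def gₛ : ℝ := min S.δ (min (Real.sqrt (1 / (2 * (c₁ S)))) (Real.sqrt ((1 - S.θ') * S.R / S.C)))

theorem gₛ_pos : 0 < (gₛ S) := by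
  have h1 := S.δ_pos; have h2 := (c₁_pos S); have h3 := S.C_pos; have h4 := S.R_pos
  have h5 : 0 < 1 - S.θ' := by linarith [S.θ'_lt_one]
  unfold gₛ
  refine lt_min h1 (lt_min (Real.sqrt_pos.2 (by positivity)) (Real.sqrt_pos.2 (by positivity)))

theorem gₛ_le_δ : (gₛ S) ≤ S.δ := min_le_left _ _

theorem c₁_mul_gₛ_sq : (c₁ S) * (gₛ S) ^ 2 ≤ 1 / 2 := by
  have h2 := (c₁_pos S)
  have hle : (gₛ S) ≤ Real.sqrt (1 / (2 * (c₁ S))) := (min_le_right _ _).trans (min_le_left _ _)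
  have hsq : (gₛ S) ^ 2 ≤ 1 / (2 * (c₁ S)) := by
    calc (gₛ S) ^ 2 ≤ (Real.sqrt (1 / (2 * (c₁ S)))) ^ 2 := pow_le_pow_left₀ (gₛ_pos S).le hle 2
      _ = 1 / (2 * (c₁ S)) := Real.sq_sqrt (by positivity)
  calc (c₁ S) * (gₛ S) ^ 2 ≤ (c₁ S) * (1 / (2 * (c₁ S))) := by gcongr
    _ = 1 / 2 := by field_simp

theorem C_mul_gₛ_sq : S.C * (gₛ S) ^ 2 ≤ (1 - S.θ') * S.R := by
  have h3 := S.C_pos; have h4 := S.R_pos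
  have h5 : 0 < 1 - S.θ' := by linarith [S.θ'_lt_one]
  have hle : (gₛ S) ≤ Real.sqrt ((1 - S.θ') * S.R / S.C) :=
    (min_le_right _ _).trans (min_le_right _ _)
  have hsq : (gₛ S) ^ 2 ≤ (1 - S.θ') * S.R / S.C := by
    calc (gₛ S) ^ 2 ≤ (Real.sqrt ((1 - S.θ') * S.R / S.C)) ^ 2 := pow_le_pow_left₀ (gₛ_pos S).le hle 2
      _ = (1 - S.θ') * S.R / S.C := Real.sq_sqrt (by positivity)
  calc S.C * (gₛ S) ^ 2 ≤ S.C * ((1 - S.θ') * S.R / S.C) := by gcongr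
    _ = (1 - S.θ') * S.R := by field_simp

/-- **Orbit-length theorem (NEW, cycle 2).** For a Wilson coupling `g ∈ (0, min gₛ g₀]` the orbit
of `(g, yW g)` stays in the chart, with positive coupling `≤ gₛ` and `1/g_j² ≥ 1/g² − 2 c₁ j`,
for every `j ≤ k` as long as `2 c₁ k ≤ 1/g² − 1/gₛ²`.  So the number of in-chart steps is at
least `(1/g² − 1/gₛ²)/(2c₁) ≈ betaOf g /(2 c₁ κ)`: LINEAR in the inverse bare coupling, i.e. the
pinned tori `M^k (2L+1)` reach sizes EXPONENTIAL in `β`. [folklore] -/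
theorem orbit_mem_chart {g : ℝ} (hg0 : 0 < g) (hgs : g ≤ (gₛ S)) (hg₀ : g ≤ S.g₀) (k : ℕ)
    (hk : 2 * (c₁ S) * k ≤ 1 / g ^ 2 - 1 / (gₛ S) ^ 2) :
    ∀ j ≤ k, 0 < (S.F^[j] (g, S.yW g)).1 ∧ (S.F^[j] (g, S.yW g)).1 ≤ (gₛ S) ∧
      ‖(S.F^[j] (g, S.yW g)).2‖ ≤ S.R ∧
      1 / g ^ 2 - 2 * (c₁ S) * j ≤ 1 / (S.F^[j] (g, S.yW g)).1 ^ 2 := by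
  intro j hj
  induction j with
  | zero =>
    simp only [Function.iterate_zero, id_eq, CharP.cast_eq_zero, mul_zero, sub_zero, le_refl,
      and_true]
    exact ⟨hg0, hgs, S.norm_yW_le g ⟨hg0.le, hg₀⟩⟩
  | succ j ih =>
    obtain ⟨hpos, hle, hy, hinv⟩ := ih (Nat.le_of_succ_le hj)
    set q := S.F^[j] (g, S.yW g) with hq
    have hstep : S.F^[j + 1] (g, S.yW g) = (S.φ q.1 q.2, S.Ψ q.1 q.2) := by
      rw [Function.iterate_succ_apply', hq]; rfl
    rw [hstep]
    simp only
    have hqδ : q.1 ≤ S.δ := hle.trans (gₛ_le_δ S)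
    have habs : |q.1| ≤ S.δ := by rwa [abs_of_pos hpos]
    have hφ := (abs_φ_sub_self_le S) hpos.le hqδ hy
    have hc₁ := (c₁_pos S)
    have hq2 : (c₁ S) * q.1 ^ 2 ≤ 1 / 2 := by
      calc (c₁ S) * q.1 ^ 2 ≤ (c₁ S) * (gₛ S) ^ 2 := by gcongr
        _ ≤ 1 / 2 := (c₁_mul_gₛ_sq S)
    -- positivity of the new coupling
    have hlow : q.1 - (c₁ S) * q.1 ^ 3 ≤ S.φ q.1 q.2 := by linarith [(abs_le.1 hφ).1]
    have hpos' : 0 < S.φ q.1 q.2 := by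
      have : q.1 / 2 ≤ q.1 - (c₁ S) * q.1 ^ 3 := by nlinarith
      linarith
    -- inverse-square decrement
    have hup : S.φ q.1 q.2 ≤ q.1 + (c₁ S) * q.1 ^ 3 := by linarith [(abs_le.1 hφ).2]
    have hinv' := inv_sq_step hpos hpos' hc₁.le hup
    have hinv'' : 1 / g ^ 2 - 2 * (c₁ S) * (j + 1 : ℕ) ≤ 1 / S.φ q.1 q.2 ^ 2 := by
      push_cast; linarith
    -- the new coupling is ≤ gₛ
    have hk' : 1 / (gₛ S) ^ 2 ≤ 1 / g ^ 2 - 2 * (c₁ S) * (j + 1 : ℕ) := by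
      have : (2 * (c₁ S) * (j + 1 : ℕ) : ℝ) ≤ 2 * (c₁ S) * k := by
        gcongr
      linarith
    have hle' : S.φ q.1 q.2 ≤ (gₛ S) := by
      have h := hk'.trans hinv''
      have hgs := (gₛ_pos S)
      rw [div_le_div_iff₀ (by positivity) (by positivity), one_mul, one_mul] at h
      nlinarith
    -- fibre stays in the basin
    have hy' : ‖S.Ψ q.1 q.2‖ ≤ S.R := by
      refine S.norm_Ψ_le_R habs hy ?_
      calc S.C * q.1 ^ 2 ≤ S.C * (gₛ S) ^ 2 := by have := S.C_pos; gcongr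
        _ ≤ (1 - S.θ') * S.R := (C_mul_gₛ_sq S)
    exact ⟨hpos', hle', hy', hinv''⟩

/-- Corollary in the form consumed by `expect_iterate` / `expect_orbit_wilson`. [folklore] -/
theorem orbit_hyp {g : ℝ} (hg0 : 0 < g) (hgs : g ≤ (gₛ S)) (hg₀ : g ≤ S.g₀) (k : ℕ)
    (hk : 2 * (c₁ S) * k ≤ 1 / g ^ 2 - 1 / (gₛ S) ^ 2) :
    ∀ i ≤ k, (S.F^[i] (g, S.yW g)).1 ∈ Set.Icc 0 S.δ ∧ ‖(S.F^[i] (g, S.yW g)).2‖ ≤ S.R := by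
  intro i hi
  obtain ⟨h1, h2, h3, -⟩ := (orbit_mem_chart S) hg0 hgs hg₀ k hk i hi
  exact ⟨⟨h1.le, h2.trans (gₛ_le_δ S)⟩, h3⟩

/-- **Exponentially large pinned tori.** For odd `M`, every Wilson coupling `g ∈ (0, min gₛ g₀]`
and every `k ≤ (1/g² − 1/gₛ²)/(2c₁)`, the genuine Wilson `n`-point data at `β = betaOf g` on the
torus of side `M^k (2L+1)` with `k`-fold dilated test functions are values of `expect` at a point
of the chart `[0, δ] × B̄_R` (where (4c) demands continuity). [folklore] -/
theorem wilson_data_in_chart (hM : Odd M) {g : ℝ} (hg0 : 0 < g) (hgs : g ≤ (gₛ S))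
    (hg₀ : g ≤ S.g₀) (k : ℕ) (hk : 2 * (c₁ S) * k ≤ 1 / g ^ 2 - 1 / (gₛ S) ^ 2)
    (L n : ℕ) (σ : Fin n → YMSpecies G) (f : Fin n → 𝓢(EuclideanSpace ℝ (Fin 4), ℝ)) :
    S.F^[k] (g, S.yW g) ∈ Set.Icc 0 S.δ ×ˢ Metric.closedBall (0 : S.E) S.R ∧
    S.expect (S.F^[k] (g, S.yW g)) (2 * L + 1) n σ f =
      wilsonCentredSchwinger r.ρ (S.betaOf g) ((M ^ k * (2 * L + 1) - 1) / 2) (S.c g) n σ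
        (fun i => (blockDilate M)^[k] (f i)) := by
  have h := (orbit_hyp S) hg0 hgs hg₀ k hk
  refine ⟨?_, expect_orbit_wilson S ⟨hg0, hg₀⟩ k (fun i hi => h i (le_of_lt hi)) L _ n
    (pow_mul_odd_eq hM k L) σ f⟩
  have hk' := h k le_rfl
  exact Set.mk_mem_prod hk'.1 (by simpa [Metric.mem_closedBall, dist_zero_right] using hk'.2)



/-! ### §C  The corner `(0, yW 0)`: a necessary condition every inhabitant forces -/

/-- The Wilson arc enters the chart continuously at `g = 0`. [folklore] -/
theorem tendsto_wilsonArc :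
    Tendsto (fun g => (g, S.yW g)) (𝓝[>] 0)
      (𝓝[Set.Icc 0 S.δ ×ˢ Metric.closedBall (0 : S.E) S.R] (0, S.yW 0)) := by
  have hcont : ContinuousWithinAt S.yW (Set.Icc 0 S.g₀) 0 :=
    S.continuousOn_yW 0 ⟨le_rfl, S.g₀_pos.le⟩
  have h1 : Tendsto S.yW (𝓝[>] 0) (𝓝 (S.yW 0)) := by
    have h := hcont.tendsto
    refine h.mono_left ?_
    rw [← nhdsWithin_Ioo_eq_nhdsGT S.g₀_pos]
    exact nhdsWithin_mono _ Set.Ioo_subset_Icc_self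
  have h2 : Tendsto (fun g : ℝ => g) (𝓝[>] (0 : ℝ)) (𝓝 0) := nhdsWithin_le_nhds
  refine tendsto_nhdsWithin_iff.2 ⟨(h2.prodMk_nhds h1), ?_⟩
  have hmem : Set.Ioo (0 : ℝ) (min S.δ S.g₀) ∈ 𝓝[>] (0 : ℝ) :=
    Ioo_mem_nhdsGT (lt_min S.δ_pos S.g₀_pos)
  filter_upwards [hmem] with g hg
  exact S.wilson_mem_chart hg.1.le (hg.2.le.trans (min_le_left _ _))
    (hg.2.le.trans (min_le_right _ _))

/-- **Corner condition.** For every inhabitant, every odd torus and every off-diagonal tuple,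
the genuine centred Wilson `n`-point functions at `β = betaOf g` (normalisations `c g`)
converge as `g → 0⁺` — to `expect (0, yW 0)`. (Cycle 1, §C; re-proved.) [folklore] -/
theorem tendsto_wilson_corner (L n : ℕ) (σ : Fin n → YMSpecies G)
    (f : Fin n → 𝓢(EuclideanSpace ℝ (Fin 4), ℝ))
    (hf : IsOffDiagonal (SchwartzMap.tensorFin n fun i => ofRealTest (f i))) :
    Tendsto (fun g => wilsonCentredSchwinger r.ρ (S.betaOf g) L (S.c g) n σ f) (𝓝[>] 0)
      (𝓝 (S.expect (0, S.yW 0) (2 * L + 1) n σ f)) := by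
  have h0 : ((0 : ℝ), S.yW 0) ∈ Set.Icc 0 S.δ ×ˢ Metric.closedBall (0 : S.E) S.R :=
    S.wilson_mem_chart le_rfl S.δ_pos.le S.g₀_pos.le
  have h := ((S.continuousOn_expect (2 * L + 1) n σ f hf) _ h0).tendsto.comp (tendsto_wilsonArc S)
  have hmem : Set.Ioo (0 : ℝ) S.g₀ ∈ 𝓝[>] (0 : ℝ) := Ioo_mem_nhdsGT S.g₀_pos
  refine h.congr' ?_
  filter_upwards [hmem] with g hg
  simp only [Function.comp_apply]
  exact S.expect_wilson g ⟨hg.1, hg.2.le⟩ L n σ f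

/-- **Filter inversion of `betaOf`**: every large inverse coupling is `betaOf g` for `g` near
`0⁺` (IVT + `betaOf → ∞`), so limits along `g → 0⁺` of functions of `betaOf g` are limits along
`β → ∞`. (Cycle 1 `atTop_le_map_betaOf`; re-proved.) [folklore] -/
theorem atTop_le_map_betaOf : (atTop : Filter ℝ) ≤ map S.betaOf (𝓝[>] 0) := by
  intro A hA
  rw [mem_map] at hA
  obtain ⟨η, hη, hsub⟩ : ∃ η > 0, Set.Ioo 0 η ⊆ S.betaOf ⁻¹' A := by
    rcases (mem_nhdsGT_iff_exists_Ioo_subset).1 hA with ⟨η, hη, h⟩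
    exact ⟨η, hη, h⟩
  set η' := min (η / 2) S.g₀ with hη'
  have hη'pos : 0 < η' := lt_min (by linarith) S.g₀_pos
  have hη'η : η' < η := (min_le_left _ _).trans_lt (by linarith)
  have hη'g₀ : η' ≤ S.g₀ := min_le_right _ _
  rw [mem_atTop_sets]
  refine ⟨S.betaOf η', fun β hβ => ?_⟩
  -- find g₁ ∈ (0, η') with betaOf g₁ ≥ β
  have hev : ∀ᶠ g in 𝓝[>] (0 : ℝ), β ≤ S.betaOf g := S.tendsto_betaOf.eventually (eventually_ge_atTop β)
  have hev2 : ∀ᶠ g in 𝓝[>] (0 : ℝ), g ∈ Set.Ioo 0 η' := Ioo_mem_nhdsGT hη'pos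
  obtain ⟨g₁, hg₁β, hg₁⟩ := (hev.and hev2).exists
  have hcont : ContinuousOn S.betaOf (Set.Icc g₁ η') :=
    S.continuousOn_betaOf.mono fun x hx => ⟨hg₁.1.trans_le hx.1, hx.2.trans hη'g₀⟩
  have hIVT := intermediate_value_Icc' hg₁.2.le hcont
  obtain ⟨g, hg, hgβ⟩ := hIVT ⟨hβ, hg₁β⟩
  rw [← hgβ]
  exact hsub ⟨hg₁.1.trans_le hg.1, hg.2.trans_lt hη'η⟩

theorem tendsto_atTop_of_comp_betaOf {X : Type} {l : Filter X} {w : ℝ → X}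
    (h : Tendsto (fun g => w (S.betaOf g)) (𝓝[>] 0) l) : Tendsto w atTop l :=
  (tendsto_map' h).mono_left (atTop_le_map_betaOf S) |>.congr fun _ => rfl

/-- The centred Wilson `n`-point function depends on the normalisations only through `c ∘ σ`. [folklore] -/
theorem wilsonCentredSchwinger_congr_c {N : ℕ} (ρ : G →* Matrix (Fin N) (Fin N) ℂ) (β : ℝ)
    (L : ℕ) {c c' : YMSpecies G → ℝ} {n : ℕ} {σ : Fin n → YMSpecies G}
    (h : ∀ i, c (σ i) = c' (σ i)) (f : Fin n → 𝓢(EuclideanSpace ℝ (Fin 4), ℝ)) :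
    wilsonCentredSchwinger ρ β L c n σ f = wilsonCentredSchwinger ρ β L c' n σ f := by
  unfold wilsonCentredSchwinger
  simp_rw [h]

/-- **Necessary condition in `β` (pure curvature).** Any inhabitant (any `M`) forces the genuine
centred plaquette `n`-point functions on every fixed odd torus to CONVERGE as `β → ∞`, for
off-diagonal tuples. This is true (limit `0` for `n ≥ 1`: concentration of Wilson's measure on
flat configurations; cycle 1 §E proved it) — a near-miss, not a kill. [folklore] -/
theorem tendsto_curvCorr_atTop (L n : ℕ) (f : Fin n → 𝓢(EuclideanSpace ℝ (Fin 4), ℝ))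
    (hf : IsOffDiagonal (SchwartzMap.tensorFin n fun i => ofRealTest (f i))) :
    Tendsto (fun β => curvCorr r β L n f) atTop
      (𝓝 (S.expect (0, S.yW 0) (2 * L + 1) n (fun _ => r.curvature) f)) := by
  refine (tendsto_atTop_of_comp_betaOf S) ?_
  have h := (tendsto_wilson_corner S) L n (fun _ => r.curvature) f hf
  refine h.congr fun g => ?_
  exact wilsonCentredSchwinger_congr_c r.ρ _ L (fun i => S.c_curvature g) f



/-! ### §R  Rescaling the coupling coordinate: `b₀` alone is not pinned by the structure -/

section Rescale

variable (l : ℝ) (hl : 0 < l)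

/-- `μ = min l 1`, the loss factor of the rescaling. -/
private def μ (l : ℝ) : ℝ := min l 1

private theorem μ_pos (hl : 0 < l) : 0 < μ l := lt_min hl one_pos
private theorem μ_le_l : μ l ≤ l := min_le_left _ _
private theorem μ_le_one : μ l ≤ 1 := min_le_right _ _

/-- `1 / l^a ≤ 1 / μ³` for `a = 1, 2, 3`, and `1 ≤ 1/μ³`. -/
private theorem inv_pow_le (hl : 0 < l) {a : ℕ} (ha : a ≤ 3) : 1 / l ^ a ≤ 1 / (μ l) ^ 3 := by
  have hμ := μ_pos l hl
  have h1 : (μ l) ^ 3 ≤ (μ l) ^ a := pow_le_pow_of_le_one hμ.le (μ_le_one l) ha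
  have h2 : (μ l) ^ a ≤ l ^ a := pow_le_pow_left₀ hμ.le (μ_le_l l) a
  exact one_div_le_one_div_of_le (by positivity) (h1.trans h2)

private theorem one_le_inv_μ (hl : 0 < l) : (1 : ℝ) ≤ 1 / (μ l) ^ 3 := by
  have h := inv_pow_le l hl (a := 0) (by norm_num)
  simpa using h

include hl in
/-- Key estimate for the rescaled coupling remainder. -/
private theorem resc_φ_bound {g : ℝ} {y : S.E}
    (h : |S.φ (g / l) y - (g / l + S.b * (g / l) ^ 3)| ≤ S.C * ((g / l) ^ 4 + |g / l| ^ 3 * ‖y‖)) :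
    |l * S.φ (g / l) y - (g + S.b / l ^ 2 * g ^ 3)| ≤
      S.C / (μ l) ^ 3 * (g ^ 4 + |g| ^ 3 * ‖y‖) := by
  have hC := S.C_pos.le
  have hl' : l ≠ 0 := hl.ne'
  have e : l * S.φ (g / l) y - (g + S.b / l ^ 2 * g ^ 3) =
      l * (S.φ (g / l) y - (g / l + S.b * (g / l) ^ 3)) := by
    field_simp
  rw [e, abs_mul, abs_of_pos hl]
  have h3 := inv_pow_le l hl (a := 3) le_rfl
  have h2 := inv_pow_le l hl (a := 2) (by norm_num)
  calc l * |S.φ (g / l) y - (g / l + S.b * (g / l) ^ 3)|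
      ≤ l * (S.C * ((g / l) ^ 4 + |g / l| ^ 3 * ‖y‖)) := by gcongr
    _ = S.C * (g ^ 4 * (1 / l ^ 3) + |g| ^ 3 * ‖y‖ * (1 / l ^ 2)) := by
        rw [abs_div, abs_of_pos hl]
        field_simp
    _ ≤ S.C * (g ^ 4 * (1 / (μ l) ^ 3) + |g| ^ 3 * ‖y‖ * (1 / (μ l) ^ 3)) := by
        gcongr
    _ = S.C / (μ l) ^ 3 * (g ^ 4 + |g| ^ 3 * ‖y‖) := by
        field_simp

include hl in
private theorem abs_div_le {g : ℝ} (hg : |g| ≤ μ l * S.δ) : |g / l| ≤ S.δ := by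
  rw [abs_div, abs_of_pos hl, div_le_iff₀ hl]
  calc |g| ≤ μ l * S.δ := hg
    _ ≤ l * S.δ := by gcongr; exacts [S.δ_pos.le, μ_le_l l]
    _ = S.δ * l := mul_comm _ _

/-- **The rescaled step** `g ↦ l·g`: same chart `E`, same `A, θ, θ', R, K`; `φ' g y = l φ(g/l) y`,
`Ψ' g y = Ψ (g/l) y`, `b' = b/l²`, `b₀' = b₀/l²`, `κ' = κ l²`, `δ' = min l 1 · δ`,
`C' = C / (min l 1)³`, `g₀' = l g₀`, `yW' = yW (·/l)`, `betaOf' = betaOf (·/l)`, `c' = c (·/l)`,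
`expect' (g, y) = expect (g/l, y)`.  Every field of `BalabanBanachStep` is re-verified. -/
def rescale : BalabanBanachStep G r M where
  E := S.E
  φ g y := l * S.φ (g / l) y
  Ψ g y := S.Ψ (g / l) y
  A := S.A
  b := S.b / l ^ 2
  θ := S.θ
  C := S.C / (μ l) ^ 3
  δ := μ l * S.δ
  b_pos := div_pos S.b_pos (by positivity)
  θ_nonneg := S.θ_nonneg
  θ_lt_one := S.θ_lt_one
  C_pos := div_pos S.C_pos (pow_pos (μ_pos l hl) 3)
  δ_pos := mul_pos (μ_pos l hl) S.δ_pos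
  norm_A_le := S.norm_A_le
  remainder g y hg hy := by
    have hμ1 := μ_le_one l
    have hgl : |g / l| ≤ S.δ := abs_div_le S l hl hg
    have hyδ : ‖y‖ ≤ S.δ := hy.trans (by nlinarith [S.δ_pos])
    have h := S.remainder (g / l) y hgl hyδ
    refine ⟨resc_φ_bound S l hl h.1, ?_⟩
    have h2 := inv_pow_le l hl (a := 2) (by norm_num)
    have h0 := one_le_inv_μ l hl
    have hC := S.C_pos.le
    calc ‖S.Ψ (g / l) y - S.A y‖ ≤ S.C * ((g / l) ^ 2 + ‖y‖ ^ 2) := h.2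
      _ = S.C * (g ^ 2 * (1 / l ^ 2) + ‖y‖ ^ 2 * 1) := by field_simp
      _ ≤ S.C * (g ^ 2 * (1 / (μ l) ^ 3) + ‖y‖ ^ 2 * (1 / (μ l) ^ 3)) := by gcongr
      _ = S.C / (μ l) ^ 3 * (g ^ 2 + ‖y‖ ^ 2) := by field_simp
  lipschitz_fibre g y y' hg hy hy' := by
    have hμ1 := μ_le_one l
    have hgl : |g / l| ≤ S.δ := abs_div_le S l hl hg
    have hyδ : ‖y‖ ≤ S.δ := hy.trans (by nlinarith [S.δ_pos])
    have hy'δ : ‖y'‖ ≤ S.δ := hy'.trans (by nlinarith [S.δ_pos])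
    have h := S.lipschitz_fibre (g / l) y y' hgl hyδ hy'δ
    have h2 := inv_pow_le l hl (a := 2) (by norm_num)
    have h1 := inv_pow_le l hl (a := 1) (by norm_num)
    have h0 := one_le_inv_μ l hl
    have hC := S.C_pos.le
    constructor
    · have e : l * S.φ (g / l) y - l * S.φ (g / l) y' = l * (S.φ (g / l) y - S.φ (g / l) y') := by
        ring
      rw [e, abs_mul, abs_of_pos hl]
      calc l * |S.φ (g / l) y - S.φ (g / l) y'| ≤ l * (S.C * |g / l| ^ 3 * ‖y - y'‖) := by gcongr; exact h.1
        _ = S.C * (|g| ^ 3 * (1 / l ^ 2)) * ‖y - y'‖ := by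
            rw [abs_div, abs_of_pos hl]; field_simp
        _ ≤ S.C * (|g| ^ 3 * (1 / (μ l) ^ 3)) * ‖y - y'‖ := by gcongr
        _ = S.C / (μ l) ^ 3 * |g| ^ 3 * ‖y - y'‖ := by field_simp
    · calc ‖S.Ψ (g / l) y - S.Ψ (g / l) y' - S.A (y - y')‖
          ≤ S.C * (|g / l| + ‖y‖ + ‖y'‖) * ‖y - y'‖ := h.2
        _ = S.C * (|g| * (1 / l ^ 1) + ‖y‖ * 1 + ‖y'‖ * 1) * ‖y - y'‖ := by
            rw [abs_div, abs_of_pos hl]; field_simp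
        _ ≤ S.C * (|g| * (1 / (μ l) ^ 3) + ‖y‖ * (1 / (μ l) ^ 3) + ‖y'‖ * (1 / (μ l) ^ 3)) *
              ‖y - y'‖ := by gcongr
        _ = S.C / (μ l) ^ 3 * (|g| + ‖y‖ + ‖y'‖) * ‖y - y'‖ := by field_simp
  lipschitz_base g g' y hg hg' hy := by
    have hμ1 := μ_le_one l
    have hgl : |g / l| ≤ S.δ := abs_div_le S l hl hg
    have hg'l : |g' / l| ≤ S.δ := abs_div_le S l hl hg'
    have hyδ : ‖y‖ ≤ S.δ := hy.trans (by nlinarith [S.δ_pos])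
    have h := S.lipschitz_base (g / l) (g' / l) y hgl hg'l hyδ
    have h3 := inv_pow_le l hl (a := 3) le_rfl
    have h2 := inv_pow_le l hl (a := 2) (by norm_num)
    have h1 := inv_pow_le l hl (a := 1) (by norm_num)
    have hC := S.C_pos.le
    have hmax : max |g / l| |g' / l| = max |g| |g'| / l := by
      rw [abs_div, abs_div, abs_of_pos hl, ← max_div_div_right hl.le]
    set m := max |g| |g'| with hm
    have hm0 : 0 ≤ m := (abs_nonneg g).trans (le_max_left _ _)
    constructor
    · have e : l * S.φ (g / l) y - l * S.φ (g' / l) y - (g - g') - S.b / l ^ 2 * (g ^ 3 - g' ^ 3) =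
          l * (S.φ (g / l) y - S.φ (g' / l) y - (g / l - g' / l) -
            S.b * ((g / l) ^ 3 - (g' / l) ^ 3)) := by
        field_simp
      rw [e, abs_mul, abs_of_pos hl]
      calc l * |S.φ (g / l) y - S.φ (g' / l) y - (g / l - g' / l) - S.b * ((g / l) ^ 3 - (g' / l) ^ 3)|
          ≤ l * (S.C * (max |g / l| |g' / l|) ^ 2 * (max |g / l| |g' / l| + ‖y‖) * |g / l - g' / l|) := by
            gcongr; exact h.1
        _ = S.C * m ^ 2 * (m * (1 / l ^ 3) + ‖y‖ * (1 / l ^ 2)) * |g - g'| := by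
            rw [hmax, show g / l - g' / l = (g - g') / l by ring, abs_div, abs_of_pos hl]
            field_simp
        _ ≤ S.C * m ^ 2 * (m * (1 / (μ l) ^ 3) + ‖y‖ * (1 / (μ l) ^ 3)) * |g - g'| := by gcongr
        _ = S.C / (μ l) ^ 3 * m ^ 2 * (m + ‖y‖) * |g - g'| := by field_simp
    · calc ‖S.Ψ (g / l) y - S.Ψ (g' / l) y‖
          ≤ S.C * (|g / l| + |g' / l| + ‖y‖) * |g / l - g' / l| := h.2
        _ = S.C * (|g| * (1 / l ^ 2) + |g'| * (1 / l ^ 2) + ‖y‖ * (1 / l ^ 1)) * |g - g'| := by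
            rw [show g / l - g' / l = (g - g') / l by ring, abs_div, abs_div, abs_div, abs_of_pos hl]
            field_simp
        _ ≤ S.C * (|g| * (1 / (μ l) ^ 3) + |g'| * (1 / (μ l) ^ 3) + ‖y‖ * (1 / (μ l) ^ 3)) *
              |g - g'| := by gcongr
        _ = S.C / (μ l) ^ 3 * (|g| + |g'| + ‖y‖) * |g - g'| := by field_simp
  b₀ := S.b₀ / l ^ 2
  b_eq := by rw [S.b_eq]; ring
  R := S.R
  δ_le_R := by
    calc μ l * S.δ ≤ 1 * S.δ := by gcongr; exacts [S.δ_pos.le, μ_le_one l]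
      _ = S.δ := one_mul _
      _ ≤ S.R := S.δ_le_R
  θ' := S.θ'
  θ'_nonneg := S.θ'_nonneg
  θ'_lt_one := S.θ'_lt_one
  contraction g y y' hg hy hy' := S.contraction (g / l) y y' (abs_div_le S l hl hg) hy hy'
  remainder_basin g y hg hy := by
    have hgl : |g / l| ≤ S.δ := abs_div_le S l hl hg
    exact resc_φ_bound S l hl (S.remainder_basin (g / l) y hgl hy)
  yW g := S.yW (g / l)
  g₀ := l * S.g₀
  g₀_pos := mul_pos hl S.g₀_pos
  continuousOn_yW := by
    refine S.continuousOn_yW.comp (continuousOn_id.div_const l) fun g hg => ?_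
    exact ⟨div_nonneg hg.1 hl.le, (div_le_iff₀ hl).2 (by linarith [hg.2])⟩
  norm_yW_le g hg := S.norm_yW_le (g / l) ⟨div_nonneg hg.1 hl.le, (div_le_iff₀ hl).2 (by linarith [hg.2])⟩
  betaOf g := S.betaOf (g / l)
  strictAntiOn_betaOf := by
    intro g hg g' hg' hlt
    refine S.strictAntiOn_betaOf ⟨div_pos hg.1 hl, (div_le_iff₀ hl).2 (by linarith [hg.2])⟩
      ⟨div_pos hg'.1 hl, (div_le_iff₀ hl).2 (by linarith [hg'.2])⟩ ?_
    exact div_lt_div_of_pos_right hlt hl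
  continuousOn_betaOf := by
    refine S.continuousOn_betaOf.comp (continuousOn_id.div_const l) fun g hg => ?_
    exact ⟨div_pos hg.1 hl, (div_le_iff₀ hl).2 (by linarith [hg.2])⟩
  κ := S.κ * l ^ 2
  κ_pos := mul_pos S.κ_pos (by positivity)
  K := S.K
  betaOf_sub_le g hg := by
    have h := S.betaOf_sub_le (g / l) ⟨div_pos hg.1 hl, (div_le_iff₀ hl).2 (by linarith [hg.2])⟩
    have e : S.κ * l ^ 2 / g ^ 2 = S.κ / (g / l) ^ 2 := by
      have hg0 : g ≠ 0 := hg.1.ne'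
      field_simp
    rw [e]; exact h
  c g := S.c (g / l)
  c_curvature g := S.c_curvature (g / l)
  expect p := S.expect (p.1 / l, p.2)
  expect_step g y hg hy S' n σ f := by
    have hgl : g / l ∈ Set.Icc 0 S.δ := by
      refine ⟨div_nonneg hg.1 hl.le, ?_⟩
      have : |g| ≤ μ l * S.δ := by rw [abs_of_nonneg hg.1]; exact hg.2
      have h := abs_div_le S l hl this
      exact (le_abs_self _).trans h
    have h := S.expect_step (g / l) y hgl hy S' n σ f
    simp only
    rw [mul_div_cancel_left₀ _ hl.ne']
    exact h
  expect_wilson g hg L n σ f := by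
    simp only
    exact S.expect_wilson (g / l) ⟨div_pos hg.1 hl, (div_le_iff₀ hl).2 (by linarith [hg.2])⟩ L n σ f
  continuousOn_expect S' n σ f hf := by
    have hmaps : Set.MapsTo (fun p : ℝ × S.E => (p.1 / l, p.2))
        (Set.Icc 0 (μ l * S.δ) ×ˢ Metric.closedBall (0 : S.E) S.R)
        (Set.Icc 0 S.δ ×ˢ Metric.closedBall (0 : S.E) S.R) := by
      intro p hp
      refine Set.mk_mem_prod ⟨div_nonneg hp.1.1 hl.le, ?_⟩ hp.2
      have : |p.1| ≤ μ l * S.δ := by rw [abs_of_nonneg hp.1.1]; exact hp.1.2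
      exact (le_abs_self _).trans (abs_div_le S l hl this)
    have hcont : Continuous (fun p : ℝ × S.E => (p.1 / l, p.2)) := by fun_prop
    exact (S.continuousOn_expect S' n σ f hf).comp hcont.continuousOn hmaps

/-- The rescaled structure records the one-loop coefficient `b₀ / l²`. [folklore] -/
theorem rescale_b₀ : (rescale S l hl).b₀ = S.b₀ / l ^ 2 := rfl

/-- … and the constant `κ l²`: only the product `b₀ κ` (the slope of `β` per block step,
`β_{k+1} = β_k − 2 b₀ κ log M + o(1)`) is invariant. [folklore] -/
theorem rescale_κ_mul_b₀ : (rescale S l hl).κ * (rescale S l hl).b₀ = S.κ * S.b₀ := by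
  show S.κ * l ^ 2 * (S.b₀ / l ^ 2) = S.κ * S.b₀
  field_simp

end Rescale

include S in
/-- **`b₀` is unpinned (NEW, cycle 2).** If `BalabanBanachStep G r M` is inhabited at all, it is
inhabited with ANY prescribed positive value of the "one-loop coefficient" field `b₀` (rescale the
coupling coordinate). Hence the informal crux's clause "`b₀(G) = 11·C₂(G)/(48π²)`, uniform in `G`"
is NOT captured by the typed crux: `b₀` is meaningful only jointly with `κ` (`rescale_κ_mul_b₀`),
and the product `b₀ κ` — the physical AF slope `β_{k+1} − β_k` — is constrained by NO field. [folklore] -/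
theorem exists_b₀_eq (t : ℝ) (ht : 0 < t) : ∃ S' : BalabanBanachStep G r M, S'.b₀ = t := by
  have hb := S.b₀_pos
  refine ⟨rescale S (Real.sqrt (S.b₀ / t)) (Real.sqrt_pos.2 (div_pos hb ht)), ?_⟩
  rw [rescale_b₀, Real.sq_sqrt (div_pos hb ht).le]
  field_simp


end Inhabitant

/-! ### §S  Species generality is illusory: WLOG an inhabitant kills every non-curvature species -/

section CurvatureOnly

variable {G : Type} [Group G] [TopologicalSpace G] [IsTopologicalGroup G] [CompactSpace G]
  [MeasurableSpace G] [BorelSpace G] (r : LatticeRep G)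

/-- `cInd` vanishes off the curvature species. [folklore] -/
theorem cInd_of_ne {s : YMSpecies G} (hs : s ≠ r.curvature) : cInd r s = 0 := by simp [cInd, hs]

open Classical in
/-- With `cInd`, a species string containing a non-curvature species has vanishing centred
Wilson `n`-point functions (a zero factor). [folklore] -/
theorem wilsonCentredSchwinger_cInd_of_exists (β : ℝ) (L n : ℕ) {σ : Fin n → YMSpecies G}
    (h : ∃ i, σ i ≠ r.curvature) (f : Fin n → 𝓢(EuclideanSpace ℝ (Fin 4), ℝ)) :
    wilsonCentredSchwinger r.ρ β L (cInd r) n σ f = 0 := by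
  obtain ⟨i, hi⟩ := h
  unfold wilsonCentredSchwinger
  have hzero : ∀ U : GaugeConfig 4 (2 * L + 1) G,
      (∏ j, smearedLatticeField (σ j).F (Literature.Probability.LatticeModels.box 4 L) 1
        (cInd r (σ j)) (wilsonTorusMean r.ρ β L (σ j).F) (f j) (torusLift (2 * L + 1) U)) = 0 :=
    fun U => Finset.prod_eq_zero (Finset.mem_univ i) (by simp [smearedLatticeField, cInd, hi])
  simp_rw [hzero, integral_zero]

variable {r} {M : ℕ} (S : BalabanBanachStep G r M)

open Classical in
/-- **The curvature-only reduction of an inhabitant**: same chart, step, basin, Wilson embedding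
and `betaOf`; normalisations `cInd` (zero off the curvature species); realisation functional
equal to `S.expect` on pure-curvature strings and ZERO on every other string. -/
def curvatureOnly : BalabanBanachStep G r M where
  E := S.E
  φ := S.φ
  Ψ := S.Ψ
  A := S.A
  b := S.b
  θ := S.θ
  C := S.C
  δ := S.δ
  b_pos := S.b_pos
  θ_nonneg := S.θ_nonneg
  θ_lt_one := S.θ_lt_one
  C_pos := S.C_pos
  δ_pos := S.δ_pos
  norm_A_le := S.norm_A_le
  remainder := S.remainder
  lipschitz_fibre := S.lipschitz_fibre
  lipschitz_base := S.lipschitz_base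
  b₀ := S.b₀
  b_eq := S.b_eq
  R := S.R
  δ_le_R := S.δ_le_R
  θ' := S.θ'
  θ'_nonneg := S.θ'_nonneg
  θ'_lt_one := S.θ'_lt_one
  contraction := S.contraction
  remainder_basin := S.remainder_basin
  yW := S.yW
  g₀ := S.g₀
  g₀_pos := S.g₀_pos
  continuousOn_yW := S.continuousOn_yW
  norm_yW_le := S.norm_yW_le
  betaOf := S.betaOf
  strictAntiOn_betaOf := S.strictAntiOn_betaOf
  continuousOn_betaOf := S.continuousOn_betaOf
  κ := S.κ
  κ_pos := S.κ_pos
  K := S.K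
  betaOf_sub_le := S.betaOf_sub_le
  c _ := cInd r
  c_curvature _ := cInd_curvature r
  expect p T n σ f := if ∀ i, σ i = r.curvature then S.expect p T n σ f else 0
  expect_step g y hg hy T n σ f := by
    by_cases h : ∀ i, σ i = r.curvature
    · simp only [h, implies_true, ↓reduceIte]; exact S.expect_step g y hg hy T n σ f
    · simp only [h, ↓reduceIte]
  expect_wilson g hg L n σ f := by
    by_cases h : ∀ i, σ i = r.curvature
    · simp only [h, implies_true, ↓reduceIte]
      rw [S.expect_wilson g hg L n σ f]
      exact wilsonCentredSchwinger_congr_c' r.ρ _ L (fun i => by rw [h i, S.c_curvature, cInd_curvature]) f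
    · simp only [h, ↓reduceIte]
      exact (wilsonCentredSchwinger_cInd_of_exists r _ L n (not_forall.1 h) f).symm
  continuousOn_expect T n σ f hf := by
    by_cases h : ∀ i, σ i = r.curvature
    · simp only [h, implies_true, ↓reduceIte]; exact S.continuousOn_expect T n σ f hf
    · simp only [h, ↓reduceIte]; exact continuousOn_const
where
  /-- dependence on `c` only through `c ∘ σ` -/
  wilsonCentredSchwinger_congr_c' {N : ℕ} (ρ : G →* Matrix (Fin N) (Fin N) ℂ) (β : ℝ) (L : ℕ)
      {c c' : YMSpecies G → ℝ} {n : ℕ} {σ : Fin n → YMSpecies G}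
      (h : ∀ i, c (σ i) = c' (σ i)) (f : Fin n → 𝓢(EuclideanSpace ℝ (Fin 4), ℝ)) :
      wilsonCentredSchwinger ρ β L c n σ f = wilsonCentredSchwinger ρ β L c' n σ f := by
    unfold wilsonCentredSchwinger; simp_rw [h]

open Classical in
/-- **Species generality is illusory (NEW, cycle 2).** If `BalabanBanachStep G r M` is inhabited, it is
inhabited by a structure whose normalisations VANISH on every non-curvature species and whose
realisation functional is ZERO on every species string that is not pure curvature (same chart,
step, Wilson embedding, `betaOf`, and the same values on pure-curvature strings). So the only
observable content the typed crux can force concerns the plaquette field `tr F²`; the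
"`n`-point functions of ALL local gauge-invariant fields" needed downstream by `IsYangMillsFor` are
not constrained. PLANNER: pin `c` (e.g. `c g s = 1` for all `s`, or a positivity/normalisation
condition per species) if the crux is to feed `ContinuumLimitOnTrajectory`. [folklore] -/
theorem exists_curvatureOnly :
    ∃ S' : BalabanBanachStep G r M,
      (∀ (g : ℝ) (s : YMSpecies G), s ≠ r.curvature → S'.c g s = 0) ∧
      (∀ (p : ℝ × S'.E) (T n : ℕ) (σ : Fin n → YMSpecies G)
        (f : Fin n → 𝓢(EuclideanSpace ℝ (Fin 4), ℝ)), (∃ i, σ i ≠ r.curvature) → S'.expect p T n σ f = 0) ∧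
      S'.E = S.E ∧ S'.b₀ = S.b₀ ∧ S'.κ = S.κ := by
  refine ⟨curvatureOnly S, fun g s hs => cInd_of_ne r hs, fun p T n σ f hσ => ?_, rfl, rfl, rfl⟩
  obtain ⟨i, hi⟩ := hσ
  have h : ¬ ∀ i, σ i = r.curvature := fun h => hi (h i)
  show (if ∀ i, σ i = r.curvature then S.expect p T n σ f else 0) = 0
  rw [if_neg h]

end CurvatureOnly

/-! ### §A  The junk chart `ℝ × ℝ` and the inhabitant of everything but (4c) -/

section Junk

variable {G : Type} [Group G] [TopologicalSpace G] [IsTopologicalGroup G] [CompactSpace G]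
  [MeasurableSpace G] [BorelSpace G] (r : LatticeRep G) (M : ℕ)

/-- Junk coupling flow `g ↦ g + (log M) g³` (exactly parabolic, `b₀ = 1`). -/
def φJ (g : ℝ) : ℝ := g + Real.log M * g ^ 3

/-- Junk step on the chart `ℝ × (ℝ × ℝ)`: parabolic in `g`, halving in the fibre. -/
def FJ (p : ℝ × (ℝ × ℝ)) : ℝ × (ℝ × ℝ) := (φJ M p.1, (1 / 2 : ℝ) • p.2)

/-- The orbit of the junk Wilson point `(g, (1, g))`: the fibre coordinate `((1/2)^k, (1/2)^k g)`
ENCODES the depth `k` and the bare coupling `g`. [folklore] -/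
theorem FJ_iterate (k : ℕ) (g : ℝ) :
    (FJ M)^[k] (g, ((1 : ℝ), g)) = ((φJ M)^[k] g, ((1 / 2 : ℝ) ^ k, (1 / 2 : ℝ) ^ k * g)) := by
  induction k with
  | zero => simp
  | succ k ih =>
    rw [Function.iterate_succ_apply', ih, Function.iterate_succ_apply']
    simp only [FJ, Prod.smul_mk, smul_eq_mul, Prod.mk.injEq, true_and]
    constructor <;> ring

theorem half_pow_injective : Function.Injective fun k : ℕ => (1 / 2 : ℝ) ^ k :=
  pow_right_injective₀ (by norm_num) (by norm_num)

open Classical in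
/-- The germ of the junk realisation functional: decode `(k, g)` from the fibre coordinate and
return the genuine Wilson data it must carry (`0` elsewhere). -/
def germ (n : ℕ) (σ : Fin n → YMSpecies G) (q : ℝ × (ℝ × ℝ)) (S₀ : ℕ)
    (h : Fin n → 𝓢(EuclideanSpace ℝ (Fin 4), ℝ)) : ℝ :=
  if hq : ∃ k : ℕ, q.2.1 = (1 / 2 : ℝ) ^ k then
    if Odd (M ^ Nat.find hq * S₀) ∧ q.2.2 * 2 ^ Nat.find hq ∈ Set.Ioc (0 : ℝ) 1 then
      wilsonCentredSchwinger r.ρ (1 / (q.2.2 * 2 ^ Nat.find hq) ^ 2)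
        ((M ^ Nat.find hq * S₀ - 1) / 2) (fun _ => 1) n σ
        (fun i => (blockDilate M)^[Nat.find hq] (h i))
    else 0
  else 0

open Classical in
/-- The germ read at an orbit point of a junk Wilson point. [folklore] -/
theorem germ_orbit (n : ℕ) (σ : Fin n → YMSpecies G) {g : ℝ} (hg : g ∈ Set.Ioc (0 : ℝ) 1)
    (k S₀ : ℕ) (h : Fin n → 𝓢(EuclideanSpace ℝ (Fin 4), ℝ)) :
    germ r M n σ ((FJ M)^[k] (g, ((1 : ℝ), g))) S₀ h =
      if Odd (M ^ k * S₀) then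
        wilsonCentredSchwinger r.ρ (1 / g ^ 2) ((M ^ k * S₀ - 1) / 2) (fun _ => 1) n σ
          (fun i => (blockDilate M)^[k] (h i))
      else 0 := by
  rw [FJ_iterate]
  have hq : ∃ k' : ℕ, ((1 / 2 : ℝ) ^ k) = (1 / 2 : ℝ) ^ k' := ⟨k, rfl⟩
  unfold germ
  simp only
  rw [dif_pos hq]
  have hfind : Nat.find hq = k := by
    rw [Nat.find_eq_iff]
    refine ⟨rfl, fun j hj heq => ?_⟩
    exact (Nat.ne_of_lt hj) (half_pow_injective heq).symm
  rw [hfind]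
  have hg' : (1 / 2 : ℝ) ^ k * g * 2 ^ k = g := by
    rw [mul_comm, ← mul_assoc, ← mul_pow]; norm_num
  rw [hg']
  by_cases hodd : Odd (M ^ k * S₀)
  · simp [hodd, hg]
  · simp [hodd]

variable (hM : 2 ≤ M)

/-- The junk realisation functional (F1 recursion over the junk germ). -/
def expectJ (n : ℕ) (σ : Fin n → YMSpecies G) (p : ℝ × (ℝ × ℝ)) (S : ℕ)
    (f : Fin n → 𝓢(EuclideanSpace ℝ (Fin 4), ℝ)) : ℝ :=
  orbitRec M (FJ M) (contractTuple M) (germ r M n σ) hM p S f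

/-- (4a) holds identically for the junk functional. [folklore] -/
theorem expectJ_step (n : ℕ) (σ : Fin n → YMSpecies G) (p : ℝ × (ℝ × ℝ)) (S : ℕ)
    (f : Fin n → 𝓢(EuclideanSpace ℝ (Fin 4), ℝ)) :
    expectJ r M hM n σ (FJ M p) S f =
      expectJ r M hM n σ p (M * S) (fun i => blockDilate M (f i)) := by
  have hM0 : M ≠ 0 := by omega
  by_cases hS : S = 0
  · subst hS
    unfold expectJ
    rw [mul_zero, orbitRec_of_not _ _ _ hM _ 0 _ (by simp), orbitRec_of_not _ _ _ hM _ 0 _ (by simp)]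
    have h0 : ∀ (q : ℝ × (ℝ × ℝ)) (h : Fin n → 𝓢(EuclideanSpace ℝ (Fin 4), ℝ)),
        germ r M n σ q 0 h = 0 := by
      intro q h
      unfold germ
      split_ifs with hq hc
      · exact absurd hc.1 (by simp)
      · rfl
      · rfl
    rw [h0, h0]
  · unfold expectJ
    rw [orbitRec_mul _ _ _ hM p hS]
    congr 1
    funext i
    exact (blockContract_blockDilate hM0 (f i)).symm

/-- **Orbit values of the junk functional**: at depth `k` of the orbit of `(g, (1, g))`, on the
torus `S'`, it returns the genuine Wilson data on the torus `M^k S'` (when odd) at `β = 1/g²`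
with `k`-fold dilated test functions. [folklore] -/
theorem expectJ_orbit (n : ℕ) (σ : Fin n → YMSpecies G) {g : ℝ} (hg : g ∈ Set.Ioc (0 : ℝ) 1)
    (S' k : ℕ) (h : Fin n → 𝓢(EuclideanSpace ℝ (Fin 4), ℝ)) :
    expectJ r M hM n σ ((FJ M)^[k] (g, ((1 : ℝ), g))) S' h =
      if Odd (M ^ k * S') then
        wilsonCentredSchwinger r.ρ (1 / g ^ 2) ((M ^ k * S' - 1) / 2) (fun _ => 1) n σ
          (fun i => (blockDilate M)^[k] (h i))
      else 0 := by
  have hM0 : M ≠ 0 := by omega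
  induction S' using Nat.strong_induction_on generalizing k h with
  | _ S' ih =>
    by_cases hdiv : S' ≠ 0 ∧ M ∣ S'
    · obtain ⟨S'', rfl⟩ := hdiv.2
      have hS'' : S'' ≠ 0 := by rintro rfl; exact hdiv.1 (by simp)
      have hlt : S'' < M * S'' := by
        have : 1 * S'' < M * S'' := Nat.mul_lt_mul_of_pos_right (by omega) (Nat.pos_of_ne_zero hS'')
        simpa using this
      unfold expectJ
      rw [orbitRec_mul _ _ _ hM _ hS'', ← Function.iterate_succ_apply' (FJ M) k]
      have := ih S'' hlt (k + 1) (contractTuple M h)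
      unfold expectJ at this
      rw [this]
      have hpow : M ^ (k + 1) * S'' = M ^ k * (M * S'') := by ring
      have hfun : (fun i => (blockDilate M)^[k + 1] (contractTuple M h i)) =
          fun i => (blockDilate M)^[k] (h i) := by
        funext i
        rw [Function.iterate_succ_apply]
        simp [contractTuple, blockDilate_blockContract hM0]
      rw [hpow, hfun]
    · unfold expectJ
      rw [orbitRec_of_not _ _ _ hM _ _ _ hdiv]
      exact germ_orbit r M n σ hg k S' h

/-- (4b) for the junk functional: at the junk Wilson point `(g, (1, g))` on the odd torus `2L+1`
it IS Wilson's centred `n`-point function at `β = 1/g²` (every `M ≥ 2`). [folklore] -/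
theorem expectJ_wilson (n : ℕ) (σ : Fin n → YMSpecies G) {g : ℝ} (hg : g ∈ Set.Ioc (0 : ℝ) 1)
    (L : ℕ) (f : Fin n → 𝓢(EuclideanSpace ℝ (Fin 4), ℝ)) :
    expectJ r M hM n σ (g, ((1 : ℝ), g)) (2 * L + 1) f =
      wilsonCentredSchwinger r.ρ (1 / g ^ 2) L (fun _ => 1) n σ f := by
  have h := expectJ_orbit r M hM n σ hg (2 * L + 1) 0 f
  simp only [Function.iterate_zero, id_eq, pow_zero, one_mul] at h
  rw [h, if_pos ⟨L, rfl⟩]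
  congr 1
  omega

end Junk

/-! ### §A (continued)  `PreStep` = `BalabanBanachStep` minus (4c), inhabited for every `M ≥ 2` -/

/-- **`BalabanBanachStep` with the single field `continuousOn_expect` (4c) removed** — every
other field verbatim (chart, parabolic hypothesis block, basin, Wilson embedding, `betaOf`,
normalisations, realisation functional with (4a) exact covariance and (4b) Wilson
identification). -/
structure PreStep (G : Type) [Group G] [TopologicalSpace G] [IsTopologicalGroup G]
    [CompactSpace G] [MeasurableSpace G] [BorelSpace G] (r : LatticeRep G) (M : ℕ) where
  /-- (1) The chart: irrelevant gauge-invariant quasi-local action functionals on unit-lattice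
  gauge fields, vacuum energy quotiented out. -/
  E : Type
  [instNormedAddCommGroup : NormedAddCommGroup E]
  [instNormedSpace : NormedSpace ℝ E]
  [instCompleteSpace : CompleteSpace E]
  /-- (2) The coupling renormalisation `g ↦ φ g y` of one complete step. -/
  φ : ℝ → E → ℝ
  /-- The step in the irrelevant directions. -/
  Ψ : ℝ → E → E
  /-- The linearisation of `Ψ 0 ·` at the free fixed point `(0, 0)`. -/
  A : E →L[ℝ] E
  /-- Parabolic coefficient: `φ g 0 = g + b g³ + O(g⁴)`. -/
  b : ℝ
  /-- Contraction rate of the irrelevant directions. -/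
  θ : ℝ
  /-- The common constant of the remainder bounds. -/
  C : ℝ
  /-- Radius of the chart (in `g` and in `y`) on which the normal form holds. -/
  δ : ℝ
  -- the hypothesis block of `ParabolicCentreCurve`, verbatim
  b_pos : 0 < b
  θ_nonneg : 0 ≤ θ
  θ_lt_one : θ < 1
  C_pos : 0 < C
  δ_pos : 0 < δ
  norm_A_le : ‖A‖ ≤ θ
  remainder : ∀ g : ℝ, ∀ y : E, |g| ≤ δ → ‖y‖ ≤ δ →
    |φ g y - (g + b * g ^ 3)| ≤ C * (g ^ 4 + |g| ^ 3 * ‖y‖) ∧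
      ‖Ψ g y - A y‖ ≤ C * (g ^ 2 + ‖y‖ ^ 2)
  lipschitz_fibre : ∀ g : ℝ, ∀ y y' : E, |g| ≤ δ → ‖y‖ ≤ δ → ‖y'‖ ≤ δ →
    |φ g y - φ g y'| ≤ C * |g| ^ 3 * ‖y - y'‖ ∧
      ‖Ψ g y - Ψ g y' - A (y - y')‖ ≤ C * (|g| + ‖y‖ + ‖y'‖) * ‖y - y'‖
  lipschitz_base : ∀ g g' : ℝ, ∀ y : E, |g| ≤ δ → |g'| ≤ δ → ‖y‖ ≤ δ →
    |φ g y - φ g' y - (g - g') - b * (g ^ 3 - g' ^ 3)| ≤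
        C * (max |g| |g'|) ^ 2 * (max |g| |g'| + ‖y‖) * |g - g'| ∧
      ‖Ψ g y - Ψ g' y‖ ≤ C * (|g| + |g'| + ‖y‖) * |g - g'|
  /-- The one-loop coefficient of `(G, r)` (recorded, not computed). -/
  b₀ : ℝ
  /-- `b = b₀ log M`: one block step of factor `M` shifts `g⁻²` by `−2 b₀ log M + O(g²)`. -/
  b_eq : b = b₀ * Real.log M
  /-- (3) Radius of the basin (the "big ball"). -/
  R : ℝ
  δ_le_R : δ ≤ R
  /-- Uniform contraction rate of the fibre maps `Ψ g ·` on the basin. -/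
  θ' : ℝ
  θ'_nonneg : 0 ≤ θ'
  θ'_lt_one : θ' < 1
  contraction : ∀ g : ℝ, ∀ y y' : E, |g| ≤ δ → ‖y‖ ≤ R → ‖y'‖ ≤ R →
    ‖Ψ g y - Ψ g y'‖ ≤ θ' * ‖y - y'‖
  remainder_basin : ∀ g : ℝ, ∀ y : E, |g| ≤ δ → ‖y‖ ≤ R →
    |φ g y - (g + b * g ^ 3)| ≤ C * (g ^ 4 + |g| ^ 3 * ‖y‖)
  /-- The Wilson embedding: `(g, yW g)` are the coordinates of Wilson's action at bare
  coupling `g`. -/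
  yW : ℝ → E
  /-- The range `[0, g₀]` of bare couplings on which the Wilson embedding is controlled. -/
  g₀ : ℝ
  g₀_pos : 0 < g₀
  continuousOn_yW : ContinuousOn yW (Set.Icc 0 g₀)
  norm_yW_le : ∀ g ∈ Set.Icc 0 g₀, ‖yW g‖ ≤ R
  /-- The inverse bare coupling `β(g)` of the tree's `wilsonMeasure r.ρ β` as a function of the
  chart coupling `g ∈ (0, g₀]` (`β ∼ κ/g²`). -/
  betaOf : ℝ → ℝ
  strictAntiOn_betaOf : StrictAntiOn betaOf (Set.Ioc 0 g₀)
  continuousOn_betaOf : ContinuousOn betaOf (Set.Ioc 0 g₀)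
  /-- The constant of `β(g) = κ/g² + O(1)` (normalisation of the invariant form of `(G, r)`
  against the tree's Wilson weight `exp(−β ∑ₚ (N − Re tr ρ(U_p)))`; recorded, not computed). -/
  κ : ℝ
  κ_pos : 0 < κ
  /-- The `O(1)` of `β(g) = κ/g² + O(1)`. -/
  K : ℝ
  betaOf_sub_le : ∀ g ∈ Set.Ioc 0 g₀, |betaOf g - κ / g ^ 2| ≤ K
  /-- Unit-scale multiplicative normalisations of the species at bare coupling `g`. -/
  c : ℝ → YMSpecies G → ℝ
  c_curvature : ∀ g : ℝ, c g r.curvature = 1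
  /-- (4) The realisation functional: `expect p S n σ f` is the smeared, renormalised `n`-point
  function of the species string `σ` with test functions `f` in the effective unit-lattice
  theory `p = (g, y)` on the torus of `S` sites per direction. -/
  expect : ℝ × E → ℕ → (n : ℕ) → (Fin n → YMSpecies G) →
    (Fin n → 𝓢(EuclideanSpace ℝ (Fin 4), ℝ)) → ℝ
  /-- (4a) exact RG covariance: the step preserves the long-distance observables, the coarse
  torus of `S` sites being the fine torus of `M S` sites read through block dilation. -/
  expect_step : ∀ (g : ℝ) (y : E), g ∈ Set.Icc 0 δ → ‖y‖ ≤ R →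
    ∀ (S n : ℕ) (σ : Fin n → YMSpecies G) (f : Fin n → 𝓢(EuclideanSpace ℝ (Fin 4), ℝ)),
      expect (φ g y, Ψ g y) S n σ f = expect (g, y) (M * S) n σ (fun i => blockDilate M (f i))
  /-- (4b) identification with Wilson's lattice theory at the Wilson points. -/
  expect_wilson : ∀ g ∈ Set.Ioc 0 g₀,
    ∀ (L n : ℕ) (σ : Fin n → YMSpecies G) (f : Fin n → 𝓢(EuclideanSpace ℝ (Fin 4), ℝ)),
      expect (g, yW g) (2 * L + 1) n σ f = wilsonCentredSchwinger r.ρ (betaOf g) L (c g) n σ f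


section PreStepFacts

variable {G : Type} [Group G] [TopologicalSpace G] [IsTopologicalGroup G] [CompactSpace G]
  [MeasurableSpace G] [BorelSpace G] {r : LatticeRep G} {M : ℕ}

/-- `PreStep` IS the weakening: every inhabitant of the crux structure gives one. -/
def toPreStep (S : BalabanBanachStep G r M) : PreStep G r M :=
  { E := S.E, φ := S.φ, Ψ := S.Ψ, A := S.A, b := S.b, θ := S.θ, C := S.C, δ := S.δ,
    b_pos := S.b_pos, θ_nonneg := S.θ_nonneg, θ_lt_one := S.θ_lt_one, C_pos := S.C_pos,
    δ_pos := S.δ_pos, norm_A_le := S.norm_A_le, remainder := S.remainder,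
    lipschitz_fibre := S.lipschitz_fibre, lipschitz_base := S.lipschitz_base, b₀ := S.b₀,
    b_eq := S.b_eq, R := S.R, δ_le_R := S.δ_le_R, θ' := S.θ', θ'_nonneg := S.θ'_nonneg,
    θ'_lt_one := S.θ'_lt_one, contraction := S.contraction, remainder_basin := S.remainder_basin,
    yW := S.yW, g₀ := S.g₀, g₀_pos := S.g₀_pos, continuousOn_yW := S.continuousOn_yW,
    norm_yW_le := S.norm_yW_le, betaOf := S.betaOf, strictAntiOn_betaOf := S.strictAntiOn_betaOf,
    continuousOn_betaOf := S.continuousOn_betaOf, κ := S.κ, κ_pos := S.κ_pos, K := S.K,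
    betaOf_sub_le := S.betaOf_sub_le, c := S.c, c_curvature := S.c_curvature, expect := S.expect,
    expect_step := S.expect_step, expect_wilson := S.expect_wilson }

theorem norm_half_id_le : ‖(1 / 2 : ℝ) • ContinuousLinearMap.id ℝ (ℝ × ℝ)‖ ≤ 1 / 2 := by
  refine (norm_smul_le (1 / 2 : ℝ) (ContinuousLinearMap.id ℝ (ℝ × ℝ))).trans ?_
  have h : ‖ContinuousLinearMap.id ℝ (ℝ × ℝ)‖ ≤ 1 := ContinuousLinearMap.norm_id_le
  have : ‖(1 / 2 : ℝ)‖ = 1 / 2 := by norm_num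
  rw [this]
  linarith [norm_nonneg (ContinuousLinearMap.id ℝ (ℝ × ℝ))]

theorem half_id_apply (y : ℝ × ℝ) :
    ((1 / 2 : ℝ) • ContinuousLinearMap.id ℝ (ℝ × ℝ)) y = (1 / 2 : ℝ) • y := rfl

theorem strictAntiOn_one_div_sq : StrictAntiOn (fun t : ℝ => 1 / t ^ 2) (Set.Ioc 0 1) := by
  intro t ht t' ht' hlt
  simp only
  apply one_div_lt_one_div_of_lt (by have := ht.1; positivity)
  exact pow_lt_pow_left₀ hlt ht.1.le two_ne_zero

theorem continuousOn_one_div_sq : ContinuousOn (fun t : ℝ => 1 / t ^ 2) (Set.Ioc 0 1) := by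
  refine continuousOn_of_forall_continuousAt fun t ht => ?_
  have : t ^ 2 ≠ 0 := by have := ht.1; positivity
  fun_prop (disch := assumption)

variable (r M)

/-- **The no-(4c) junk inhabitant (cycle 1 §A, re-proved): for EVERY `G`, `r` and `M ≥ 2` the
structure `BalabanBanachStep G r M` minus its continuity field is inhabited** by the chart
`ℝ × ℝ`, the exactly parabolic flow `g ↦ g + (log M) g³`, the halving fibre map, the Wilson
embedding `yW g = (1, g)`, `betaOf g = 1/g²` and the F1-recursion functional `expectJ`, whose
(4a) holds identically and whose (4b) holds by decoding `(k, g)` from the fibre coordinate.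
So ALL the content of the crux sits in (4c). -/
def preStepJunk (hM : 2 ≤ M) : PreStep G r M where
  E := ℝ × ℝ
  φ g _ := φJ M g
  Ψ _ y := (1 / 2 : ℝ) • y
  A := (1 / 2 : ℝ) • ContinuousLinearMap.id ℝ (ℝ × ℝ)
  b := Real.log M
  θ := 1 / 2
  C := 1
  δ := 1
  b_pos := Real.log_pos (by exact_mod_cast hM)
  θ_nonneg := by norm_num
  θ_lt_one := by norm_num
  C_pos := one_pos
  δ_pos := one_pos
  norm_A_le := norm_half_id_le
  remainder g y _ _ := by
    constructor
    · simp only [φJ, sub_self, abs_zero]; positivity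
    · rw [half_id_apply, sub_self, norm_zero]; positivity
  lipschitz_fibre g y y' _ _ _ := by
    constructor
    · simp only [sub_self, abs_zero]; positivity
    · have : (1 / 2 : ℝ) • y - (1 / 2 : ℝ) • y' -
          ((1 / 2 : ℝ) • ContinuousLinearMap.id ℝ (ℝ × ℝ)) (y - y') = 0 := by
        rw [half_id_apply, smul_sub]
        abel
      rw [this, norm_zero]; positivity
  lipschitz_base g g' y _ _ _ := by
    constructor
    · have : φJ M g - φJ M g' - (g - g') - Real.log M * (g ^ 3 - g' ^ 3) = 0 := by
        simp only [φJ]; ring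
      rw [this, abs_zero]; positivity
    · simp only [sub_self, norm_zero]; positivity
  b₀ := 1
  b_eq := (one_mul _).symm
  R := 2
  δ_le_R := by norm_num
  θ' := 1 / 2
  θ'_nonneg := by norm_num
  θ'_lt_one := by norm_num
  contraction g y y' _ _ _ := by
    rw [← smul_sub, norm_smul]; norm_num
  remainder_basin g y _ _ := by simp only [φJ, sub_self, abs_zero]; positivity
  yW g := ((1 : ℝ), g)
  g₀ := 1
  g₀_pos := one_pos
  continuousOn_yW := by fun_prop
  norm_yW_le g hg := by
    rw [Prod.norm_def, Real.norm_eq_abs, Real.norm_eq_abs, abs_one, abs_of_nonneg hg.1]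
    exact max_le (by norm_num) (hg.2.trans (by norm_num))
  betaOf g := 1 / g ^ 2
  strictAntiOn_betaOf := strictAntiOn_one_div_sq
  continuousOn_betaOf := continuousOn_one_div_sq
  κ := 1
  κ_pos := one_pos
  K := 0
  betaOf_sub_le g _ := by simp
  c _ _ := 1
  c_curvature _ := rfl
  expect p S n σ f := expectJ r M hM n σ p S f
  expect_step g y _ _ S n σ f := expectJ_step r M hM n σ (g, y) S f
  expect_wilson g hg L n σ f := expectJ_wilson r M hM n σ hg L f

/-- **Theorem A.** `PreStep G r M` (the crux structure without (4c)) is inhabited for every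
`G`, `r`, `M ≥ 2`: the typed crux minus continuity is TRIVIALLY TRUE; any proof or disproof of
`BalabanStepParabolic` is about `continuousOn_expect` alone. [folklore] -/
theorem preStep_nonempty (hM : 2 ≤ M) : Nonempty (PreStep G r M) := ⟨preStepJunk r M hM⟩

end PreStepFacts

/-! ### §B  Even block factors: the full structure is junk-inhabited from finite-torus regularity -/

section Even

variable {G : Type} [Group G] [TopologicalSpace G] [IsTopologicalGroup G] [CompactSpace G]
  [MeasurableSpace G] [BorelSpace G] (r : LatticeRep G)

open Classical in
/-- With `cInd` the centred Wilson `n`-point function is the pure-curvature one or zero. [folklore] -/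
theorem wilsonCentredSchwinger_cInd (β : ℝ) (L n : ℕ) (σ : Fin n → YMSpecies G)
    (f : Fin n → 𝓢(EuclideanSpace ℝ (Fin 4), ℝ)) :
    wilsonCentredSchwinger r.ρ β L (cInd r) n σ f =
      if (∀ i, σ i = r.curvature) then curvCorr r β L n f else 0 := by
  by_cases h : ∀ i, σ i = r.curvature
  · rw [if_pos h]
    have hσ : σ = fun _ => r.curvature := funext h
    subst hσ
    unfold curvCorr wilsonCentredSchwinger
    simp
  · rw [if_neg h]
    obtain ⟨i, hi⟩ := not_forall.1 h
    unfold wilsonCentredSchwinger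
    have hzero : ∀ U : GaugeConfig 4 (2 * L + 1) G,
        (∏ j, smearedLatticeField (σ j).F (Literature.Probability.LatticeModels.box 4 L) 1
          (cInd r (σ j)) (wilsonTorusMean r.ρ β L (σ j).F) (f j) (torusLift (2 * L + 1) U)) = 0 :=
      fun U => Finset.prod_eq_zero (Finset.mem_univ i) (by simp [smearedLatticeField, cInd, hi])
    simp_rw [hzero, integral_zero]

/-- Regularity of the `cInd`-normalised centred functions, from `CurvatureTorusRegular`. [folklore] -/
theorem regular_cInd (hr : CurvatureTorusRegular r) (L n : ℕ) (σ : Fin n → YMSpecies G)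
    (f : Fin n → 𝓢(EuclideanSpace ℝ (Fin 4), ℝ)) :
    ContinuousOn (fun β => wilsonCentredSchwinger r.ρ β L (cInd r) n σ f) (Set.Ioi 0) ∧
      ∃ ℓ : ℝ, Tendsto (fun β => wilsonCentredSchwinger r.ρ β L (cInd r) n σ f) atTop (𝓝 ℓ) := by
  simp_rw [wilsonCentredSchwinger_cInd]
  by_cases h : ∀ i, σ i = r.curvature
  · simp_rw [if_pos h]; exact hr L n f
  · simp_rw [if_neg h]; exact ⟨continuousOn_const, 0, tendsto_const_nhds⟩

/-- `1/t² → ∞` as `t → 0⁺`. [folklore] -/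
theorem tendsto_one_div_sq_nhdsGT : Tendsto (fun t : ℝ => 1 / t ^ 2) (𝓝[>] 0) atTop := by
  have h : (fun t : ℝ => 1 / t ^ 2) = (fun x : ℝ => x ^ 2) ∘ fun t => t⁻¹ := by
    funext t; simp [inv_pow]
  rw [h]
  exact (tendsto_pow_atTop two_ne_zero).comp tendsto_inv_nhdsGT_zero

/-- **Continuous extension through `β = ∞`**: `t ↦ V(1/t²)` (`t > 0`), `ℓ` (`t ≤ 0`) is continuous
on `ℝ` when `V` is continuous on `(0, ∞)` with limit `ℓ` at `∞`. [folklore] -/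
theorem continuous_extend {V : ℝ → ℝ} {ℓ : ℝ} (hV : ContinuousOn V (Set.Ioi 0))
    (hℓ : Tendsto V atTop (𝓝 ℓ)) :
    Continuous (fun t : ℝ => if 0 < t then V (1 / t ^ 2) else ℓ) := by
  rw [continuous_iff_continuousAt]
  intro t
  rcases lt_trichotomy t 0 with ht | rfl | ht
  · have heq : (fun t : ℝ => if 0 < t then V (1 / t ^ 2) else ℓ) =ᶠ[𝓝 t] fun _ => ℓ := by
      filter_upwards [Iio_mem_nhds ht] with s hs
      rw [if_neg (not_lt.2 (le_of_lt hs))]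
    exact (continuousAt_congr heq).2 continuousAt_const
  · rw [ContinuousAt, if_neg (lt_irrefl (0 : ℝ)), ← nhdsLE_sup_nhdsGT (0 : ℝ), tendsto_sup]
    constructor
    · have heq : (fun t : ℝ => if 0 < t then V (1 / t ^ 2) else ℓ) =ᶠ[𝓝[≤] (0 : ℝ)] fun _ => ℓ := by
        filter_upwards [self_mem_nhdsWithin] with s hs
        rw [if_neg (not_lt.2 hs)]
      exact (tendsto_congr' heq).2 tendsto_const_nhds
    · have heq : (fun t : ℝ => if 0 < t then V (1 / t ^ 2) else ℓ) =ᶠ[𝓝[>] (0 : ℝ)]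
          fun t => V (1 / t ^ 2) := by
        filter_upwards [self_mem_nhdsWithin] with s hs
        rw [if_pos (show 0 < s from hs)]
      exact (tendsto_congr' heq).2 (hℓ.comp tendsto_one_div_sq_nhdsGT)
  · have heq : (fun t : ℝ => if 0 < t then V (1 / t ^ 2) else ℓ) =ᶠ[𝓝 t]
        fun t => V (1 / t ^ 2) := by
      filter_upwards [Ioi_mem_nhds ht] with s hs
      rw [if_pos (show 0 < s from hs)]
    refine (continuousAt_congr heq).2 ?_
    have h1 : ContinuousAt (fun t : ℝ => 1 / t ^ 2) t := by
      have : t ^ 2 ≠ 0 := by positivity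
      fun_prop (disch := assumption)
    have h2 : ContinuousAt V (1 / t ^ 2) := hV.continuousAt (Ioi_mem_nhds (by positivity))
    exact ContinuousAt.comp_of_eq h2 h1 rfl

variable (M : ℕ) (hM : 2 ≤ M)

/-- The even-`M` junk step on the thin chart `ℝ × ℝ` (`E = ℝ`): parabolic in `g`, halving in `y`. -/
def FE (p : ℝ × ℝ) : ℝ × ℝ := (φJ M p.1, (1 / 2 : ℝ) • p.2)

theorem continuous_FE : Continuous (FE M) := by unfold FE φJ; fun_prop

open Classical in
/-- The even-`M` germ: on odd base tori, the Wilson data at `β = 1/g²` read through the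
continuous extension; it ignores the fibre coordinate. -/
def germE (hr : CurvatureTorusRegular r) (n : ℕ) (σ : Fin n → YMSpecies G) (q : ℝ × ℝ) (S₀ : ℕ)
    (f : Fin n → 𝓢(EuclideanSpace ℝ (Fin 4), ℝ)) : ℝ :=
  if Odd S₀ then
    (if 0 < q.1 then wilsonCentredSchwinger r.ρ (1 / q.1 ^ 2) ((S₀ - 1) / 2) (cInd r) n σ f
      else Classical.choose (regular_cInd r hr ((S₀ - 1) / 2) n σ f).2)
  else 0

theorem continuous_germE (hr : CurvatureTorusRegular r) (n : ℕ) (σ : Fin n → YMSpecies G)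
    (S₀ : ℕ) (f : Fin n → 𝓢(EuclideanSpace ℝ (Fin 4), ℝ)) :
    Continuous fun q : ℝ × ℝ => germE r hr n σ q S₀ f := by
  unfold germE
  by_cases hS : Odd S₀
  · simp only [hS, ↓reduceIte]
    have h := continuous_extend (regular_cInd r hr ((S₀ - 1) / 2) n σ f).1
      (Classical.choose_spec (regular_cInd r hr ((S₀ - 1) / 2) n σ f).2)
    exact h.comp continuous_fst
  · simp only [hS, ↓reduceIte]
    exact continuous_const

theorem norm_half_id_le' : ‖(1 / 2 : ℝ) • ContinuousLinearMap.id ℝ ℝ‖ ≤ 1 / 2 := by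
  refine (norm_smul_le (1 / 2 : ℝ) (ContinuousLinearMap.id ℝ ℝ)).trans ?_
  have h : ‖ContinuousLinearMap.id ℝ ℝ‖ ≤ 1 := ContinuousLinearMap.norm_id_le
  have : ‖(1 / 2 : ℝ)‖ = 1 / 2 := by norm_num
  rw [this]
  linarith [norm_nonneg (ContinuousLinearMap.id ℝ ℝ)]

theorem half_id_apply' (y : ℝ) : ((1 / 2 : ℝ) • ContinuousLinearMap.id ℝ ℝ) y = (1 / 2 : ℝ) • y := rfl

include hM

/-- The even-`M` junk realisation functional. -/
def expectE (hr : CurvatureTorusRegular r) (n : ℕ) (σ : Fin n → YMSpecies G) (p : ℝ × ℝ)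
    (S : ℕ) (f : Fin n → 𝓢(EuclideanSpace ℝ (Fin 4), ℝ)) : ℝ :=
  orbitRec M (FE M) (contractTuple M) (germE r hr n σ) hM p S f

theorem expectE_step (hr : CurvatureTorusRegular r) (n : ℕ) (σ : Fin n → YMSpecies G)
    (p : ℝ × ℝ) (S : ℕ) (f : Fin n → 𝓢(EuclideanSpace ℝ (Fin 4), ℝ)) :
    expectE r M hM hr n σ (FE M p) S f =
      expectE r M hM hr n σ p (M * S) (fun i => blockDilate M (f i)) := by
  have hM0 : M ≠ 0 := by omega
  by_cases hS : S = 0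
  · subst hS
    unfold expectE
    rw [mul_zero, orbitRec_of_not _ _ _ hM _ 0 _ (by simp), orbitRec_of_not _ _ _ hM _ 0 _ (by simp)]
    simp [germE]
  · unfold expectE
    rw [orbitRec_mul _ _ _ hM p hS]
    congr 1
    funext i
    exact (blockContract_blockDilate hM0 (f i)).symm

theorem expectE_wilson (hMe : Even M) (hr : CurvatureTorusRegular r) (n : ℕ)
    (σ : Fin n → YMSpecies G) {g : ℝ} (hg : 0 < g) (y : ℝ) (L : ℕ)
    (f : Fin n → 𝓢(EuclideanSpace ℝ (Fin 4), ℝ)) :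
    expectE r M hM hr n σ (g, y) (2 * L + 1) f =
      wilsonCentredSchwinger r.ρ (1 / g ^ 2) L (cInd r) n σ f := by
  unfold expectE
  have hnd : ¬ (2 * L + 1 ≠ 0 ∧ M ∣ 2 * L + 1) := by
    rintro ⟨-, hd⟩
    have : Even (2 * L + 1) := (even_iff_two_dvd.2 ((even_iff_two_dvd.1 hMe).trans hd))
    exact Nat.not_even_iff_odd.2 ⟨L, rfl⟩ this
  rw [orbitRec_of_not _ _ _ hM _ _ _ hnd]
  unfold germE
  rw [if_pos ⟨L, rfl⟩, if_pos hg]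
  congr 1
  omega

theorem continuous_expectE (hr : CurvatureTorusRegular r) (n : ℕ) (σ : Fin n → YMSpecies G)
    (S : ℕ) (f : Fin n → 𝓢(EuclideanSpace ℝ (Fin 4), ℝ)) :
    Continuous fun p : ℝ × ℝ => expectE r M hM hr n σ p S f := by
  unfold expectE
  induction S using Nat.strong_induction_on generalizing f with
  | _ S ih =>
    by_cases h : S ≠ 0 ∧ M ∣ S
    · obtain ⟨S', rfl⟩ := h.2
      have hS' : S' ≠ 0 := by rintro rfl; exact h.1 (by simp)
      have hlt : S' < M * S' := by
        have : 1 * S' < M * S' := Nat.mul_lt_mul_of_pos_right (by omega) (Nat.pos_of_ne_zero hS')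
        simpa using this
      simp_rw [orbitRec_mul _ _ _ hM _ hS']
      exact (ih S' hlt (contractTuple M f)).comp (continuous_FE M)
    · simp_rw [orbitRec_of_not _ _ _ hM _ S _ h]
      exact continuous_germE r hr n σ S f

/-- **The even-`M` junk inhabitant of the FULL structure** (cycle 1 §B/§E, re-proved modulo
`CurvatureTorusRegular`): thin chart `E = ℝ`, `g ↦ g + (log M) g³`, `y ↦ y/2`, `yW ≡ 1`,
`betaOf = 1/g²`, `c = cInd`, functional `expectE`. For even `M` the only pinned points are the
Wilson arc itself (`M ∤ 2L+1`), so (4c) reduces to finite-torus regularity: NO renormalisation-group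
content. -/
def evenStep (hMe : Even M) (hr : CurvatureTorusRegular r) : BalabanBanachStep G r M where
  E := ℝ
  φ g _ := φJ M g
  Ψ _ y := (1 / 2 : ℝ) • y
  A := (1 / 2 : ℝ) • ContinuousLinearMap.id ℝ ℝ
  b := Real.log M
  θ := 1 / 2
  C := 1
  δ := 1
  b_pos := Real.log_pos (by exact_mod_cast hM)
  θ_nonneg := by norm_num
  θ_lt_one := by norm_num
  C_pos := one_pos
  δ_pos := one_pos
  norm_A_le := norm_half_id_le'
  remainder g y _ _ := by
    constructor
    · simp only [φJ, sub_self, abs_zero]; positivity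
    · rw [half_id_apply', sub_self, norm_zero]; positivity
  lipschitz_fibre g y y' _ _ _ := by
    constructor
    · simp only [sub_self, abs_zero]; positivity
    · have : (1 / 2 : ℝ) • y - (1 / 2 : ℝ) • y' -
          ((1 / 2 : ℝ) • ContinuousLinearMap.id ℝ ℝ) (y - y') = 0 := by
        rw [half_id_apply', smul_sub]
        abel
      rw [this, norm_zero]; positivity
  lipschitz_base g g' y _ _ _ := by
    constructor
    · have : φJ M g - φJ M g' - (g - g') - Real.log M * (g ^ 3 - g' ^ 3) = 0 := by
        simp only [φJ]; ring
      rw [this, abs_zero]; positivity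
    · simp only [sub_self, norm_zero]; positivity
  b₀ := 1
  b_eq := (one_mul _).symm
  R := 1
  δ_le_R := le_rfl
  θ' := 1 / 2
  θ'_nonneg := by norm_num
  θ'_lt_one := by norm_num
  contraction g y y' _ _ _ := by
    rw [← smul_sub, norm_smul]; norm_num
  remainder_basin g y _ _ := by simp only [φJ, sub_self, abs_zero]; positivity
  yW _ := 1
  g₀ := 1
  g₀_pos := one_pos
  continuousOn_yW := continuousOn_const
  norm_yW_le _ _ := by simp
  betaOf g := 1 / g ^ 2
  strictAntiOn_betaOf := strictAntiOn_one_div_sq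
  continuousOn_betaOf := continuousOn_one_div_sq
  κ := 1
  κ_pos := one_pos
  K := 0
  betaOf_sub_le g _ := by simp
  c _ := cInd r
  c_curvature _ := cInd_curvature r
  expect p S n σ f := expectE r M hM hr n σ p S f
  expect_step g y _ _ S n σ f := expectE_step r M hM hr n σ (g, y) S f
  expect_wilson g hg L n σ f := expectE_wilson r M hM hMe hr n σ hg.1 1 L f
  continuousOn_expect S n σ f _ := (continuous_expectE r M hM hr n σ S f).continuousOn

/-- **Theorem B (even `M` is dead weight).** For every `G`, `r` with finite-torus regularity and
every EVEN `M ≥ 2`, `BalabanBanachStep G r M` is inhabited with zero RG content. [folklore] -/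
theorem nonempty_of_even (hMe : Even M) (hr : CurvatureTorusRegular r) :
    Nonempty (BalabanBanachStep G r M) := ⟨evenStep r M hM hMe hr⟩

end Even

/-! ### §B'  The crux is equivalent to its restriction to odd block factors -/

/-- The crux restricted to ODD block factors (where (4a)+(4b) transport genuine Wilson data). -/
def BalabanStepParabolicOdd : Prop :=
  ∀ (G : Type) [Group G] [TopologicalSpace G] [IsTopologicalGroup G] [CompactSpace G],
    IsCompactSimpleLieGroup G → letI : MeasurableSpace G := borel G; haveI : BorelSpace G := ⟨rfl⟩;
    ∀ (r : LatticeRep G), ∃ M₀ : ℕ, ∀ M : ℕ, M₀ ≤ M → Odd M → Nonempty (BalabanBanachStep G r M)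

/-- **`BalabanStepParabolic ↔ BalabanStepParabolicOdd`**, given finite-torus regularity for all
`(G, r)` (cycle 1 `balabanStepParabolic_iff_odd`; unconditional there via §E). The even half of
"`∀ M ≥ M₀`" carries no content. PLANNER: restate with `Odd M →`, or let (4b) pin ALL tori. [folklore] -/
theorem balabanStepParabolic_iff_odd
    (hreg : ∀ (G : Type) [Group G] [TopologicalSpace G] [IsTopologicalGroup G] [CompactSpace G]
      [MeasurableSpace G] [BorelSpace G] (r : LatticeRep G), CurvatureTorusRegular r) :
    Summit.QuantumFields.YangMills.Theses.ParabolicTrajectory.BalabanStepParabolic ↔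
      BalabanStepParabolicOdd := by
  constructor
  · intro h G _ _ _ _ hG r
    obtain ⟨M₀, hM₀⟩ := h G hG r
    exact ⟨M₀, fun M hM _ => hM₀ M hM⟩
  · intro h G _ _ _ _ hG r
    letI : MeasurableSpace G := borel G
    haveI : BorelSpace G := ⟨rfl⟩
    obtain ⟨M₀, hM₀⟩ := h G hG r
    refine ⟨max M₀ 2, fun M hM => ?_⟩
    have h2 : 2 ≤ M := (le_max_right _ _).trans hM
    rcases Nat.even_or_odd M with he | ho
    · exact nonempty_of_even r M h2 he (hreg G r)
    · exact hM₀ M ((le_max_left _ _).trans hM) ho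


/-! ### §B''  Unconditional corollaries (with §E) -/

/-- **Even `M` is dead weight, unconditionally**: for every compact group `G` with a lattice
representation `r` and every EVEN `M ≥ 2`, `BalabanBanachStep G r M` is inhabited with zero
renormalisation-group content (cycle 1 `balabanStepParabolic_even`, re-proved). [folklore] -/
theorem balabanStepParabolic_even {G : Type} [Group G] [TopologicalSpace G] [IsTopologicalGroup G]
    [CompactSpace G] [MeasurableSpace G] [BorelSpace G] (r : LatticeRep G) (M : ℕ) (hM : 2 ≤ M)
    (hMe : Even M) : Nonempty (BalabanBanachStep G r M) :=
  nonempty_of_even r M hM hMe (curvatureTorusRegular_holds r)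

/-- **`BalabanStepParabolic ↔ BalabanStepParabolicOdd`, unconditionally** (cycle 1
`balabanStepParabolic_iff_odd`, re-proved): the even half of "`∀ M ≥ M₀`" carries no content.
PLANNER: restate the crux with `Odd M →` or let (4b) pin all tori. [folklore] -/
theorem balabanStepParabolic_iff_odd' :
    Summit.QuantumFields.YangMills.Theses.ParabolicTrajectory.BalabanStepParabolic ↔
      BalabanStepParabolicOdd :=
  balabanStepParabolic_iff_odd fun _ _ _ _ _ _ _ r => curvatureTorusRegular_holds r


/-! ### §H  Load-bearing analysis: `IsCompactSimpleLieGroup` guards content, not truth -/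

section TrivialGroup

variable {G : Type} [Group G] [TopologicalSpace G] [IsTopologicalGroup G] [CompactSpace G]
  [MeasurableSpace G] [BorelSpace G] [Subsingleton G] (r : LatticeRep G)

/-- For a trivial (one-element) gauge group every centred smeared field vanishes identically:
all configurations coincide, so every observable equals its own torus mean. [folklore] -/
theorem smeared_centred_eq_zero_of_subsingleton (β : ℝ) (L : ℕ) (O : YMSpecies G) (c : ℝ)
    (f : 𝓢(EuclideanSpace ℝ (Fin 4), ℝ)) (U : GaugeConfig 4 (2 * L + 1) G) :
    smearedLatticeField O.F (Literature.Probability.LatticeModels.box 4 L) 1 c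
      (wilsonTorusMean r.ρ β L O.F) f (torusLift (2 * L + 1) U) = 0 := by
  haveI := isProbabilityMeasure_wilsonMeasure (d := 4) (L := 2 * L + 1) r.ρ r.continuous β
  have hconst : ∀ V W : LGConfig 4 G, O.F V = O.F W := fun V W => congrArg O.F (Subsingleton.elim V W)
  have hmean : wilsonTorusMean r.ρ β L O.F = O.F (torusLift (2 * L + 1) U) := by
    unfold wilsonTorusMean
    rw [show (fun V : GaugeConfig 4 (2 * L + 1) G => O.F (torusLift (2 * L + 1) V)) =
        fun _ => O.F (torusLift (2 * L + 1) U) from funext fun V => hconst _ _]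
    rw [integral_const, probReal_univ, one_smul]
  unfold smearedLatticeField
  refine mul_eq_zero_of_right _ (Finset.sum_eq_zero fun x _ => ?_)
  rw [hmean, hconst (configShift (-x) (torusLift (2 * L + 1) U)) (torusLift (2 * L + 1) U), sub_self,
    mul_zero]

/-- For a trivial gauge group the centred Wilson `n`-point functions are `1` (`n = 0`) or `0`. [folklore] -/
theorem wilsonCentredSchwinger_of_subsingleton (β : ℝ) (L n : ℕ) (c : YMSpecies G → ℝ)
    (σ : Fin n → YMSpecies G) (f : Fin n → 𝓢(EuclideanSpace ℝ (Fin 4), ℝ)) :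
    wilsonCentredSchwinger r.ρ β L c n σ f = if n = 0 then 1 else 0 := by
  haveI := isProbabilityMeasure_wilsonMeasure (d := 4) (L := 2 * L + 1) r.ρ r.continuous β
  by_cases hn : n = 0
  · subst hn
    rw [if_pos rfl, wilsonCentredSchwinger_zero]
    exact probReal_univ
  · rw [if_neg hn]
    obtain ⟨k, rfl⟩ := Nat.exists_eq_succ_of_ne_zero hn
    unfold wilsonCentredSchwinger
    have hzero : ∀ U : GaugeConfig 4 (2 * L + 1) G,
        (∏ i : Fin (k + 1), smearedLatticeField (σ i).F (Literature.Probability.LatticeModels.box 4 L) 1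
          (c (σ i)) (wilsonTorusMean r.ρ β L (σ i).F) (f i) (torusLift (2 * L + 1) U)) = 0 :=
      fun U => Finset.prod_eq_zero (Finset.mem_univ (0 : Fin (k + 1)))
        (smeared_centred_eq_zero_of_subsingleton r β L (σ 0) _ (f 0) U)
    simp_rw [hzero, integral_zero]

variable (M : ℕ) (hM : 2 ≤ M)

include hM in
/-- **The trivial-group inhabitant of the FULL structure, every `M ≥ 2`** (odd included): thin
chart, junk parabolic flow, and the CONSTANT realisation functional `1`/`0` — which IS the genuine
Wilson data when the gauge group has one element. -/
def trivialGroupStep : BalabanBanachStep G r M where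
  E := ℝ
  φ g _ := φJ M g
  Ψ _ y := (1 / 2 : ℝ) • y
  A := (1 / 2 : ℝ) • ContinuousLinearMap.id ℝ ℝ
  b := Real.log M
  θ := 1 / 2
  C := 1
  δ := 1
  b_pos := Real.log_pos (by exact_mod_cast hM)
  θ_nonneg := by norm_num
  θ_lt_one := by norm_num
  C_pos := one_pos
  δ_pos := one_pos
  norm_A_le := norm_half_id_le'
  remainder g y _ _ := by
    constructor
    · simp only [φJ, sub_self, abs_zero]; positivity
    · rw [half_id_apply', sub_self, norm_zero]; positivity
  lipschitz_fibre g y y' _ _ _ := by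
    constructor
    · simp only [sub_self, abs_zero]; positivity
    · have : (1 / 2 : ℝ) • y - (1 / 2 : ℝ) • y' -
          ((1 / 2 : ℝ) • ContinuousLinearMap.id ℝ ℝ) (y - y') = 0 := by
        rw [half_id_apply', smul_sub]
        abel
      rw [this, norm_zero]; positivity
  lipschitz_base g g' y _ _ _ := by
    constructor
    · have : φJ M g - φJ M g' - (g - g') - Real.log M * (g ^ 3 - g' ^ 3) = 0 := by
        simp only [φJ]; ring
      rw [this, abs_zero]; positivity
    · simp only [sub_self, norm_zero]; positivity
  b₀ := 1
  b_eq := (one_mul _).symm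
  R := 1
  δ_le_R := le_rfl
  θ' := 1 / 2
  θ'_nonneg := by norm_num
  θ'_lt_one := by norm_num
  contraction g y y' _ _ _ := by
    rw [← smul_sub, norm_smul]; norm_num
  remainder_basin g y _ _ := by simp only [φJ, sub_self, abs_zero]; positivity
  yW _ := 1
  g₀ := 1
  g₀_pos := one_pos
  continuousOn_yW := continuousOn_const
  norm_yW_le _ _ := by simp
  betaOf g := 1 / g ^ 2
  strictAntiOn_betaOf := strictAntiOn_one_div_sq
  continuousOn_betaOf := continuousOn_one_div_sq
  κ := 1
  κ_pos := one_pos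
  K := 0
  betaOf_sub_le g _ := by simp
  c _ _ := 1
  c_curvature _ := rfl
  expect _ _ n _ _ := if n = 0 then 1 else 0
  expect_step _ _ _ _ _ _ _ _ := rfl
  expect_wilson g _ L n σ f := (wilsonCentredSchwinger_of_subsingleton r _ L n _ σ f).symm
  continuousOn_expect _ _ _ _ _ := continuousOn_const

include hM in
/-- **`IsCompactSimpleLieGroup` is load-bearing for CONTENT, not for truth.** Dropping it from the
crux does not make the statement false — at the trivial gauge group (`Subsingleton G`, admitted by
`LatticeRep` with the one-dimensional trivial representation but excluded by
`IsCompactSimpleLieGroup`, which demands a non-commuting pair) the FULL structure is inhabited for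
EVERY `M ≥ 2`, odd `M` included, by constants. So no `_false_without_` theorem exists for this
hypothesis; its role is to exclude junk gauge groups, exactly as the route intends. [folklore] -/
theorem nonempty_of_subsingleton : Nonempty (BalabanBanachStep G r M) := ⟨trivialGroupStep r M hM⟩

end TrivialGroup

/-- The trivial group carries a lattice representation (`N = 1`, `ρ ≡ 1`). -/
def unitLatticeRep : LatticeRep PUnit.{1} where
  N := 1
  ρ := 1
  continuous := continuous_const
  injective := fun _ _ _ => Subsingleton.elim _ _
  mem_unitary := fun _ => by simp [MonoidHom.one_apply]

/-- **The crux WITHOUT `IsCompactSimpleLieGroup` holds at the trivial group** (witnessing that the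
hypothesis is not load-bearing for truth): every block factor `M ≥ 2`. [folklore] -/
theorem balabanStep_punit (M : ℕ) (hM : 2 ≤ M) :
    letI : MeasurableSpace PUnit.{1} := borel PUnit
    haveI : BorelSpace PUnit.{1} := ⟨rfl⟩
    ∀ r : LatticeRep PUnit.{1}, Nonempty (BalabanBanachStep PUnit r M) := by
  intro r
  exact @nonempty_of_subsingleton PUnit _ _ _ _ (borel PUnit) (@BorelSpace.mk PUnit _ (borel PUnit) rfl)
    _ r M hM

/-! ### §G  The PICKED line's object `RegulatorChart G r M` has the crux's dead weight (cycle 3)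

Even `M`: junk-inhabited — proved by the LEAD (`nonempty_regulatorChart_of_even`,
`regulatorChartExists_iff_odd` in `Theorems/ParabolicTrajectoryBalabanStepParabolicRegulatorChartEven.lean`;
found independently in this seat's `RegChart.lean`, dropped as duplicate).  Below: the trivial-group junk,
i.e. `IsCompactSimpleLieGroup` guards content, not truth, for the line's stub exactly as for the crux (§H). -/

section RegulatorChartJunk

variable (M : ℕ)

/-- The junk cubic `t ↦ t + (log M) t³` has derivative `1 + 3 (log M) t²`. [folklore] -/
theorem hasDerivAt_φJ (t : ℝ) : HasDerivAt (φJ M) (1 + 3 * Real.log M * t ^ 2) t := by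
  have h : HasDerivAt (fun s : ℝ => s + Real.log M * s ^ 3) (1 + Real.log M * (3 * t ^ 2)) t := by
    have h1 : HasDerivAt (fun s : ℝ => s ^ 3) (3 * t ^ 2) t := by
      simpa using hasDerivAt_pow 3 t
    exact (hasDerivAt_id t).add (h1.const_mul (Real.log M))
  have hf : (fun s : ℝ => s + Real.log M * s ^ 3) = φJ M := by funext s; rfl
  rw [hf] at h
  convert h using 1
  ring

/-- **The thin SMOOTH junk chart** (`E = ℝ`, `φ g y = g + (log M) g³`, `Ψ g y = y/2`): an EXACT smooth
half-chart normal form, `C = 0`, `b = 1 · log M`, `δ = R = 1`, `θ' = 1/2` (the lead's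
`smoothHalfChart_thin`, re-proved here to keep this file independent of line files). [folklore] -/
theorem smoothHalfChart_thin' :
    SmoothHalfChart ℝ (fun g _ => φJ M g) (fun _ y => (1 / 2 : ℝ) • y)
      ((1 / 2 : ℝ) • ContinuousLinearMap.id ℝ ℝ) (fun g _ => 1 + 3 * Real.log M * g ^ 2)
      (fun _ _ => 0) (fun _ _ => 0) (fun _ _ => (1 / 2 : ℝ) • ContinuousLinearMap.id ℝ ℝ)
      (1 * Real.log M) 0 1 1 (1 / 2) where
  δ_pos := one_pos
  δ_le_R := le_rfl
  C_nonneg := le_rfl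
  θ'_nonneg := by norm_num
  φ_zero y _ := by simp [φJ]
  Ψ_zero_zero := by simp
  hasDeriv_φ g _ y _ := (hasDerivAt_φJ M g).hasDerivWithinAt
  hasFDeriv_φ g _ y _ := by
    simpa using (hasFDerivWithinAt_const (φJ M g) y (Metric.closedBall (0 : ℝ) 1))
  hasDeriv_Ψ g _ y _ := by
    simpa using (hasDerivWithinAt_const g (Set.Icc (0 : ℝ) 1) ((1 / 2 : ℝ) • y))
  hasFDeriv_Ψ g _ y _ :=
    (((1 / 2 : ℝ) • ContinuousLinearMap.id ℝ ℝ).hasFDerivAt).hasFDerivWithinAt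
  φg_bound g _ y _ := by simp
  φy_bound g _ y _ := by simp
  Ψg_bound g _ y _ := by simp
  Ψy_sub_A g _ y _ := by simp
  Ψy_bound g _ y _ := norm_half_id_le'

variable {G : Type} [Group G] [TopologicalSpace G] [IsTopologicalGroup G] [CompactSpace G]
  [MeasurableSpace G] [BorelSpace G] [Subsingleton G] (r : LatticeRep G) (hM : 2 ≤ M)

include hM in
/-- **Trivial gauge group: the line's object is inhabited for EVERY `M ≥ 2`** (odd included) by the
thin smooth chart and the CONSTANT chart functions `1`/`0` — which ARE the genuine centred Wilson data of
a one-element gauge group (`wilsonCentredSchwinger_of_subsingleton`, §H). -/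
def regulatorChartTrivialGroup : RegulatorChart G r M where
  two_le_M := hM
  E := ℝ
  φ g _ := φJ M g
  Ψ _ y := (1 / 2 : ℝ) • y
  A := (1 / 2 : ℝ) • ContinuousLinearMap.id ℝ ℝ
  φg g _ := 1 + 3 * Real.log M * g ^ 2
  φy _ _ := 0
  Ψg _ _ := 0
  Ψy _ _ := (1 / 2 : ℝ) • ContinuousLinearMap.id ℝ ℝ
  b₀ := 1
  θ := 1 / 2
  C := 0
  δ := 1
  R := 1
  θ' := 1 / 2
  b₀_pos := one_pos
  θ_nonneg := by norm_num
  θ_lt_one := by norm_num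
  norm_A_le := norm_half_id_le'
  θ'_lt_one := by norm_num
  smooth := smoothHalfChart_thin' M
  yW _ := 1
  g₀ := 1
  betaOf g := 1 / g ^ 2
  κ := 1
  K := 0
  corr _ _ n _ := if n = 0 then 1 else 0
  realisation :=
    { g₀_pos := one_pos
      g₀_le_δ := le_rfl
      continuousOn_yW := continuousOn_const
      norm_yW_le := fun _ _ => by simp
      strictAntiOn_betaOf := strictAntiOn_one_div_sq
      continuousOn_betaOf := continuousOn_one_div_sq
      κ_pos := one_pos
      betaOf_sub_le := fun g _ => by simp
      corr_step := fun _ _ _ _ _ _ _ _ _ => rfl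
      corr_wilson := fun g _ L n f => (wilsonCentredSchwinger_of_subsingleton r _ L n _ _ f).symm
      corr_continuousOn := fun _ _ _ _ => continuousOn_const }

include hM in
/-- **The line's stub WITHOUT `IsCompactSimpleLieGroup` holds at any one-element gauge group**, every
`M ≥ 2`: the hypothesis guards content, not truth, for `RegulatorChart` as for `BalabanBanachStep`. [folklore] -/
theorem regulatorChart_nonempty_of_subsingleton : Nonempty (RegulatorChart G r M) :=
  ⟨regulatorChartTrivialGroup M r hM⟩

end RegulatorChartJunk

/-- **The line's stub at the trivial group `PUnit`** (not vacuous: `unitLatticeRep`). [folklore] -/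
theorem regulatorChart_punit (M : ℕ) (hM : 2 ≤ M) :
    letI : MeasurableSpace PUnit.{1} := borel PUnit
    haveI : BorelSpace PUnit.{1} := ⟨rfl⟩
    ∀ r : LatticeRep PUnit.{1}, Nonempty (RegulatorChart PUnit r M) := by
  intro r
  exact @regulatorChart_nonempty_of_subsingleton M PUnit _ _ _ _ (borel PUnit)
    (@BorelSpace.mk PUnit _ (borel PUnit) rfl) _ r hM

/-! ### §V  Fibre slaving and the FORCED SCALING LIMIT (cycle 3; landed as `Negative/FibreSlaving`,
`Negative/ForcedScalingLimit` — restated here for the index, proofs by the landed theorems)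

WHY THE CRUX RESISTS, AS A THEOREM.  For ANY inhabitant `S` of `BalabanBanachStep G r M` (any Banach space
`E`), deep Wilson-orbit points are parametrised by their coupling coordinate: the fibre difference of two
deep orbit points is `≤ λ |Δ coupling| + ϑ^{depth} · 2δ`.  So every deep sequence whose arrival couplings
converge is Cauchy in `ℝ × E`, converges in the chart, and by (4c) the genuine dilated Wilson data along it
converge; the limit depends on the arrival coupling only.  The inhabitant cannot "spread out" the orbit
closure by enlarging `E`: `contraction` + `lipschitz_base` + `lipschitz_fibre` forbid it.  Deep couplings
increase strictly, so every small level is reached (`Negative.exists_reaching_sequence`), and the forced limits are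
continuous in the running coupling (`Negative.forced_scaling_limit_continuous`, not restated). -/

section ForcedScalingLimit

variable {G : Type} [Group G] [TopologicalSpace G] [IsTopologicalGroup G] [CompactSpace G]
  [MeasurableSpace G] [BorelSpace G] {r : LatticeRep G} {M : ℕ} (S : BalabanBanachStep G r M)

/-- **Slaving dichotomy** (restated; `Negative.slaving_dichotomy`): along two orbit segments with couplings
in `[0, τ]` and fibres in the `δ`-ball, EITHER `‖Δy_m‖ ≤ λ|Δg_m|` OR `‖Δy_m‖ ≤ ϑ^m ‖Δy_0‖`
(`λ = 2C(2τ+δ)/(1−θ')`, `ϑ = (1+θ')/2`; smallness `Cτ²(τ+δ) + Cτ³λ ≤ (1−θ')/2`). [folklore] -/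
theorem slaving_dichotomy' {τ : ℝ} (hτ : τ ≤ S.δ)
    (hsmall : S.C * τ ^ 2 * (τ + S.δ) + S.C * τ ^ 3 * (2 * S.C * (2 * τ + S.δ) / (1 - S.θ')) ≤
      (1 - S.θ') / 2)
    (p q : ℝ × S.E) (m : ℕ)
    (hp : ∀ i < m, (S.F^[i] p).1 ∈ Set.Icc 0 τ ∧ ‖(S.F^[i] p).2‖ ≤ S.δ)
    (hq : ∀ i < m, (S.F^[i] q).1 ∈ Set.Icc 0 τ ∧ ‖(S.F^[i] q).2‖ ≤ S.δ) :
    ‖(S.F^[m] p).2 - (S.F^[m] q).2‖ ≤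
        (2 * S.C * (2 * τ + S.δ) / (1 - S.θ')) * |(S.F^[m] p).1 - (S.F^[m] q).1| ∨
      ‖(S.F^[m] p).2 - (S.F^[m] q).2‖ ≤ ((1 + S.θ') / 2) ^ m * ‖p.2 - q.2‖ :=
  Summit.QuantumFields.YangMills.Theorems.BalabanStepParabolic.Negative.slaving_dichotomy S hτ hsmall p q m
    hp hq

/-- **Deep orbit points are Cauchy when their couplings are** (restated;
`Negative.deep_orbit_cauchySeq`), WHATEVER the Banach space `E`. [folklore] -/
theorem deep_orbit_cauchySeq' {τ₀ : ℝ} (hτs : τ₀ ≤ (min S.δ (min (Real.sqrt (1 / (2 * (S.b + S.C * (S.δ + S.R))))) (Real.sqrt ((1 - S.θ') * S.R / S.C))))) (hτg₀ : τ₀ ≤ S.g₀)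
    (hτδ2 : S.C * τ₀ ^ 2 / (1 - S.θ') ≤ S.δ / 2)
    (hsmall : S.C * τ₀ ^ 2 * (τ₀ + S.δ) + S.C * τ₀ ^ 3 * (2 * S.C * (2 * τ₀ + S.δ) / (1 - S.θ')) ≤
      (1 - S.θ') / 2)
    {i₀ : ℕ} (hi₀ : S.θ' ^ i₀ * S.R ≤ S.δ / 2)
    (g : ℕ → ℝ) (k : ℕ → ℕ) (hg : ∀ j, 0 < g j ∧ g j ≤ τ₀)
    (hk : ∀ j, 2 * (S.b + S.C * (S.δ + S.R)) * (k j) ≤ 1 / (g j) ^ 2 - 1 / τ₀ ^ 2) (hkinf : Tendsto k atTop atTop)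
    (hc : CauchySeq fun j => (S.F^[k j] (g j, S.yW (g j))).1) :
    CauchySeq fun j => S.F^[k j] (g j, S.yW (g j)) :=
  Summit.QuantumFields.YangMills.Theorems.BalabanStepParabolic.Negative.deep_orbit_cauchySeq S hτs hτg₀ hτδ2
    hsmall hi₀ g k hg hk hkinf hc

/-- **FORCED SCALING LIMIT** (restated; `Negative.forced_scaling_limit`).  For every inhabitant `S` and odd
`M` there are `g⋆ ∈ (0, min δ g₀]` and a graph `Q : ℝ → [0,δ] × B̄_R` such that admissible deep sequences of
Wilson orbit points with convergent arrival couplings EXIST and, along EVERY such sequence (`0 < g_j ≤ g⋆`,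
depths `k_j → ∞` in the window `2c₁k_j ≤ 1/g_j² − 1/g⋆²`, arrival couplings `→ t`), the orbit points
converge to `Q t` and the GENUINE centred Wilson `n`-point functions at `β_j = betaOf g_j → ∞`, on the tori
`M^{k_j}(2L+1) → ∞`, with `k_j`-fold dilated test functions, CONVERGE to `expect (Q t) (2L+1) n σ f`.
Field (4c) of the crux IS this continuum/thermodynamic-limit statement, for every inhabitant. [folklore] -/
theorem forced_scaling_limit' (hM : Odd M) :
    ∃ gstar : ℝ, 0 < gstar ∧ gstar ≤ S.g₀ ∧ gstar ≤ S.δ ∧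
    (∃ (g : ℕ → ℝ) (k : ℕ → ℕ) (t : ℝ), (∀ j, 0 < g j ∧ g j ≤ gstar) ∧
      (∀ j, 2 * (S.b + S.C * (S.δ + S.R)) * (k j) ≤ 1 / (g j) ^ 2 - 1 / gstar ^ 2) ∧
      Tendsto k atTop atTop ∧ Tendsto (fun j => (S.F^[k j] (g j, S.yW (g j))).1) atTop (𝓝 t)) ∧
    ∃ Q : ℝ → ℝ × S.E, (∀ t, Q t ∈ Set.Icc 0 S.δ ×ˢ Metric.closedBall (0 : S.E) S.R) ∧
    ∀ (g : ℕ → ℝ) (k : ℕ → ℕ) (t : ℝ),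
      (∀ j, 0 < g j ∧ g j ≤ gstar) →
      (∀ j, 2 * (S.b + S.C * (S.δ + S.R)) * (k j) ≤ 1 / (g j) ^ 2 - 1 / gstar ^ 2) →
      Tendsto k atTop atTop →
      Tendsto (fun j => (S.F^[k j] (g j, S.yW (g j))).1) atTop (𝓝 t) →
      Tendsto (fun j => S.F^[k j] (g j, S.yW (g j))) atTop (𝓝 (Q t)) ∧
      ∀ (L n : ℕ) (σ : Fin n → YMSpecies G) (f : Fin n → 𝓢(EuclideanSpace ℝ (Fin 4), ℝ)),
        IsOffDiagonal (SchwartzMap.tensorFin n fun i => ofRealTest (f i)) →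
        Tendsto (fun j => wilsonCentredSchwinger r.ρ (S.betaOf (g j))
            ((M ^ (k j) * (2 * L + 1) - 1) / 2) (S.c (g j)) n σ
            (fun i => (blockDilate M)^[k j] (f i))) atTop
          (𝓝 (S.expect (Q t) (2 * L + 1) n σ f)) :=
  Summit.QuantumFields.YangMills.Theorems.BalabanStepParabolic.Negative.forced_scaling_limit S hM

/-- **FORCED SCALING LIMIT, intrinsic form** (restated; `Negative.forced_scaling_limit_of_region`): for EVERY
cap `τ₀ ≤ τmax`, along EVERY sequence of Wilson orbit points whose orbits stay in `[0,τ₀] × B̄_R` up to depth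
`k_j → ∞` (no a-priori window) with arrival couplings `→ t`, the points converge to `Q t` and the genuine
dilated Wilson data converge to `expect (Q t) (2L+1) n σ f`; such sequences exist. [folklore] -/
theorem forced_scaling_limit_of_region' (hM : Odd M) :
    ∃ τmax : ℝ, 0 < τmax ∧ τmax ≤ S.g₀ ∧ τmax ≤ S.δ ∧ τmax ≤ (min S.δ (min (Real.sqrt (1 / (2 * (S.b + S.C * (S.δ + S.R))))) (Real.sqrt ((1 - S.θ') * S.R / S.C)))) ∧
    ∀ τ₀ : ℝ, 0 < τ₀ → τ₀ ≤ τmax →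
    (∃ (g : ℕ → ℝ) (k : ℕ → ℕ) (t : ℝ), (∀ j, g j ∈ Set.Ioc 0 S.g₀) ∧
      (∀ j, ∀ i ≤ k j, (S.F^[i] (g j, S.yW (g j))).1 ∈ Set.Icc 0 τ₀ ∧
        ‖(S.F^[i] (g j, S.yW (g j))).2‖ ≤ S.R) ∧
      Tendsto k atTop atTop ∧ Tendsto (fun j => (S.F^[k j] (g j, S.yW (g j))).1) atTop (𝓝 t)) ∧
    ∃ Q : ℝ → ℝ × S.E, (∀ t, Q t ∈ Set.Icc 0 S.δ ×ˢ Metric.closedBall (0 : S.E) S.R) ∧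
    ∀ (g : ℕ → ℝ) (k : ℕ → ℕ) (t : ℝ),
      (∀ j, g j ∈ Set.Ioc 0 S.g₀) →
      (∀ j, ∀ i ≤ k j, (S.F^[i] (g j, S.yW (g j))).1 ∈ Set.Icc 0 τ₀ ∧
        ‖(S.F^[i] (g j, S.yW (g j))).2‖ ≤ S.R) →
      Tendsto k atTop atTop →
      Tendsto (fun j => (S.F^[k j] (g j, S.yW (g j))).1) atTop (𝓝 t) →
      Tendsto (fun j => S.F^[k j] (g j, S.yW (g j))) atTop (𝓝 (Q t)) ∧
      ∀ (L n : ℕ) (σ : Fin n → YMSpecies G) (f : Fin n → 𝓢(EuclideanSpace ℝ (Fin 4), ℝ)),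
        IsOffDiagonal (SchwartzMap.tensorFin n fun i => ofRealTest (f i)) →
        Tendsto (fun j => wilsonCentredSchwinger r.ρ (S.betaOf (g j))
            ((M ^ (k j) * (2 * L + 1) - 1) / 2) (S.c (g j)) n σ
            (fun i => (blockDilate M)^[k j] (f i))) atTop
          (𝓝 (S.expect (Q t) (2 * L + 1) n σ f)) :=
  Summit.QuantumFields.YangMills.Theorems.BalabanStepParabolic.Negative.forced_scaling_limit_of_region S hM

end ForcedScalingLimit

/-! ### §P  PERIODIC FACE CONTACT (NEW, cycle 4, gen 4): the typed crux is FALSE modulo `FaceContactHypothesis`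

(4c) asks continuity for tuples off-diagonal in `ℝ⁴ⁿ`, but the data pinned by (4a)+(4b) at deep orbit points are
sampled on the fundamental domain `box 4 L_k` of the PERIODIC torus `M^k(2L+1)`.  The bumps `f⁻`, `f⁺` at the face
points `(∓1/2,0,0,0)` of the unit domain (base torus `1`) are disjointly supported in `ℝ⁴` (so `(f⁻,f⁺)` IS admissible
in (4c), `isOffDiagonal_facePair`) while their periodisations touch across the glued face: the `M^k`-dilated samples
are `≡ 1` on the opposite faces `x₀ = ∓L_k` for `|x'ᵢ| ≤ M^k/16` (`dist_sample_le`), which are torus nearest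
neighbours.  By `wilsonCentredSchwinger_two_eq` the centred curvature two-point function is `∑ₓ∑_y f⁻f⁺ Cov(P_x,P_y)`;
under (H₁) `PlaquetteCovNonneg` (all site covariances `≥ 0` at large `β` — GKS-type, OPEN for non-abelian LGT) and
(H₂) `AdjacentCovLowerBound` (nearest-neighbour covariance `≥ c β^{-p}` — perturbatively `p = 2`, OPEN at weak
coupling) it is `≥ (2⌊M^k/16⌋+1)³ c β^{-p}` (`faceData_lower_bound`), which tends to `+∞` along `β_i = max B (i/A)`,
`k_i = i`, contradicting `overtuned_trivial_of_nonempty` (drefute's `Negative/OverTunedLimit`: every inhabitant at odd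
`M` forces these data `→ 0`).  Hence `not_nonempty_of_faceContact` (no inhabitant at ANY odd `M`) and
`balabanStepParabolic_false_of_faceContactHypothesis : FaceContactHypothesis → ¬ BalabanStepParabolic` (`SU(2)`,
fundamental Wilson action; `SU(2)` certified simple in the tree).  CLASS: refuted-MISSTATED modulo H — repair (4c) by
`∀ i, tsupport (f i) ⊆ {u | ∀ j, |u j| < S/2}` (dilation-compatible); the witness misses the repair.  The same clause
sits verbatim in `RegulatorChart` (line object).  Proposed for landing as `Negative/FaceContactSetup` +
`Negative/FaceContact` (negative lemma modulo `FaceContactHypothesis`); the block below is the same development,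
self-contained in this work file. -/

section FaceContact

/-! #### Site covariances of the action density on the torus and the two hypotheses -/

section Cov

variable {G : Type} [Group G] [TopologicalSpace G] [IsTopologicalGroup G] [CompactSpace G]
  [MeasurableSpace G] [BorelSpace G] (r : LatticeRep G)

/-- `P_x(U)`: the action density (curvature species `r.curvature.F = actionDensity r.ρ`) at the site `x ∈ ℤ⁴` of
the periodic lift of the torus configuration `U` (torus of side `2L+1`). -/
def siteP (L : ℕ) (x : Fin 4 → ℤ) (U : GaugeConfig 4 (2 * L + 1) G) : ℝ :=
  actionDensity r.ρ (configShift (-x) (torusLift (2 * L + 1) U))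

/-- `Cov_{β,2L+1}(P_x, P_y) = ∫ (P_x − ⟨P⟩)(P_y − ⟨P⟩) dμ_β`: the covariance of the action densities at two sites under
the torus Wilson state (centring by the torus Wilson mean `wilsonTorusMean`, as in `wilsonCentredSchwinger`). -/
def siteCov (β : ℝ) (L : ℕ) (x y : Fin 4 → ℤ) : ℝ :=
  ∫ U, (siteP r L x U - wilsonTorusMean r.ρ β L (actionDensity r.ρ)) *
      (siteP r L y U - wilsonTorusMean r.ρ β L (actionDensity r.ρ))
    ∂(wilsonMeasure (d := 4) (L := 2 * L + 1) r.ρ β)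

/-- **(H₁) Plaquette-covariance positivity** (a Griffiths/GKS-II-type correlation inequality for the action density of
the Wilson theory of `(G, r)` at large `β` on large odd tori): `0 ≤ Cov_{β,2L+1}(P_x, P_y)` for all sites.  Known for
abelian/ferromagnetic models; OPEN for non-abelian lattice gauge theory (no Griffiths inequalities are available);
its leading weak-coupling (Gaussian) approximation is a sum of squares. -/
def PlaquetteCovNonneg : Prop :=
  ∃ β₁ : ℝ, ∃ L₁ : ℕ, ∀ β : ℝ, β₁ ≤ β → ∀ L : ℕ, L₁ ≤ L → ∀ x y : Fin 4 → ℤ, 0 ≤ siteCov r β L x y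

/-- **(H₂) Nearest-neighbour covariance lower bound** at weak coupling, uniformly in the volume:
`c β^{-p} ≤ Cov_{β,2L+1}(P_x, P_{x+e₀})`.  Perturbatively the left side is `const(G,r)·β⁻² (1 + O(β⁻¹))` with a
positive constant (neighbouring action densities share links); a proof in `d = 4` at weak coupling is OPEN. -/
def AdjacentCovLowerBound : Prop :=
  ∃ c : ℝ, 0 < c ∧ ∃ p : ℕ, ∃ β₁ : ℝ, ∃ L₁ : ℕ, ∀ β : ℝ, β₁ ≤ β → ∀ L : ℕ, L₁ ≤ L →
    ∀ x : Fin 4 → ℤ, c / β ^ p ≤ siteCov r β L x (x + Pi.single 0 1)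

omit [IsTopologicalGroup G] [CompactSpace G] [BorelSpace G] in
/-- The action density of the shifted lift in terms of torus plaquette deficits: it depends on `x` only through
`x mod (2L+1)`. [folklore] -/
theorem siteP_eq (L : ℕ) (x : Fin 4 → ℤ) (U : GaugeConfig 4 (2 * L + 1) G) :
    siteP r L x U = Summit.QuantumFields.YangMills.Theorems.BalabanStepParabolic.Negative.Pmax r -
      ∑ i : Fin 4, ∑ j : Fin 4, (if i < j then Summit.QuantumFields.YangMills.Theorems.BalabanStepParabolic.Negative.pDef r U (Torus.proj (2 * L + 1) x) i j else 0) := by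
  have h := Summit.QuantumFields.YangMills.Theorems.BalabanStepParabolic.Negative.Pmax_sub_actionDensity r (2 * L + 1) U x
  unfold siteP
  linarith

omit [IsTopologicalGroup G] [CompactSpace G] [BorelSpace G] in
/-- **Periodicity**: sites with the same image on the torus carry the same action density. [folklore] -/
theorem siteP_eq_of_proj_eq (L : ℕ) {x y : Fin 4 → ℤ} (h : Torus.proj (2 * L + 1) x = Torus.proj (2 * L + 1) y) :
    siteP r L x = siteP r L y := by
  funext U
  rw [siteP_eq, siteP_eq, h]

omit [Group G] [TopologicalSpace G] [IsTopologicalGroup G] [CompactSpace G] [MeasurableSpace G]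
  [BorelSpace G] in
/-- Translating a site by a multiple of the period does not change its torus image. [folklore] -/
theorem proj_add_period (T : ℕ) (x v : Fin 4 → ℤ) :
    Torus.proj T (x + (T : ℤ) • v) = Torus.proj T x := by
  funext i
  simp only [Torus.proj_apply, Pi.add_apply, Pi.smul_apply, smul_eq_mul, Int.cast_add, Int.cast_mul,
    Int.cast_natCast, ZMod.natCast_self, zero_mul, add_zero]

/-- Covariances are symmetric. [folklore] -/
theorem siteCov_comm (β : ℝ) (L : ℕ) (x y : Fin 4 → ℤ) : siteCov r β L x y = siteCov r β L y x := by
  unfold siteCov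
  congr 1
  funext U
  ring

/-- Periodicity of covariances in the second site. [folklore] -/
theorem siteCov_congr_right (β : ℝ) (L : ℕ) (x : Fin 4 → ℤ) {y y' : Fin 4 → ℤ}
    (h : Torus.proj (2 * L + 1) y = Torus.proj (2 * L + 1) y') :
    siteCov r β L x y = siteCov r β L x y' := by
  unfold siteCov
  have e := siteP_eq_of_proj_eq r L h
  simp_rw [e]

/-- The action density is bounded. [folklore] -/
theorem exists_siteP_bound : ∃ C : ℝ, 0 ≤ C ∧ ∀ (L : ℕ) (x : Fin 4 → ℤ) (U : GaugeConfig 4 (2 * L + 1) G),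
    |siteP r L x U| ≤ C := by
  obtain ⟨C, hC⟩ := r.curvature.bounded
  refine ⟨max C 0, le_max_right _ _, fun L x U => ?_⟩
  have h := hC (configShift (-x) (torusLift (2 * L + 1) U))
  rw [Summit.QuantumFields.YangMills.Theorems.BalabanStepParabolic.Negative.curvature_F] at h
  exact h.trans (le_max_left _ _)

/-- The action density of the shifted lift is measurable on torus configurations. [folklore] -/
theorem measurable_siteP (L : ℕ) (x : Fin 4 → ℤ) : Measurable (siteP r L x) := by
  haveI := Summit.QuantumFields.YangMills.Theorems.BalabanStepParabolic.Negative.secondCountable_of_latticeRep r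
  have hm := r.curvature.measurable
  rw [Summit.QuantumFields.YangMills.Theorems.BalabanStepParabolic.Negative.curvature_F] at hm
  exact hm.comp ((configShift (-x)).measurable.comp (measurable_torusLift _))

/-- Integrability of products of centred action densities under the torus Wilson state. [folklore] -/
theorem integrable_centred_mul (β : ℝ) (L : ℕ) (x y : Fin 4 → ℤ) (m a b : ℝ) :
    Integrable (fun U => (a * (siteP r L x U - m)) * (b * (siteP r L y U - m)))
      (wilsonMeasure (d := 4) (L := 2 * L + 1) r.ρ β) := by
  obtain ⟨C, hC0, hC⟩ := exists_siteP_bound r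
  refine Summit.QuantumFields.YangMills.Theorems.BalabanStepParabolic.Negative.integrable_wilson_of_bound r L β ?_ (C := |a| * (C + |m|) * (|b| * (C + |m|))) fun U => ?_
  · exact (((measurable_siteP r L x).sub_const m).const_mul a).mul
      (((measurable_siteP r L y).sub_const m).const_mul b)
  · rw [abs_mul, abs_mul, abs_mul]
    have hx : |siteP r L x U - m| ≤ C + |m| := (abs_sub _ _).trans (add_le_add (hC L x U) le_rfl)
    have hy : |siteP r L y U - m| ≤ C + |m| := (abs_sub _ _).trans (add_le_add (hC L y U) le_rfl)
    gcongr

end Cov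

/-! #### The face-touching pair of test functions -/

section Bumps

/-- The face point `(s, 0, 0, 0)` of `ℝ⁴`. -/
def facePt (s : ℝ) : EuclideanSpace ℝ (Fin 4) := WithLp.toLp 2 (Pi.single 0 s)

/-- First coordinate of the face point. [folklore] -/
@[simp] theorem facePt_apply_zero (s : ℝ) : facePt s 0 = s := by simp [facePt]

/-- Transverse coordinates of the face point vanish. [folklore] -/
@[simp] theorem facePt_apply_succ (s : ℝ) (i : Fin 3) : facePt s i.succ = 0 := by
  simp [facePt, Fin.succ_ne_zero]

/-- The two face points are at distance `1`. [folklore] -/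
theorem dist_facePt : dist (facePt (-(1 / 2))) (facePt (1 / 2)) = 1 := by
  rw [EuclideanSpace.dist_eq, Fin.sum_univ_succ]
  simp only [facePt_apply_zero, facePt_apply_succ, dist_self, ne_eq, OfNat.ofNat_ne_zero,
    not_false_eq_true, zero_pow, Finset.sum_const_zero, add_zero]
  rw [Real.dist_eq, show (-(1 / 2) - 1 / 2 : ℝ) = -1 by norm_num, abs_neg, abs_one, one_pow, Real.sqrt_one]

/-- A smooth bump around the face point `(s,0,0,0)`: `= 1` on the closed ball of radius `1/8`, supported in the
ball of radius `1/4`, with values in `[0, 1]` (Mathlib `ContDiffBump`). -/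
def faceBump (s : ℝ) : ContDiffBump (facePt s) := ⟨1 / 8, 1 / 4, by norm_num, by norm_num⟩

/-- The face bump as a real Schwartz test function. -/
def faceTest (s : ℝ) : 𝓢(EuclideanSpace ℝ (Fin 4), ℝ) :=
  (faceBump s).hasCompactSupport.toSchwartzMap (faceBump s).contDiff

/-- Values of the face test function. [folklore] -/
theorem faceTest_apply (s : ℝ) (u : EuclideanSpace ℝ (Fin 4)) : faceTest s u = faceBump s u := rfl

/-- The face test function is non-negative. [folklore] -/
theorem faceTest_nonneg (s : ℝ) (u : EuclideanSpace ℝ (Fin 4)) : 0 ≤ faceTest s u := (faceBump s).nonneg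

/-- The face test function equals `1` on the plateau ball of radius `1/8`. [folklore] -/
theorem faceTest_eq_one (s : ℝ) {u : EuclideanSpace ℝ (Fin 4)} (hu : dist u (facePt s) ≤ 1 / 8) :
    faceTest s u = 1 :=
  (faceBump s).one_of_mem_closedBall (Metric.mem_closedBall.2 hu)

/-- The support of the face test function is the closed ball of radius `1/4`. [folklore] -/
theorem tsupport_faceTest (s : ℝ) :
    tsupport (faceTest s : EuclideanSpace ℝ (Fin 4) → ℝ) = Metric.closedBall (facePt s) (1 / 4) :=
  (faceBump s).tsupport_eq

/-- **The face-touching pair** `(f⁻, f⁺)`: bumps at the two face points `(∓1/2, 0, 0, 0)` of the unit fundamental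
domain `[-1/2, 1/2]⁴` of the base torus `2·0+1`. -/
def facePair : Fin 2 → 𝓢(EuclideanSpace ℝ (Fin 4), ℝ) := ![faceTest (-(1 / 2)), faceTest (1 / 2)]

/-- The two supports are disjoint IN `ℝ⁴` (closed balls of radius `1/4` at distance `1`). [folklore] -/
theorem disjoint_tsupport_facePair :
    Disjoint (tsupport (faceTest (-(1 / 2)) : EuclideanSpace ℝ (Fin 4) → ℝ))
      (tsupport (faceTest (1 / 2) : EuclideanSpace ℝ (Fin 4) → ℝ)) := by
  rw [tsupport_faceTest, tsupport_faceTest]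
  exact Metric.closedBall_disjoint_closedBall (by rw [dist_facePt]; norm_num)

/-- **The pair is off-diagonal** in the sense of (4c) (`⁰𝒮(ℝ⁴ˣ²)`). [folklore] -/
theorem isOffDiagonal_facePair :
    IsOffDiagonal (SchwartzMap.tensorFin 2 fun i => ofRealTest (facePair i)) :=
  Summit.QuantumFields.YangMills.Theorems.ContinuumLimitOnTrajectory.Negative.isOffDiagonal_Tn facePair
    (Summit.QuantumFields.YangMills.Theorems.ContinuumLimitOnTrajectory.Negative.pairwise_two disjoint_tsupport_facePair)

/-- Values of `k`-fold block-dilated test functions: `((blockDilate M)^[k] f) u = f (M^{-k} u)`. [folklore] -/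
theorem blockDilate_iterate_apply {M : ℕ} (hM : M ≠ 0) (k : ℕ) (f : 𝓢(EuclideanSpace ℝ (Fin 4), ℝ))
    (u : EuclideanSpace ℝ (Fin 4)) : ((blockDilate M)^[k] f) u = f ((((M : ℝ) ^ k)⁻¹) • u) := by
  induction k generalizing u with
  | zero => simp
  | succ k ih =>
    rw [Function.iterate_succ_apply', blockDilate_apply hM, ih, smul_smul, pow_succ, mul_inv]

end Bumps

/-! #### The two-point function of the curvature species as a double sum of site covariances -/

section Expansion

variable {G : Type} [Group G] [TopologicalSpace G] [IsTopologicalGroup G] [CompactSpace G]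
  [MeasurableSpace G] [BorelSpace G] (r : LatticeRep G)

/-- The smeared centred curvature field at unit scale and unit normalisation is `∑ₓ g(x) (P_x − ⟨P⟩)`. [folklore] -/
theorem smeared_curvature_eq (β : ℝ) (L : ℕ) (g : 𝓢(EuclideanSpace ℝ (Fin 4), ℝ))
    (U : GaugeConfig 4 (2 * L + 1) G) :
    smearedLatticeField r.curvature.F (box 4 L) 1 1 (wilsonTorusMean r.ρ β L r.curvature.F) g
        (torusLift (2 * L + 1) U) =
      ∑ x ∈ box 4 L, g (siteToE x) * (siteP r L x U - wilsonTorusMean r.ρ β L (actionDensity r.ρ)) := by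
  simp [smearedLatticeField, siteP, Summit.QuantumFields.YangMills.Theorems.BalabanStepParabolic.Negative.curvature_F]

/-- **Double-sum expansion**: the centred curvature two-point function on the torus `2L+1` with unit
normalisations is `∑ₓ ∑_y g₀(x) g₁(y) Cov_{β,2L+1}(P_x, P_y)`. [folklore] -/
theorem wilsonCentredSchwinger_two_eq (β : ℝ) (L : ℕ) (g : Fin 2 → 𝓢(EuclideanSpace ℝ (Fin 4), ℝ)) :
    wilsonCentredSchwinger r.ρ β L (fun _ => 1) 2 (fun _ => r.curvature) g =
      ∑ x ∈ box 4 L, ∑ y ∈ box 4 L, g 0 (siteToE x) * g 1 (siteToE y) * siteCov r β L x y := by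
  unfold wilsonCentredSchwinger
  simp only [Fin.prod_univ_two, smeared_curvature_eq]
  set m := wilsonTorusMean r.ρ β L (actionDensity r.ρ) with hm
  simp_rw [Finset.sum_mul_sum]
  rw [integral_finsetSum _ (fun x _ => integrable_finsetSum _ fun y _ =>
    integrable_centred_mul r β L x y m _ _)]
  refine Finset.sum_congr rfl fun x _ => ?_
  rw [integral_finsetSum _ (fun y _ => integrable_centred_mul r β L x y m _ _)]
  refine Finset.sum_congr rfl fun y _ => ?_
  unfold siteCov
  rw [← integral_const_mul]
  refine integral_congr_ae (ae_of_all _ fun U => ?_)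
  simp only
  ring

end Expansion

/-! #### Geometry of the face samples -/

section Geometry

/-- Face sites `(a, x') ∈ ℤ × ℤ³`. -/
def faceSite (a : ℤ) (x' : Fin 3 → ℤ) : Fin 4 → ℤ := Fin.cons a x'

/-- First coordinate of a face site. [folklore] -/
@[simp] theorem faceSite_zero (a : ℤ) (x' : Fin 3 → ℤ) : faceSite a x' 0 = a := by simp [faceSite]

/-- Transverse coordinates of a face site. [folklore] -/
@[simp] theorem faceSite_succ (a : ℤ) (x' : Fin 3 → ℤ) (i : Fin 3) : faceSite a x' i.succ = x' i := by
  simp [faceSite]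

/-- Face sites with a fixed first coordinate are parametrised injectively by their transverse coordinates. [folklore] -/
theorem faceSite_injective (a : ℤ) : Function.Injective (faceSite a) := fun x y h => by
  simpa [faceSite] using h

/-- Face sites of a box. [folklore] -/
theorem faceSite_mem_box {L : ℕ} {a : ℤ} {x' : Fin 3 → ℤ} (ha : -(L : ℤ) ≤ a ∧ a ≤ L)
    (hx : ∀ i, -(L : ℤ) ≤ x' i ∧ x' i ≤ L) : faceSite a x' ∈ box 4 L := by
  rw [Literature.Probability.LatticeModels.mem_box]
  refine Fin.cases ?_ (fun i => ?_)
  · simpa using ha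
  · simpa using hx i

/-- Opposite faces are torus neighbours: `(L+1, x') = (-L, x') + (2L+1)·e₀`. [folklore] -/
theorem faceSite_add_single (L : ℕ) (x' : Fin 3 → ℤ) :
    faceSite (L : ℤ) x' + Pi.single 0 1 = faceSite (-(L : ℤ)) x' + ((2 * L + 1 : ℕ) : ℤ) • Pi.single 0 1 := by
  funext i
  refine Fin.cases ?_ (fun j => ?_) i
  · simp; ring
  · simp [Fin.succ_ne_zero]

/-- **The dilated face samples lie on the plateau.** For `T ≥ 16`, transverse coordinates `|x'ᵢ| ≤ m ≤ T/16` and a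
first coordinate `a` with `(a/T − c)² ≤ (1/(2T))²`, the point `T⁻¹ (a, x')` is within `1/8` of the face point
`(c, 0, 0, 0)`. [folklore] -/
theorem dist_sample_le {T : ℕ} (hT : 16 ≤ T) {a : ℤ} {c : ℝ}
    (h0 : (((T : ℝ))⁻¹ * (a : ℝ) - c) ^ 2 ≤ (1 / 32) ^ 2) {m : ℕ} (hm : m ≤ T / 16)
    {x' : Fin 3 → ℤ} (hx : ∀ i, -(m : ℤ) ≤ x' i ∧ x' i ≤ m) :
    dist (((T : ℝ))⁻¹ • siteToE (faceSite a x')) (facePt c) ≤ 1 / 8 := by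
  have hT0 : (0 : ℝ) < T := by exact_mod_cast (show 0 < T by omega)
  have hmT : (m : ℝ) ≤ (T : ℝ) / 16 := by
    have h1 : (m : ℝ) ≤ ((T / 16 : ℕ) : ℝ) := by exact_mod_cast hm
    exact h1.trans (Nat.cast_div_le)
  have h2 : ∀ i, (((T : ℝ))⁻¹ * (x' i : ℝ)) ^ 2 ≤ (1 / 16) ^ 2 := fun i => by
    have hxi : |(x' i : ℝ)| ≤ m := by
      rw [← Int.cast_abs]; exact_mod_cast abs_le.2 (hx i)
    have hle : |((T : ℝ))⁻¹ * (x' i : ℝ)| ≤ 1 / 16 := by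
      rw [abs_mul, abs_inv, Nat.abs_cast]
      calc ((T : ℝ))⁻¹ * |(x' i : ℝ)| ≤ ((T : ℝ))⁻¹ * ((T : ℝ) / 16) :=
            mul_le_mul_of_nonneg_left (hxi.trans hmT) (by positivity)
        _ = 1 / 16 := by field_simp
    calc (((T : ℝ))⁻¹ * (x' i : ℝ)) ^ 2 = |((T : ℝ))⁻¹ * (x' i : ℝ)| ^ 2 := (sq_abs _).symm
      _ ≤ (1 / 16) ^ 2 := pow_le_pow_left₀ (abs_nonneg _) hle 2
  have hsum : ∑ i, dist ((((T : ℝ))⁻¹ • siteToE (faceSite a x')) i) (facePt c i) ^ 2 ≤ (1 / 8) ^ 2 := by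
    rw [Fin.sum_univ_succ]
    simp only [PiLp.smul_apply, siteToE_apply, faceSite_zero, faceSite_succ, facePt_apply_zero,
      facePt_apply_succ, smul_eq_mul, Real.dist_eq, sq_abs, sub_zero]
    have h3 : ∑ i : Fin 3, (((T : ℝ))⁻¹ * (x' i : ℝ)) ^ 2 ≤ ∑ _i : Fin 3, ((1 : ℝ) / 16) ^ 2 :=
      Finset.sum_le_sum fun i _ => h2 i
    have h4 : ∑ _i : Fin 3, ((1 : ℝ) / 16) ^ 2 = 3 * (1 / 16) ^ 2 := by simp
    rw [h4] at h3
    have : ((1 : ℝ) / 32) ^ 2 + 3 * (1 / 16) ^ 2 ≤ (1 / 8) ^ 2 := by norm_num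
    linarith
  rw [EuclideanSpace.dist_eq]
  calc Real.sqrt (∑ i, dist ((((T : ℝ))⁻¹ • siteToE (faceSite a x')) i) (facePt c i) ^ 2)
      ≤ Real.sqrt ((1 / 8) ^ 2) := Real.sqrt_le_sqrt hsum
    _ = 1 / 8 := Real.sqrt_sq (by norm_num)

/-- `(1/(2T))² ≤ (1/32)²` for `T ≥ 16`. [folklore] -/
theorem inv_two_T_sq_le {T : ℕ} (hT16 : 16 ≤ T) : (1 / (2 * (T : ℝ))) ^ 2 ≤ (1 / 32) ^ 2 := by
  have h32 : (1 : ℝ) / (2 * T) ≤ 1 / 32 :=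
    one_div_le_one_div_of_le (by norm_num) (by exact_mod_cast (show 32 ≤ 2 * T by omega))
  exact pow_le_pow_left₀ (by positivity) h32 2

/-- The first-coordinate condition at the left face `a = -L`, `c = -1/2` of the torus `2L+1 = T ≥ 16`. [folklore] -/
theorem face_coord_neg {T L : ℕ} (hT : 2 * L + 1 = T) (hT16 : 16 ≤ T) :
    (((T : ℝ))⁻¹ * (((-(L : ℤ)) : ℤ) : ℝ) - (-(1 / 2))) ^ 2 ≤ (1 / 32) ^ 2 := by
  have hTr : (T : ℝ) = 2 * L + 1 := by exact_mod_cast hT.symm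
  have hL : (2 * (L : ℝ) + 1) ≠ 0 := by positivity
  have hkey : ((T : ℝ))⁻¹ * (((-(L : ℤ)) : ℤ) : ℝ) - (-(1 / 2)) = 1 / (2 * T) := by
    rw [hTr]
    push_cast
    field_simp
    ring
  rw [hkey]
  exact inv_two_T_sq_le hT16

/-- The first-coordinate condition at the right face `a = L`, `c = 1/2`. [folklore] -/
theorem face_coord_pos {T L : ℕ} (hT : 2 * L + 1 = T) (hT16 : 16 ≤ T) :
    (((T : ℝ))⁻¹ * (((L : ℤ) : ℤ) : ℝ) - 1 / 2) ^ 2 ≤ (1 / 32) ^ 2 := by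
  have hTr : (T : ℝ) = 2 * L + 1 := by exact_mod_cast hT.symm
  have hL : (2 * (L : ℝ) + 1) ≠ 0 := by positivity
  have hkey : ((T : ℝ))⁻¹ * (((L : ℤ) : ℤ) : ℝ) - 1 / 2 = -(1 / (2 * T)) := by
    rw [hTr]
    push_cast
    field_simp
    ring
  rw [hkey, neg_sq]
  exact inv_two_T_sq_le hT16

end Geometry


/-! #### The lower bound and the contradiction -/

section Contradiction

variable {G : Type} [Group G] [TopologicalSpace G] [IsTopologicalGroup G] [CompactSpace G]
  [MeasurableSpace G] [BorelSpace G] (r : LatticeRep G) {M : ℕ}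

/-- **Face-contact lower bound.** Under (H₁), (H₂) at `β`, on the torus `T = M^k = 2L_k+1 ≥ 16` (odd `M`) the
centred curvature two-point function of the `k`-fold dilated face pair is at least
`(2⌊T/16⌋+1)³ · c β^{-p}`: the double sum of `wilsonCentredSchwinger_two_eq` has non-negative terms, and the
`(2⌊T/16⌋+1)³` torus-nearest-neighbour face pairs `((-L_k, x'), (L_k, x'))` carry weight `1 · 1` and covariance
`≥ c β^{-p}`. [folklore] -/
theorem faceData_lower_bound (hM : Odd M) (hM0 : M ≠ 0)
    {β₁ : ℝ} {L₁ : ℕ} (h₁ : ∀ β : ℝ, β₁ ≤ β → ∀ L : ℕ, L₁ ≤ L → ∀ x y : Fin 4 → ℤ, 0 ≤ siteCov r β L x y)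
    {c : ℝ} {p : ℕ} {β₂ : ℝ} {L₂ : ℕ}
    (h₂ : ∀ β : ℝ, β₂ ≤ β → ∀ L : ℕ, L₂ ≤ L → ∀ x : Fin 4 → ℤ, c / β ^ p ≤ siteCov r β L x (x + Pi.single 0 1))
    {k : ℕ} (hk16 : 16 ≤ M ^ k) (hkL : 2 * max L₁ L₂ + 1 ≤ M ^ k) {β : ℝ} (hβ₁ : β₁ ≤ β) (hβ₂ : β₂ ≤ β) :
    ((2 * (M ^ k / 16) + 1 : ℕ) : ℝ) ^ 3 * (c / β ^ p) ≤
      wilsonCentredSchwinger r.ρ β ((M ^ k - 1) / 2) (fun _ => 1) 2 (fun _ => r.curvature)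
        (fun j => (blockDilate M)^[k] (facePair j)) := by
  -- the torus `T = M^k = 2 Lk + 1`
  obtain ⟨Lk, h2Lk⟩ : ∃ Lk, 2 * Lk + 1 = M ^ k := by
    have h := Summit.QuantumFields.YangMills.Theorems.BalabanStepParabolic.Negative.pow_mul_odd_eq hM k 0
    exact ⟨_, by simpa using h.symm⟩
  have hLkdef : (M ^ k - 1) / 2 = Lk := by omega
  rw [hLkdef]
  have hL₁ : L₁ ≤ Lk := by omega
  have hL₂ : L₂ ≤ Lk := by omega
  generalize hmdef : M ^ k / 16 = m
  have hmT : m ≤ M ^ k / 16 := hmdef.ge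
  have hmLk : m ≤ Lk := by omega
  have hTcast : ((M : ℝ) ^ k)⁻¹ = (((M ^ k : ℕ) : ℝ))⁻¹ := by rw [Nat.cast_pow]
  -- expand
  rw [wilsonCentredSchwinger_two_eq]
  simp only [facePair, Matrix.cons_val_zero, Matrix.cons_val_one, blockDilate_iterate_apply hM0, hTcast]
  -- the face-pair injection and the summand over pairs (opaque names with defining equations)
  obtain ⟨e, he⟩ : ∃ e : (Fin 3 → ℤ) → (Fin 4 → ℤ) × (Fin 4 → ℤ),
      e = fun x' => (faceSite (-(Lk : ℤ)) x', faceSite (Lk : ℤ) x') := ⟨_, rfl⟩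
  have einj : Function.Injective e := by
    intro x y h
    rw [he] at h
    exact faceSite_injective _ (congrArg Prod.snd h)
  obtain ⟨Ψ, hΨ⟩ : ∃ Ψ : (Fin 4 → ℤ) × (Fin 4 → ℤ) → ℝ, Ψ = fun q =>
      faceTest (-(1 / 2)) ((((M ^ k : ℕ) : ℝ))⁻¹ • siteToE q.1) *
        faceTest (1 / 2) ((((M ^ k : ℕ) : ℝ))⁻¹ • siteToE q.2) * siteCov r β Lk q.1 q.2 := ⟨_, rfl⟩
  have hΨnn : ∀ q, 0 ≤ Ψ q := fun q => by
    rw [hΨ]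
    exact mul_nonneg (mul_nonneg (faceTest_nonneg _ _) (faceTest_nonneg _ _)) (h₁ β hβ₁ Lk hL₁ q.1 q.2)
  have hsub : (box 3 m).map ⟨e, einj⟩ ⊆ box 4 Lk ×ˢ box 4 Lk := by
    intro q hq
    rw [Finset.mem_map] at hq
    obtain ⟨x', hx', rfl⟩ := hq
    rw [Literature.Probability.LatticeModels.mem_box] at hx'
    have hx'' : ∀ i, -(Lk : ℤ) ≤ x' i ∧ x' i ≤ Lk := fun i => by
      have := hx' i; constructor <;> omega
    have hLk0 : -(Lk : ℤ) ≤ Lk ∧ (Lk : ℤ) ≤ Lk := by constructor <;> omega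
    have hLk1 : -(Lk : ℤ) ≤ -Lk ∧ -(Lk : ℤ) ≤ Lk := by constructor <;> omega
    show e x' ∈ box 4 Lk ×ˢ box 4 Lk
    rw [he]
    exact Finset.mem_product.2 ⟨faceSite_mem_box hLk1 hx'', faceSite_mem_box hLk0 hx''⟩
  -- each face pair contributes at least c / β^p
  have hterm : ∀ x' ∈ box 3 m, c / β ^ p ≤ Ψ (e x') := by
    intro x' hx'
    rw [Literature.Probability.LatticeModels.mem_box] at hx'
    have hplatm : faceTest (-(1 / 2)) ((((M ^ k : ℕ) : ℝ))⁻¹ • siteToE (faceSite (-(Lk : ℤ)) x')) = 1 :=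
      faceTest_eq_one _ (dist_sample_le hk16 (face_coord_neg h2Lk hk16) hmT hx')
    have hplatp : faceTest (1 / 2) ((((M ^ k : ℕ) : ℝ))⁻¹ • siteToE (faceSite (Lk : ℤ) x')) = 1 :=
      faceTest_eq_one _ (dist_sample_le hk16 (face_coord_pos h2Lk hk16) hmT hx')
    have hcov : c / β ^ p ≤ siteCov r β Lk (faceSite (-(Lk : ℤ)) x') (faceSite (Lk : ℤ) x') := by
      rw [siteCov_comm, siteCov_congr_right r β Lk (faceSite (Lk : ℤ) x')
        (y' := faceSite (Lk : ℤ) x' + Pi.single 0 1) ?_]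
      · exact h₂ β hβ₂ Lk hL₂ _
      · rw [faceSite_add_single, proj_add_period]
    rw [hΨ, he]
    simp only [hplatm, hplatp, one_mul]
    exact hcov
  -- assemble
  calc ((2 * m + 1 : ℕ) : ℝ) ^ 3 * (c / β ^ p)
      = ∑ _x' ∈ box 3 m, c / β ^ p := by
        rw [Finset.sum_const, nsmul_eq_mul, Literature.Probability.LatticeModels.card_box]; push_cast; ring
    _ ≤ ∑ x' ∈ box 3 m, Ψ (e x') := Finset.sum_le_sum hterm
    _ = ∑ q ∈ (box 3 m).map ⟨e, einj⟩, Ψ q := (Finset.sum_map (box 3 m) ⟨e, einj⟩ Ψ).symm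
    _ ≤ ∑ q ∈ box 4 Lk ×ˢ box 4 Lk, Ψ q :=
        Finset.sum_le_sum_of_subset_of_nonneg hsub fun q _ _ => hΨnn q
    _ = ∑ x ∈ box 4 Lk, ∑ y ∈ box 4 Lk, Ψ (x, y) := Finset.sum_product (box 4 Lk) (box 4 Lk) Ψ
    _ = _ := by simp only [hΨ]

/-- **No inhabitant at odd block factors under (H₁), (H₂).** Every inhabitant of `BalabanBanachStep G r M`, `M`
odd, forces the centred curvature two-point functions of ALL `ℝ⁸`-off-diagonal pairs — in particular of the
face-touching pair — to tend to `0` along `β_i = max B (i/A)`, `k_i = i` (`Summit.QuantumFields.YangMills.Theorems.BalabanStepParabolic.Negative.overtuned_trivial_of_nonempty`), while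
by `faceData_lower_bound` they are `≥ (M^i/16)³ c A^p i^{-p} → ∞`. [folklore] -/
theorem not_nonempty_of_faceContact (h₁ : PlaquetteCovNonneg r) (h₂ : AdjacentCovLowerBound r)
    (hM : Odd M) : ¬ Nonempty (BalabanBanachStep G r M) := by
  intro hS
  obtain ⟨S⟩ := hS
  have hM2 : 2 ≤ M := S.two_le_M
  have hM0 : M ≠ 0 := by omega
  have hM1 : 1 < M := by omega
  obtain ⟨β₁, L₁, h₁⟩ := h₁
  obtain ⟨c, hc, p, β₂, L₂, h₂⟩ := h₂
  obtain ⟨β₀, A, hA, hlim⟩ := Summit.QuantumFields.YangMills.Theorems.BalabanStepParabolic.Negative.overtuned_trivial_of_nonempty hM ⟨S⟩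
  -- the over-tuned sequence
  set B : ℝ := max (max β₀ β₁) (max β₂ 1) with hB
  set β : ℕ → ℝ := fun i => max B ((i : ℝ) / A) with hβ
  have hβB : ∀ i, B ≤ β i := fun i => le_max_left _ _
  have hβ₀ : ∀ i, β₀ ≤ β i := fun i =>
    ((le_max_left _ _).trans (le_max_left _ _)).trans (hβB i)
  have hβ₁ : ∀ i, β₁ ≤ β i := fun i =>
    ((le_max_right _ _).trans (le_max_left _ _)).trans (hβB i)
  have hβ₂ : ∀ i, β₂ ≤ β i := fun i =>
    ((le_max_left _ _).trans (le_max_right _ _)).trans (hβB i)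
  have hkA : ∀ i, ((i : ℕ) : ℝ) ≤ A * β i := fun i => by
    have h : (i : ℝ) / A ≤ β i := le_max_right _ _
    rwa [div_le_iff₀ hA, mul_comm] at h
  have hW := hlim β (fun i => i) hβ₀ tendsto_id hkA 0 1 facePair isOffDiagonal_facePair
  have hW' : Tendsto (fun i => wilsonCentredSchwinger r.ρ (β i) ((M ^ i - 1) / 2) (fun _ => 1) 2
      (fun _ => r.curvature) (fun j => (blockDilate M)^[i] (facePair j))) atTop (𝓝 0) := by
    simpa only [Nat.mul_zero, Nat.zero_add, Nat.mul_one] using hW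
  -- eventually the data are ≥ 1
  have hpow : Tendsto (fun n : ℕ => M ^ n) atTop atTop := tendsto_pow_atTop_atTop_of_one_lt hM1
  have hM3 : (1 : ℝ) < (M : ℝ) ^ 3 := by
    have : (1 : ℝ) < M := by exact_mod_cast hM1
    exact one_lt_pow₀ this (by norm_num)
  have hsmall : ∀ᶠ i : ℕ in atTop, (i : ℝ) ^ p / ((M : ℝ) ^ 3) ^ i ≤ c * A ^ p / 4096 :=
    (tendsto_pow_const_div_const_pow_of_one_lt p hM3).eventually (ge_mem_nhds (by positivity))
  have hbig : ∀ᶠ i : ℕ in atTop, B ≤ (i : ℝ) / A := by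
    have ht : Tendsto (fun i : ℕ => (i : ℝ) / A) atTop atTop :=
      tendsto_natCast_atTop_atTop.atTop_div_const hA
    exact ht.eventually_ge_atTop B
  have h16 : ∀ᶠ i : ℕ in atTop, 16 ≤ M ^ i := hpow.eventually_ge_atTop 16
  have hLL : ∀ᶠ i : ℕ in atTop, 2 * max L₁ L₂ + 1 ≤ M ^ i := hpow.eventually_ge_atTop _
  have hone : ∀ᶠ i : ℕ in atTop, (1 : ℝ) ≤ i := by
    filter_upwards [eventually_ge_atTop 1] with i hi
    exact_mod_cast hi
  have hev : ∀ᶠ i : ℕ in atTop, (1 : ℝ) ≤ wilsonCentredSchwinger r.ρ (β i) ((M ^ i - 1) / 2) (fun _ => 1) 2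
      (fun _ => r.curvature) (fun j => (blockDilate M)^[i] (facePair j)) := by
    filter_upwards [hsmall, hbig, h16, hLL, hone] with i hsm hbi h16i hLLi h1i
    have hβi : β i = (i : ℝ) / A := max_eq_right hbi
    have hlb := faceData_lower_bound r hM hM0 h₁ h₂ h16i hLLi (hβ₁ i) (hβ₂ i)
    refine le_trans ?_ hlb
    -- arithmetic: 1 ≤ (2m+1)^3 * (c / β^p)
    have hi0 : (0 : ℝ) < i := by linarith
    have hu : ((M : ℝ) ^ i) / 16 ≤ ((2 * (M ^ i / 16) + 1 : ℕ) : ℝ) := by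
      have hdiv : ((M ^ i : ℕ) : ℝ) / 16 - 1 ≤ ((M ^ i / 16 : ℕ) : ℝ) := by
        have := Nat.cast_div_le (α := ℝ) (m := M ^ i) (n := 16)
        have h' : ((M ^ i : ℕ) : ℝ) / 16 < ((M ^ i / 16 : ℕ) : ℝ) + 1 := by
          have := Nat.lt_div_mul_add (a := M ^ i) (b := 16) (by norm_num)
          have h'' : ((M ^ i : ℕ) : ℝ) < ((M ^ i / 16 : ℕ) : ℝ) * 16 + 16 := by exact_mod_cast this
          linarith
        linarith
      push_cast at hdiv ⊢
      linarith
    have hu0 : (0 : ℝ) ≤ ((M : ℝ) ^ i) / 16 := by positivity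
    have hcube : (((M : ℝ) ^ i) / 16) ^ 3 ≤ ((2 * (M ^ i / 16) + 1 : ℕ) : ℝ) ^ 3 :=
      pow_le_pow_left₀ hu0 hu 3
    have hMi : ((M : ℝ) ^ 3) ^ i = ((M : ℝ) ^ i) ^ 3 := by rw [← pow_mul, ← pow_mul, mul_comm]
    have hden : (0 : ℝ) < ((M : ℝ) ^ 3) ^ i := by positivity
    have hsm' : (i : ℝ) ^ p * 4096 ≤ c * A ^ p * ((M : ℝ) ^ i) ^ 3 := by
      rw [div_le_div_iff₀ hden (by norm_num)] at hsm
      rw [← hMi]; linarith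
    have hβp : c / β i ^ p = c * A ^ p / (i : ℝ) ^ p := by
      rw [hβi, div_pow]
      field_simp
    rw [hβp]
    have hip : (0 : ℝ) < (i : ℝ) ^ p := by positivity
    rw [mul_div_assoc', le_div_iff₀ hip, one_mul]
    calc (i : ℝ) ^ p ≤ (((M : ℝ) ^ i) / 16) ^ 3 * (c * A ^ p) := by
          have : (((M : ℝ) ^ i) / 16) ^ 3 * (c * A ^ p) = c * A ^ p * ((M : ℝ) ^ i) ^ 3 / 4096 := by ring
          rw [this, le_div_iff₀ (by norm_num : (0 : ℝ) < 4096)]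
          exact hsm'
      _ ≤ ((2 * (M ^ i / 16) + 1 : ℕ) : ℝ) ^ 3 * (c * A ^ p) :=
          mul_le_mul_of_nonneg_right hcube (by positivity)
  -- contradiction with the forced limit 0
  have hlt : ∀ᶠ i : ℕ in atTop, wilsonCentredSchwinger r.ρ (β i) ((M ^ i - 1) / 2) (fun _ => 1) 2
      (fun _ => r.curvature) (fun j => (blockDilate M)^[i] (facePair j)) < 1 :=
    hW'.eventually (gt_mem_nhds (by norm_num))
  obtain ⟨i, hi1, hi2⟩ := (hev.and hlt).exists
  linarith

/-- **The picked line's object dies with the crux under (H₁), (H₂)** (via the landed bridge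
`nonempty_balabanBanachStep_of_regulatorChart`). [folklore] -/
theorem not_nonempty_regulatorChart_of_faceContact (h₁ : PlaquetteCovNonneg r) (h₂ : AdjacentCovLowerBound r)
    (hM : Odd M) : ¬ Nonempty (RegulatorChart G r M) := fun ⟨𝒞⟩ =>
  not_nonempty_of_faceContact r h₁ h₂ hM (Summit.QuantumFields.YangMills.Theorems.BalabanStepParabolic.nonempty_balabanBanachStep_of_regulatorChart 𝒞)

end Contradiction

/-! #### The negative lemma for the crux: `SU(2)` with Wilson's fundamental action -/

section SU2

/-- Wilson's original model: the fundamental lattice representation of `SU(2)`. -/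
def su2Fundamental : LatticeRep (Matrix.specialUnitaryGroup (Fin 2) ℂ) :=
  ⟨2, fundamentalRep (Fin 2), continuous_fundamentalRep _, fundamentalRep_injective _,
    fundamentalRep_mem_unitaryGroup⟩

/-- **The face-contact hypothesis `H`** (precise, NOT constructible in the tree today): for `SU(2)` lattice gauge
theory with Wilson's fundamental action on large odd tori at large `β`, (H₁) the covariances of the action
densities at any two sites are non-negative and (H₂) at nearest-neighbour sites they are `≥ c β^{-p}` for some
`c > 0`, `p`.  (H₁) is a Griffiths-type inequality unknown for non-abelian gauge theories; (H₂) is the leading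
perturbative behaviour (`p = 2`), unproved at weak coupling in four dimensions. -/
def FaceContactHypothesis : Prop :=
  letI : MeasurableSpace (Matrix.specialUnitaryGroup (Fin 2) ℂ) := borel _
  haveI : BorelSpace (Matrix.specialUnitaryGroup (Fin 2) ℂ) := ⟨rfl⟩
  PlaquetteCovNonneg su2Fundamental ∧ AdjacentCovLowerBound su2Fundamental

/-- **`¬ BalabanStepParabolic` modulo the face-contact hypothesis.** Under `H` the typed crux is false: for
`G = SU(2)` (a certified compact simple Lie group, `isSimpleCompactGroup_specialUnitaryGroup_holds`) and Wilson's
fundamental action, `BalabanBanachStep G r M` is EMPTY for every odd `M` (`not_nonempty_of_faceContact`), so no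
threshold `M₀` works.  Classification: refuted-misstated modulo `H` — repair (4c) by restricting to tuples supported
in the open fundamental cube (module docstring); the face-touching witness misses the repaired statement. [folklore] -/
theorem balabanStepParabolic_false_of_faceContactHypothesis (h : FaceContactHypothesis) :
    ¬ Summit.QuantumFields.YangMills.Theses.ParabolicTrajectory.BalabanStepParabolic := by
  intro hcrux
  letI : MeasurableSpace (Matrix.specialUnitaryGroup (Fin 2) ℂ) := borel _
  haveI : BorelSpace (Matrix.specialUnitaryGroup (Fin 2) ℂ) := ⟨rfl⟩
  have hG : IsCompactSimpleLieGroup (Matrix.specialUnitaryGroup (Fin 2) ℂ) :=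
    isCompactSimpleLieGroup_specialUnitaryGroup isSimpleCompactGroup_specialUnitaryGroup_holds le_rfl
  obtain ⟨M₀, hM₀⟩ := hcrux (Matrix.specialUnitaryGroup (Fin 2) ℂ) hG su2Fundamental
  exact not_nonempty_of_faceContact su2Fundamental h.1 h.2 ⟨M₀, rfl⟩ (hM₀ (2 * M₀ + 1) (by omega))

/-- **The line's odd-`M` stub is false modulo `H` as well** (via the landed glue
`balabanStepParabolic_of_regulatorChartOdd`). [folklore] -/
theorem regulatorChartOdd_false_of_faceContactHypothesis (h : FaceContactHypothesis) :
    ¬ (∀ (G : Type) [Group G] [TopologicalSpace G] [IsTopologicalGroup G] [CompactSpace G],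
      IsCompactSimpleLieGroup G →
      letI : MeasurableSpace G := borel G
      haveI : BorelSpace G := ⟨rfl⟩
      ∀ (r : LatticeRep G), ∃ M₀ : ℕ, ∀ M : ℕ, M₀ ≤ M → Odd M → Nonempty (RegulatorChart G r M)) :=
  fun hline => balabanStepParabolic_false_of_faceContactHypothesis h
    (Summit.QuantumFields.YangMills.Theorems.BalabanStepParabolic.balabanStepParabolic_of_regulatorChartOdd hline)

end SU2

end FaceContact

end Summit.QuantumFields.YangMills.Cruxes.BalabanStepParabolic.Disproof

end
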